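import Literature.Barriers.CriticalPhenomena.NoExactBoundaryRelationZ2
import HarnessLib

/-!
# Barrier (SAWScalingLimit): the uniform `ℤ²` SAW observable satisfies no exact two-vertex (domino) stencil relation

Barrier catalogue `Literature/Barriers/CriticalPhenomena/` (D-0021), sub-problem `SAWScalingLimit`;
companion of `NienhuisWeightsExcludeVertexSAW` (ONE-VERTEX relations refuted:
`not_hasExactVertexRelationZ2`, `NoExactVertexRelationZ2SC_holds`), `NoExactPlaquetteRelationZ2`
(face relations), `NoExactVertexRelationZ2Stiffness`, `NoExactBoundaryRelationZ2` and
`NoExactStripRelationZ2Width`. It fills the scope caveat (b) "larger or multi-vertex stencils" of the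
first for the smallest multi-vertex stencil: the seven mid-edges adjacent to a domino `{v, v + e₀}`.

## What the sources print

* Duminil-Copin–Smirnov, *The connective constant of the honeycomb lattice equals `√(2+√2)`*,
  Ann. of Math. 175 (2012), Lemma 1: "If `x = x_c` and `σ = 5/8`, then `F` satisfies the following
  relation for every vertex `v ∈ V(Ω)`: `(p - v)F(p) + (q - v)F(q) + (r - v)F(r) = 0`, where `p, q, r`
  are the mid-edges of the three edges adjacent to `v`" — ONE vertex, three mid-edges, constant
  coefficients. Its `ℤ²` shape (one vertex, four mid-edges) is the tree's `ExactVertexRelationZ2`,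
  refuted for every `x ∈ (0,1)`, `σ` by `not_hasExactVertexRelationZ2`, whose barrier block lists as
  NOT excluded "larger or multi-vertex stencils".
* Glazman–Manolescu 2019 (arXiv:1708.00395), p. 1: the square-lattice walk "is not believed to be
  integrable, therefore it is not reasonable to expect … the existence of a well-behaved
  equivalent observable"; Beaton–Guttmann–Jensen 2012, p. 2: on the square lattice "there is no
  known appropriate parafermionic observable satisfying an identity like (1)".

## What is formalised (square lattice, the library's observable)

With `F = Literature.Probability.RandomPlanarGeometry.SAW.midEdgeParafermionicObservable Ω δ a x σ`
(vertex-rooted walks, weight `e^{-iσW} x^{#vertices}`), a discrete domain `Ω_δ`, a root `a ∈ Ω_δ` on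
its boundary and a horizontal domino `{v, v + e₀}` whose seven adjacent mid-edges are edges of `Ω_δ`
(slots `dominoBase`/`dominoDir`: `0` = the shared edge `{v, v+e₀}`, `1, 2, 3` = the edges of `v`
towards `e₁, -e₀, -e₁`, `4, 5, 6` = the edges of `v + e₀` towards `e₀, e₁, -e₁`):
* `dominoFunctionalZ2 Ω δ a v x σ c = Σ_{k<7} c_k F(slot_k)`, one free coefficient per slot;
* the technique class `ExactDominoRelationZ2 x σ c` (the quantifier shape of `ExactVertexRelationZ2`)
  and the barrier statement `NoExactDominoRelationZ2`: for `x ≠ 0` the class forces `c = 0`;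
* PROVED: `exactDominoRelationZ2_eq_zero` / `NoExactDominoRelationZ2_holds`, with the remarks
  `exactDominoRelationZ2_zero` and `exactDominoRelationZ2_zero_fugacity` (`x ≠ 0` is needed).
Vertical dominoes follow by the diagonal symmetry of `ℤ²` and are not restated. This is the
range-free form of the lane's pre-registered search class S-Z2-2a (seven-slot domino stencil,
predicted and found EMPTY on finite tables).

## Proof

Twenty-two instances: the tree `DP0` (the domino with its six outer lattice neighbours attached as
pendant leaves) and the domains obtained from it by closing one or two of the adjacent unit squares
(`DPa`/`DPb`: the square above/below the domino; `DPab`: both; `DPnw`, `DPne`, `DPse`, `DPsw`: a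
square hanging off one end through one extra vertex), each rooted at one of its boundary vertices,
arranged in eleven pairs exchanged by the rotation `R180` about the centre of the domino
(`NoDominoRelation.E_DP0_0_1 …`). As in `NoExactPlaquetteRelationZ2`, the observable at interior
mid-edges is evaluated by `NoDominoRelation.halfEdgeTerm_eq_sideSum` (simple paths whose last step did
not come from the far endpoint), so that each instance becomes the kernel-computable list
`NoDominoRelation.dominoTerms`, evaluated by `decide`. `R180` maps the stencil to itself (slots
`1 ↔ 6`, `2 ↔ 4`, `3 ↔ 5`) and preserves windings; sum and difference of the two relations of a pair
are relations for the symmetric unknowns `(2c₀, c₁ + c₆, c₂ + c₄, c₃ + c₅)` and the antisymmetric ones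
`(c₁ - c₆, c₂ - c₄, c₃ - c₅)`. In each sector a few maximal minors of the row matrix (coefficients in
`ℤ[x, t, t⁻¹]`, `t = e^{-iσπ/2}`), expanded by their cofactors (`NoDominoRelation.minor_sym1 …`), are
combined by explicit multipliers into a monomial `x^a t^b` (exact Nullstellensatz certificates over
`ℚ` found by linear algebra — symmetric sector: three minors, 32 multiplier terms, coefficients with
numerator `≤ 43` and denominator `≤ 2`; antisymmetric sector: five minors, 58 multiplier terms, numerators `≤ 7607`, denominators `≤ 60` — checked by
`linear_combination`, `cert_sym`, `cert_asym`), whence `c = 0` for `x ≠ 0`, `t ≠ 0`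
(`NoDominoRelation.core`).

Mechanism, informally (exact computations behind the choice of instances): the rows of the bare tree
`DP0` rooted at its six leaves are single monomials per slot — e.g. root `(0,1)`:
`(x²t, x, x²t⁻¹, x², x³t, x³t², x³)` — and already have rank `6` of `7` for generic `(x, t)`: they
force the two-vertex analogue of the discrete Cauchy–Riemann stencil. Rank `7` needs walks returning
around a closed unit square. The sparsest maximal minors are tiny (symmetric sector:
`x(1 + t⁸) - t²(1 + t⁴)` and `1 - x t⁶(1 - t⁴ + t⁸)`), but they share the spurious common zeros
`t²⁰ = 1`, `x = t²(1+t⁴)/(1+t⁸) ∈ {±1, ±(3 ± √5)/2, …}` (symmetric) and `(x, t) ∈ {(1,1), (-1,i), (1,-1)}`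
(antisymmetric, all sparse minors), at which the full row matrix nevertheless has full rank; one denser
minor through the doubly closed domain `DPab` removes them in each sector — the domino counterpart of
the `3 × 2` block in `NoExactBoundaryRelationZ2` ("`t²⁰ = 1, x = (3 ± √5)/2`-type points").

Conventions: `NoVertexRelation.tOf σ = e^{-iσπ/2}`; the phase of `m` signed quarter turns (left `= +1`)
is `NoBoundaryRelation.tpow (tOf σ) m`; integer coordinates `NoVertexRelation.ZZ`, plane sets
`NoVertexRelation.Omega E` with `meshDomain (Omega E) 1 = verts E` and edges `E` (`GoodEdgeList`;
edge lists need not be induced subgraphs of `ℤ²`), from `NienhuisWeightsExcludeVertexSAW.lean`; path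
lists `NoBoundaryRelation.pathsTo`, certificates `pathOK`, chain walks `mkWalk` from
`NoExactBoundaryRelationZ2.lean` (its private evaluation lemmas and those of
`NoExactPlaquetteRelationZ2.lean` are re-proved here, being private there).
-/

noncomputable section

open Real

namespace Literature.Barriers.CriticalPhenomena

open Literature.Probability.RandomPlanarGeometry.SAW Literature.Probability.LatticeModels
  Literature.Probability.Percolation

/-! ### The technique class: exact two-vertex (domino) stencil relations -/

/-- The base points of the seven mid-edges of the horizontal domino `{v, v + e₀}`: slots `0–3` sit at
`v` (directions `e₀, e₁, -e₀, -e₁`; slot `0` is the shared edge `{v, v + e₀}`), slots `4–6` at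
`v + e₀` (directions `e₀, e₁, -e₁`). [folklore] -/
def dominoBase (v : Site 2) : Fin 7 → Site 2 :=
  ![v, v, v, v, v + dirZ2 0, v + dirZ2 0, v + dirZ2 0]

/-- The lattice directions of the seven domino slots (see `dominoBase`). [folklore] -/
def dominoDir : Fin 7 → Fin 4 :=
  ![0, 1, 2, 3, 0, 1, 3]

/-- **The domino functional**: with `F = midEdgeParafermionicObservable Ω δ a x σ`, the weighted sum
`Σ_{k<7} c_k F({base_k, base_k + dir_k})` of the observable over the seven mid-edges adjacent to the
two vertices `v, v + e₀` of a horizontal domino (the shared edge counted once), one free coefficient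
`c_k ∈ ℂ` per slot — the two-vertex ("multi-vertex stencil") extension of the shape of
Duminil-Copin–Smirnov's vertex relation `(p - v)F(p) + (q - v)F(q) + (r - v)F(r) = 0`.
[cite: DuminilCopinSmirnov2012, Lemma 1 (shape of the relation, one vertex)] -/
def dominoFunctionalZ2 (Ω : Set ℂ) (δ : ℝ) (a v : Site 2) (x σ : ℝ) (c : Fin 7 → ℂ) : ℂ :=
  ∑ k : Fin 7, c k * midEdgeParafermionicObservable Ω δ a x σ s(dominoBase v k, dominoBase v k + dirZ2 (dominoDir k))

/-- **Technique class (explicit).** `ExactDominoRelationZ2 x σ c`: the slot-indexed coefficients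
`c : Fin 7 → ℂ` give an EXACT TWO-VERTEX (DOMINO) STENCIL RELATION, at fugacity `x` and spin `σ`,
for the uniform square-lattice SAW's mid-edge parafermionic observable: for every discrete domain
`Ω_δ ⊆ δℤ²`, every root `a ∈ Ω_δ` on its boundary (some lattice neighbour of `a` falls outside `Ω`)
and every horizontal domino `{v, v + e₀}` whose seven adjacent mid-edges are edges of `Ω_δ`,
`Σ_k c_k F(slot_k) = 0`. The one-vertex class `ExactVertexRelationZ2` (Duminil-Copin–Smirnov's
Lemma 1 shape, refuted on `ℤ²` by `not_hasExactVertexRelationZ2`) is the sub-case `c₄ = c₅ = c₆ = 0`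
restricted to dominoes; this class is its smallest multi-vertex extension (scope caveat (b) of
`NienhuisWeightsExcludeVertexSAW`: "larger or multi-vertex stencils").
[cite: DuminilCopinSmirnov2012, Lemma 1 (shape of the relation, one vertex)]
[cite: GlazmanManolescu2019, p. 1 (no well-behaved observable expected on the square lattice)] -/
def ExactDominoRelationZ2 (x σ : ℝ) (c : Fin 7 → ℂ) : Prop :=
  ∀ (Ω : Set ℂ) (δ : ℝ) (a v : Site 2), 0 < δ → a ∈ meshDomain Ω δ →
    (∃ w : Site 2, (zdGraph 2).Adj a w ∧ meshPoint δ w ∉ Ω) →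
    (∀ k : Fin 7, (discreteDomainGraph Ω δ).Adj (dominoBase v k) (dominoBase v k + dirZ2 (dominoDir k))) →
      dominoFunctionalZ2 Ω δ a v x σ c = 0

namespace NoDominoRelation

open NoVertexRelation NoBoundaryRelation Complex

variable {E : List (ZZ × ZZ)}

/-! ### Integer-coordinate bookkeeping -/

/-- `dirZ2` in integer coordinates. [folklore] -/
private theorem toSite_add_dirZ2 (p : ZZ) (i : Fin 4) : toSite p + dirZ2 i = toSite (p + dirZZ i) := by
  funext j; fin_cases i <;> fin_cases j <;> simp [toSite, dirZ2, dirZZ]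

/-- The base points of the seven domino slots at `v`, integer coordinates (`dominoBase` order). [folklore] -/
def baseZZ (v : ZZ) : Fin 7 → ZZ :=
  ![v, v, v, v, v + dirZZ 0, v + dirZZ 0, v + dirZZ 0]

/-- `dominoBase` in integer coordinates. [folklore] -/
private theorem dominoBase_toSite (v : ZZ) (k : Fin 7) : dominoBase (toSite v) k = toSite (baseZZ v k) := by
  fin_cases k <;> simp [dominoBase, baseZZ, toSite_add_dirZ2]

/-! ### Enumeration data (kernel-computable) -/

/-- The monomials `(k, n, m)` (`c_k x^n t^m`) of ONE half-edge term `z → w` put in slot `k`: one per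
simple path `r → z` of `Ω_E` whose last step did not come from `w` (the walk must not have used
the edge `{z, w}`), `n` = number of vertices of the path, `m` = its signed quarter turns continued
into the half-edge towards `w`. [folklore] -/
def sideTerms (E : List (ZZ × ZZ)) (fuel : ℕ) (r : ZZ) (k : Fin 7) (z w : ZZ) : List (Fin 7 × ℕ × ℤ) :=
  ((pathsTo E fuel r z).filter fun l => l.tail.head? ≠ some w).map fun l =>
    (k, l.length, quarterTurns (l.reverse ++ [w]))

/-- The monomials of the domino functional of `Ω_E` rooted at `r`, domino at `v`: for each slot
`k` (mid-edge from `base k` in direction `dominoDir k`) the two half-edge terms. [folklore] -/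
def dominoTerms (E : List (ZZ × ZZ)) (fuel : ℕ) (r v : ZZ) : List (Fin 7 × ℕ × ℤ) :=
  (List.finRange 7).flatMap fun k =>
    sideTerms E fuel r k (baseZZ v k) (baseZZ v k + dirZZ (dominoDir k)) ++
      sideTerms E fuel r k (baseZZ v k + dirZZ (dominoDir k)) (baseZZ v k)

/-- Side conditions for evaluating the half-edge term `z → w` by the enumeration (one Boolean,
checked by `decide` per instance): every listed path is a certified simple path `r → z`, the
contributing ones make unit steps without reversal up to the half-edge, no duplicates. [folklore] -/
def sideOK (E : List (ZZ × ZZ)) (fuel : ℕ) (r z w : ZZ) : Bool :=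
  ((pathsTo E fuel r z).all fun l =>
      pathOK E r z l && (decide (l.tail.head? = some w) || goodSteps (l.reverse ++ [w]))) &&
    decide ((pathsTo E fuel r z).Nodup)

/-- All side conditions of the domino evaluation. [folklore] -/
def dominoOK (E : List (ZZ × ZZ)) (fuel : ℕ) (r v : ZZ) : Bool :=
  (List.finRange 7).all fun k =>
    sideOK E fuel r (baseZZ v k) (baseZZ v k + dirZZ (dominoDir k)) &&
      sideOK E fuel r (baseZZ v k + dirZZ (dominoDir k)) (baseZZ v k)

/-! ### Generic facts (copied from the boundary-relation module, where they are private) -/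

/-- The phase of an integer number of quarter turns. [folklore] -/
private theorem cexp_quarter_int (σ : ℝ) (m : ℤ) :
    Complex.exp (-Complex.I * σ * (((m : ℤ) : ℝ) * (Real.pi / 2) : ℝ)) = tpow (tOf σ) m := by
  unfold tpow
  split_ifs with h
  · obtain ⟨k, rfl⟩ := Int.eq_ofNat_of_zero_le h
    rw [cexp_quarter_nat]; simp
  · obtain ⟨k, hk⟩ := Int.exists_eq_neg_ofNat (le_of_lt (not_le.1 h))
    subst hk
    rw [cexp_quarter_neg_nat]; simp

/-- Support of the chain walk. [folklore] -/
private theorem support_mkWalk (hG : GoodEdgeList E) : ∀ (v : ZZ) (l : List ZZ) (h : chainB E v l = true),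
    (mkWalk hG v l h).support = (v :: l).map toSite
  | _, [], _ => rfl
  | v, w :: rest, h => by
    simp only [mkWalk, SimpleGraph.Walk.support_cons, List.map_cons, List.cons.injEq, true_and]
    exact support_mkWalk hG w rest _

/-- A certified reversed vertex list is the support of a self-avoiding walk `r → z`. [folklore] -/
private theorem exists_saw_of_pathOK (hG : GoodEdgeList E) {r z : ZZ} {l : List ZZ} (h : pathOK E r z l = true) :
    ∃ γ : DomainSAW (Omega E) 1 (toSite r) (toSite z), (γ.walk.support.map ofSite).reverse = l := by
  unfold pathOK at h
  split at h
  · simp at h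
  · rename_i v rest hrev
    simp only [Bool.and_eq_true, decide_eq_true_eq] at h
    obtain ⟨⟨⟨rfl, hch⟩, hlast⟩, hnd⟩ := h
    subst hlast
    refine ⟨⟨mkWalk hG v rest hch, ?_⟩, ?_⟩
    · rw [SimpleGraph.Walk.isPath_def, support_mkWalk]
      exact hnd.map toSite_injective
    · change ((mkWalk hG v rest hch).support.map ofSite).reverse = l
      rw [support_mkWalk, List.map_map]
      have : (ofSite ∘ toSite) = id := funext ofSite_toSite
      rw [this, List.map_id, ← hrev, List.reverse_reverse]

/-- Summation over a `flatMap`. [folklore] -/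
private theorem sum_flatMap {α β : Type*} (L : List α) (f : α → List β) (g : β → ℂ) :
    ((L.flatMap f).map g).sum = (L.map fun a => ((f a).map g).sum).sum := by
  induction L with
  | nil => simp
  | cons a L ih => simp [List.flatMap_cons, ih]

/-- A sum of `if p then 0 else g` over a list is the sum of `g` over the sublist where `p` fails. [folklore] -/
private theorem sum_map_ite_eq_sum_filter {α : Type*} (L : List α) (p : α → Prop) [DecidablePred p] (g : α → ℂ) :
    (L.map fun a => if p a then 0 else g a).sum = ((L.filter fun a => ¬ p a).map g).sum := by
  induction L with
  | nil => simp
  | cons a L ih =>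
    by_cases ha : p a
    · simp [ha, ih]
    · simp [ha, ih]

/-! ### Which walks have used the edge `{z, w}`: the last step -/

/-- For a self-avoiding walk STARTING at `b`, the edge `{b, w}` is used iff `w` is the second vertex. [folklore] -/
private theorem mem_edges_iff_second {V : Type*} {G : SimpleGraph V} :
    ∀ {b a : V} (q : G.Walk b a), q.IsPath → ∀ w : V, (s(b, w) ∈ q.edges ↔ q.support.tail.head? = some w)
  | _, _, .nil, _, w => by simp
  | b, a, .cons' _ v _ h q', hq, w => by
      rw [SimpleGraph.Walk.cons_isPath_iff] at hq
      have hv : q'.support.head? = some v := by cases q' <;> simp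
      rw [SimpleGraph.Walk.edges_cons, SimpleGraph.Walk.support_cons, List.tail_cons, hv, List.mem_cons]
      constructor
      · rintro (he | he)
        · rcases Sym2.eq_iff.1 he with ⟨-, h2⟩ | ⟨h1, h2⟩
          · rw [h2]
          · rw [h2, h1]
        · exact absurd (SimpleGraph.Walk.fst_mem_support_of_mem_edges q' he) hq.2
      · intro hw
        have hvw : v = w := Option.some.inj hw
        exact Or.inl (by rw [hvw])

/-- For a self-avoiding walk ENDING at `z`, the edge `{z, w}` is used iff `w` is the vertex before
`z`, i.e. the second entry of the reversed (integer) vertex list. [folklore] -/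
private theorem mem_edges_iff_prev {G : SimpleGraph (Site 2)} {a z : Site 2} (p : G.Walk a z) (hp : p.IsPath)
    (w : ZZ) : s(z, toSite w) ∈ p.edges ↔ ((p.support.map ofSite).reverse).tail.head? = some w := by
  have h1 := mem_edges_iff_second p.reverse hp.reverse (toSite w)
  rw [SimpleGraph.Walk.edges_reverse, List.mem_reverse, SimpleGraph.Walk.support_reverse] at h1
  rw [h1, ← List.map_reverse, ← List.map_tail, List.head?_map]
  cases p.support.reverse.tail.head? with
  | none => simp
  | some s =>
    show some s = some (toSite w) ↔ some (ofSite s) = some w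
    simp only [Option.some.injEq]
    constructor
    · rintro rfl; exact ofSite_toSite w
    · rintro rfl; exact (toSite_ofSite s).symm

/-! ### Evaluating a half-edge term by the enumeration (far endpoint arbitrary) -/

/-- **Evaluation of a half-edge term by the path enumeration**, the far endpoint `w` being a
vertex of the domain or not: the half-edge term `z → w` of the observable rooted at the vertex
`r` is the sum, over the certified complete duplicate-free list of simple paths `r → z` whose
last step did not come from `w`, of `x^{#vertices} t^{quarter turns}`, `t = e^{-iσπ/2}`. [folklore] -/
private theorem halfEdgeTerm_eq_sideSum (hG : GoodEdgeList E) {r z : ZZ} (w : ZZ) (hr : r ∈ verts E)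
    {fuel : ℕ} (hfuel : (verts E).length ≤ fuel)
    (hokP : ∀ l ∈ pathsTo E fuel r z, pathOK E r z l = true)
    (hokG : ∀ l ∈ pathsTo E fuel r z, l.tail.head? ≠ some w → goodSteps (l.reverse ++ [w]) = true)
    (hnd : (pathsTo E fuel r z).Nodup) (x σ : ℝ) :
    halfEdgeTerm (Omega E) 1 (toSite r) x σ (toSite z) (toSite w) =
      (((pathsTo E fuel r z).filter fun l => l.tail.head? ≠ some w).map
        fun l => (x : ℂ) ^ l.length * tpow (tOf σ) (quarterTurns (l.reverse ++ [w]))).sum := by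
  classical
  set P := pathsTo E fuel r z with hP
  let S := DomainSAW (Omega E) 1 (toSite r) (toSite z)
  let φ : S → List ZZ := fun γ => (γ.walk.support.map ofSite).reverse
  have hφmem : ∀ γ : S, φ γ ∈ P := by
    intro γ
    simp only [hP, pathsTo, List.mem_filter, decide_eq_true_eq]
    refine ⟨by simpa using hG.support_mem_dfs γ (by simpa using hr) hfuel, ?_⟩
    show ((γ.walk.support.map ofSite).reverse).head? = some z
    rw [head?_reverse_map_support, ofSite_toSite]
  have hφinj : Function.Injective φ := by
    intro γ γ' h
    apply DomainSAW_eq_of_support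
    have h' := congrArg List.reverse h
    simp only [φ, List.reverse_reverse] at h'
    exact List.map_injective_iff.2 ofSite_injective h'
  haveI : Finite S := Finite.of_injective (fun γ => (⟨φ γ, hφmem γ⟩ : {l // l ∈ P})) fun γ γ' h =>
    hφinj (congrArg Subtype.val h)
  haveI : Fintype S := Fintype.ofFinite S
  let g : List ZZ → ℂ := fun l => (x : ℂ) ^ l.length * tpow (tOf σ) (quarterTurns (l.reverse ++ [w]))
  let Gf : List ZZ → ℂ := fun l => if l.tail.head? = some w then 0 else g l
  have hterm : ∀ γ : S,
      (if s(toSite z, toSite w) ∈ γ.walk.edges then 0 else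
        Complex.exp (-Complex.I * σ *
          (winding (γ.walk.support.map (meshPoint 1) ++ [medialPoint 1 s(toSite z, toSite w)]) : ℝ)) *
          (x : ℂ) ^ (γ.length + 1)) = Gf (φ γ) := by
    intro γ
    have hedge : s(toSite z, toSite w) ∈ γ.walk.edges ↔ (φ γ).tail.head? = some w :=
      mem_edges_iff_prev γ.walk γ.isPath w
    by_cases hprev : (φ γ).tail.head? = some w
    · rw [if_pos (hedge.2 hprev)]
      simp only [Gf, if_pos hprev]
    · rw [if_neg (fun he => hprev (hedge.1 he))]
      simp only [Gf, if_neg hprev]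
      have hgood : goodSteps (γ.walk.support.map ofSite ++ [ofSite (toSite w)]) = true := by
        have := hokG (φ γ) (hφmem γ) hprev
        simpa [φ] using this
      rw [winding_support_medial γ.walk (toSite w) hgood, cexp_quarter_int]
      have hlen : (φ γ).length = γ.length + 1 := by
        simp [φ, DomainSAW.length, SimpleGraph.Walk.length_support]
      have hrev : (φ γ).reverse ++ [w] = γ.walk.support.map ofSite ++ [ofSite (toSite w)] := by
        simp [φ]
      simp only [g, hlen, hrev]
      ring
  unfold halfEdgeTerm
  rw [tsum_fintype]
  rw [show ∑ γ : S, _ = ∑ γ : S, Gf (φ γ) from Finset.sum_congr rfl fun γ _ => hterm γ]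
  have hsum : ∑ γ : S, Gf (φ γ) = (P.map Gf).sum := by
    rw [← List.sum_toFinset Gf hnd]
    refine Finset.sum_bij (fun γ _ => φ γ) (fun γ _ => List.mem_toFinset.2 (hφmem γ))
      (fun γ _ γ' _ h => hφinj h) (fun l hl => ?_) (fun γ _ => rfl)
    obtain ⟨γ, hγ⟩ := exists_saw_of_pathOK hG (hokP l (List.mem_toFinset.1 hl))
    exact ⟨γ, Finset.mem_univ _, hγ⟩
  rw [hsum]
  exact sum_map_ite_eq_sum_filter P (fun l => l.tail.head? = some w) g

/-- Unpacking `sideOK`. [folklore] -/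
private theorem sideOK_spec {fuel : ℕ} {r z w : ZZ} (h : sideOK E fuel r z w = true) :
    (∀ l ∈ pathsTo E fuel r z, pathOK E r z l = true) ∧
    (∀ l ∈ pathsTo E fuel r z, l.tail.head? ≠ some w → goodSteps (l.reverse ++ [w]) = true) ∧
    (pathsTo E fuel r z).Nodup := by
  simp only [sideOK, Bool.and_eq_true, List.all_eq_true, Bool.or_eq_true, decide_eq_true_eq] at h
  obtain ⟨h1, hnd⟩ := h
  exact ⟨fun l hl => (h1 l hl).1, fun l hl hne => ((h1 l hl).2.resolve_left hne), hnd⟩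

/-! ### Evaluating the domino functional on `Ω_E` -/

/-- `∑ k : Fin 7` as a list sum over `List.finRange 7`. [folklore] -/
private theorem sum_fin_seven_eq_finRange (h : Fin 7 → ℂ) : ∑ k : Fin 7, h k = ((List.finRange 7).map h).sum := by
  rw [← List.sum_ofFn, List.ofFn_eq_map]

/-- **The domino functional on `Ω_E` rooted at the vertex `r`, domino at `v`**, evaluated by the
enumeration: `Σ_{(k,n,m) ∈ dominoTerms} c_k x^n t^m`. [folklore] -/
private theorem dominoFunctional_eq (hG : GoodEdgeList E) {r v : ZZ} (hr : r ∈ verts E)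
    {fuel : ℕ} (hfuel : (verts E).length ≤ fuel) (hok : dominoOK E fuel r v = true) (x σ : ℝ) (c : Fin 7 → ℂ) :
    dominoFunctionalZ2 (Omega E) 1 (toSite r) (toSite v) x σ c =
      ((dominoTerms E fuel r v).map fun knm => c knm.1 * ((x : ℂ) ^ knm.2.1 * tpow (tOf σ) knm.2.2)).sum := by
  unfold dominoFunctionalZ2
  rw [sum_fin_seven_eq_finRange, dominoTerms, sum_flatMap]
  congr 1
  refine List.map_congr_left fun k hk => ?_
  simp only [dominoOK, List.all_eq_true, Bool.and_eq_true] at hok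
  obtain ⟨hok1, hok2⟩ := hok k hk
  obtain ⟨hP1, hG1, hnd1⟩ := sideOK_spec hok1
  obtain ⟨hP2, hG2, hnd2⟩ := sideOK_spec hok2
  rw [dominoBase_toSite, toSite_add_dirZ2, midEdgeParafermionicObservable_mk,
    halfEdgeTerm_eq_sideSum hG (baseZZ v k + dirZZ (dominoDir k)) hr hfuel hP1 hG1 hnd1,
    halfEdgeTerm_eq_sideSum hG (baseZZ v k) hr hfuel hP2 hG2 hnd2,
    List.map_append, List.sum_append, sideTerms, sideTerms, List.map_map, List.map_map, mul_add,
    ← List.sum_map_mul_left, ← List.sum_map_mul_left]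
  rfl

/-- **Instantiating an exact domino relation on `Ω_E`** (root `r` a vertex with the lattice
neighbour `r + dir j₀` outside the domain; the seven domino mid-edges present). [folklore] -/
private theorem inst (hG : GoodEdgeList E) {r v : ZZ} (j₀ : Fin 4) (hr : r ∈ verts E)
    (hout : r + dirZZ j₀ ∉ verts E)
    (hsq : ∀ k : Fin 7, EAdj E (baseZZ v k) (baseZZ v k + dirZZ (dominoDir k)))
    {fuel : ℕ} (hfuel : (verts E).length ≤ fuel) (hok : dominoOK E fuel r v = true)
    {x σ : ℝ} {c : Fin 7 → ℂ} (h : ExactDominoRelationZ2 x σ c) :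
    ((dominoTerms E fuel r v).map fun knm => c knm.1 * ((x : ℂ) ^ knm.2.1 * tpow (tOf σ) knm.2.2)).sum = 0 := by
  rw [← dominoFunctional_eq hG hr hfuel hok x σ c]
  refine h (Omega E) 1 (toSite r) (toSite v) one_pos ((hG.mem_meshDomain_iff _).2 (by simpa using hr))
    ⟨toSite (r + dirZZ j₀), ?_, ?_⟩ fun k => ?_
  · rw [← toSite_add_dirZ2]
    fin_cases j₀
    · simpa [dirZ2, toSite] using zdAdj_toSite_right r
    · simpa [dirZ2, toSite] using zdAdj_toSite_up r
    · simpa [dirZ2, toSite, sub_eq_add_neg] using zdAdj_toSite_left r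
    · simpa [dirZ2, toSite, sub_eq_add_neg] using zdAdj_toSite_down r
  · rw [meshPoint_one_toSite, pt_mem_Omega_iff hG.unit]
    exact hout
  · rw [dominoBase_toSite, toSite_add_dirZ2]
    exact hG.A _ _ (hsq k)

/-! ### The instances: eleven `R180`-pairs of small domains around the domino `{(0,0), (1,0)}` (trees and single closed
unit squares hung on the domino), each rooted at one of its boundary vertices -/

/-- `tpow` at a non-negative exponent. [folklore] -/
@[simp] private theorem tpow_ofNat (t : ℂ) (k : ℕ) : tpow t (Int.ofNat k) = t ^ k := by
  simp [tpow]

/-- `tpow` at a negative exponent. [folklore] -/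
@[simp] private theorem tpow_negSucc (t : ℂ) (k : ℕ) : tpow t (Int.negSucc k) = t⁻¹ ^ (k + 1) := by
  simp only [tpow, Int.negSucc_not_nonneg, if_false, Int.neg_negSucc]
  rfl

/-- Edge list of instance `DP0_0_1`: the tree `DP0`: the domino `{(0,0),(1,0)}` with its six outer neighbours as pendant leaves, root `(0, 1)`. [folklore] -/
def E_DP0_0_1 : List (ZZ × ZZ) :=
  [((0, 0), (1, 0)), ((0, 0), (0, 1)), ((-1, 0), (0, 0)), ((0, -1), (0, 0)), ((1, 0), (2, 0)), ((1, 0), (1, 1)), ((1, -1), (1, 0))]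

/-- Kernel certificate: unit darts, connected. [folklore] -/
private theorem good_DP0_0_1 : GoodEdgeList E_DP0_0_1 := ⟨by decide, ⟨(0, 1), by decide, 14, by decide⟩⟩

/-- The domino monomials of instance `DP0_0_1` (kernel evaluation of `dominoTerms`). [folklore] -/
private theorem terms_DP0_0_1 : dominoTerms E_DP0_0_1 14 (0, 1) (0, 0) =
  [(0, 2, Int.ofNat 1), (1, 1, Int.ofNat 0), (2, 2, Int.negSucc 0), (3, 2, Int.ofNat 0), (4, 3, Int.ofNat 1), (5, 3, Int.ofNat 2), (6, 3,
      Int.ofNat 0)] := by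
  decide

/-- The exact domino relation instantiated on `DP0_0_1`. [folklore] -/
private theorem inst_DP0_0_1 {x σ : ℝ} {c : Fin 7 → ℂ} (h : ExactDominoRelationZ2 x σ c) :
    c 0 * ((x : ℂ) ^ (2 : ℕ) * tOf σ) + c 1 * ((x : ℂ)) + c 2 * ((x : ℂ) ^ (2 : ℕ) * (tOf σ)⁻¹) + c 3 * ((x : ℂ) ^ (2 : ℕ)) +
      c 4 * ((x : ℂ) ^ (3 : ℕ) * tOf σ) + c 5 * ((x : ℂ) ^ (3 : ℕ) * tOf σ ^ (2 : ℕ)) + c 6 * ((x : ℂ) ^ (3 : ℕ)) = 0 := by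
  have h0 := inst good_DP0_0_1 (r := (0, 1)) (v := (0, 0)) 1 (by decide) (by decide) (by decide)
    (fuel := 14) (by decide) (by decide) h
  rw [terms_DP0_0_1] at h0
  simp only [List.map_cons, List.map_nil, List.sum_cons, List.sum_nil, add_zero, tpow_ofNat, tpow_negSucc, zero_add, pow_zero, mul_one, pow_one] at h0
  linear_combination h0

/-- Edge list of instance `DP0_1_m1`: the tree `DP0`: the domino `{(0,0),(1,0)}` with its six outer neighbours as pendant leaves, root `(1, -1)`. [folklore] -/
def E_DP0_1_m1 : List (ZZ × ZZ) :=
  [((0, 0), (1, 0)), ((0, 0), (0, 1)), ((-1, 0), (0, 0)), ((0, -1), (0, 0)), ((1, 0), (2, 0)), ((1, 0), (1, 1)), ((1, -1), (1, 0))]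

/-- Kernel certificate: unit darts, connected. [folklore] -/
private theorem good_DP0_1_m1 : GoodEdgeList E_DP0_1_m1 := ⟨by decide, ⟨(1, -1), by decide, 14, by decide⟩⟩

/-- The domino monomials of instance `DP0_1_m1` (kernel evaluation of `dominoTerms`). [folklore] -/
private theorem terms_DP0_1_m1 : dominoTerms E_DP0_1_m1 14 (1, -1) (0, 0) =
  [(0, 2, Int.ofNat 1), (1, 3, Int.ofNat 0), (2, 3, Int.ofNat 1), (3, 3, Int.ofNat 2), (4, 2, Int.negSucc 0), (5, 2, Int.ofNat 0), (6, 1,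
      Int.ofNat 0)] := by
  decide

/-- The exact domino relation instantiated on `DP0_1_m1`. [folklore] -/
private theorem inst_DP0_1_m1 {x σ : ℝ} {c : Fin 7 → ℂ} (h : ExactDominoRelationZ2 x σ c) :
    c 0 * ((x : ℂ) ^ (2 : ℕ) * tOf σ) + c 1 * ((x : ℂ) ^ (3 : ℕ)) + c 2 * ((x : ℂ) ^ (3 : ℕ) * tOf σ) + c 3 * ((x : ℂ) ^ (3 : ℕ) * tOf σ ^ (2 : ℕ)) +
      c 4 * ((x : ℂ) ^ (2 : ℕ) * (tOf σ)⁻¹) + c 5 * ((x : ℂ) ^ (2 : ℕ)) + c 6 * ((x : ℂ)) = 0 := by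
  have h0 := inst good_DP0_1_m1 (r := (1, -1)) (v := (0, 0)) 0 (by decide) (by decide) (by decide)
    (fuel := 14) (by decide) (by decide) h
  rw [terms_DP0_1_m1] at h0
  simp only [List.map_cons, List.map_nil, List.sum_cons, List.sum_nil, add_zero, tpow_ofNat, tpow_negSucc, zero_add, pow_zero, mul_one, pow_one] at h0
  linear_combination h0

/-- Edge list of instance `DP0_m1_0`: the tree `DP0`: the domino `{(0,0),(1,0)}` with its six outer neighbours as pendant leaves, root `(-1, 0)`. [folklore] -/
def E_DP0_m1_0 : List (ZZ × ZZ) :=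
  [((0, 0), (1, 0)), ((0, 0), (0, 1)), ((-1, 0), (0, 0)), ((0, -1), (0, 0)), ((1, 0), (2, 0)), ((1, 0), (1, 1)), ((1, -1), (1, 0))]

/-- Kernel certificate: unit darts, connected. [folklore] -/
private theorem good_DP0_m1_0 : GoodEdgeList E_DP0_m1_0 := ⟨by decide, ⟨(-1, 0), by decide, 14, by decide⟩⟩

/-- The domino monomials of instance `DP0_m1_0` (kernel evaluation of `dominoTerms`). [folklore] -/
private theorem terms_DP0_m1_0 : dominoTerms E_DP0_m1_0 14 (-1, 0) (0, 0) =
  [(0, 2, Int.ofNat 0), (1, 2, Int.ofNat 1), (2, 1, Int.ofNat 0), (3, 2, Int.negSucc 0), (4, 3, Int.ofNat 0), (5, 3, Int.ofNat 1), (6, 3,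
      Int.negSucc 0)] := by
  decide

/-- The exact domino relation instantiated on `DP0_m1_0`. [folklore] -/
private theorem inst_DP0_m1_0 {x σ : ℝ} {c : Fin 7 → ℂ} (h : ExactDominoRelationZ2 x σ c) :
    c 0 * ((x : ℂ) ^ (2 : ℕ)) + c 1 * ((x : ℂ) ^ (2 : ℕ) * tOf σ) + c 2 * ((x : ℂ)) + c 3 * ((x : ℂ) ^ (2 : ℕ) * (tOf σ)⁻¹) +
        c 4 * ((x : ℂ) ^ (3 : ℕ)) +
      c 5 * ((x : ℂ) ^ (3 : ℕ) * tOf σ) + c 6 * ((x : ℂ) ^ (3 : ℕ) * (tOf σ)⁻¹) = 0 := by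
  have h0 := inst good_DP0_m1_0 (r := (-1, 0)) (v := (0, 0)) 1 (by decide) (by decide) (by decide)
    (fuel := 14) (by decide) (by decide) h
  rw [terms_DP0_m1_0] at h0
  simp only [List.map_cons, List.map_nil, List.sum_cons, List.sum_nil, add_zero, tpow_ofNat, tpow_negSucc, zero_add, pow_zero, mul_one, pow_one] at h0
  linear_combination h0

/-- Edge list of instance `DP0_2_0`: the tree `DP0`: the domino `{(0,0),(1,0)}` with its six outer neighbours as pendant leaves, root `(2, 0)`. [folklore] -/
def E_DP0_2_0 : List (ZZ × ZZ) :=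
  [((0, 0), (1, 0)), ((0, 0), (0, 1)), ((-1, 0), (0, 0)), ((0, -1), (0, 0)), ((1, 0), (2, 0)), ((1, 0), (1, 1)), ((1, -1), (1, 0))]

/-- Kernel certificate: unit darts, connected. [folklore] -/
private theorem good_DP0_2_0 : GoodEdgeList E_DP0_2_0 := ⟨by decide, ⟨(2, 0), by decide, 14, by decide⟩⟩

/-- The domino monomials of instance `DP0_2_0` (kernel evaluation of `dominoTerms`). [folklore] -/
private theorem terms_DP0_2_0 : dominoTerms E_DP0_2_0 14 (2, 0) (0, 0) =
  [(0, 2, Int.ofNat 0), (1, 3, Int.negSucc 0), (2, 3, Int.ofNat 0), (3, 3, Int.ofNat 1), (4, 1, Int.ofNat 0), (5, 2, Int.negSucc 0), (6, 2,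
      Int.ofNat 1)] := by
  decide

/-- The exact domino relation instantiated on `DP0_2_0`. [folklore] -/
private theorem inst_DP0_2_0 {x σ : ℝ} {c : Fin 7 → ℂ} (h : ExactDominoRelationZ2 x σ c) :
    c 0 * ((x : ℂ) ^ (2 : ℕ)) + c 1 * ((x : ℂ) ^ (3 : ℕ) * (tOf σ)⁻¹) + c 2 * ((x : ℂ) ^ (3 : ℕ)) + c 3 * ((x : ℂ) ^ (3 : ℕ) * tOf σ) +
        c 4 * ((x : ℂ)) +
      c 5 * ((x : ℂ) ^ (2 : ℕ) * (tOf σ)⁻¹) + c 6 * ((x : ℂ) ^ (2 : ℕ) * tOf σ) = 0 := by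
  have h0 := inst good_DP0_2_0 (r := (2, 0)) (v := (0, 0)) 0 (by decide) (by decide) (by decide)
    (fuel := 14) (by decide) (by decide) h
  rw [terms_DP0_2_0] at h0
  simp only [List.map_cons, List.map_nil, List.sum_cons, List.sum_nil, add_zero, tpow_ofNat, tpow_negSucc, zero_add, pow_zero, mul_one, pow_one] at h0
  linear_combination h0

/-- Edge list of instance `DP0_0_m1`: the tree `DP0`: the domino `{(0,0),(1,0)}` with its six outer neighbours as pendant leaves, root `(0, -1)`. [folklore] -/
def E_DP0_0_m1 : List (ZZ × ZZ) :=
  [((0, 0), (1, 0)), ((0, 0), (0, 1)), ((-1, 0), (0, 0)), ((0, -1), (0, 0)), ((1, 0), (2, 0)), ((1, 0), (1, 1)), ((1, -1), (1, 0))]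

/-- Kernel certificate: unit darts, connected. [folklore] -/
private theorem good_DP0_0_m1 : GoodEdgeList E_DP0_0_m1 := ⟨by decide, ⟨(0, -1), by decide, 14, by decide⟩⟩

/-- The domino monomials of instance `DP0_0_m1` (kernel evaluation of `dominoTerms`). [folklore] -/
private theorem terms_DP0_0_m1 : dominoTerms E_DP0_0_m1 14 (0, -1) (0, 0) =
  [(0, 2, Int.negSucc 0), (1, 2, Int.ofNat 0), (2, 2, Int.ofNat 1), (3, 1, Int.ofNat 0), (4, 3, Int.negSucc 0), (5, 3, Int.ofNat 0), (6, 3,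
      Int.negSucc 1)] := by
  decide

/-- The exact domino relation instantiated on `DP0_0_m1`. [folklore] -/
private theorem inst_DP0_0_m1 {x σ : ℝ} {c : Fin 7 → ℂ} (h : ExactDominoRelationZ2 x σ c) :
    c 0 * ((x : ℂ) ^ (2 : ℕ) * (tOf σ)⁻¹) + c 1 * ((x : ℂ) ^ (2 : ℕ)) + c 2 * ((x : ℂ) ^ (2 : ℕ) * tOf σ) + c 3 * ((x : ℂ)) +
      c 4 * ((x : ℂ) ^ (3 : ℕ) * (tOf σ)⁻¹) + c 5 * ((x : ℂ) ^ (3 : ℕ)) + c 6 * ((x : ℂ) ^ (3 : ℕ) * (tOf σ)⁻¹ ^ (2 : ℕ)) = 0 := by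
  have h0 := inst good_DP0_0_m1 (r := (0, -1)) (v := (0, 0)) 2 (by decide) (by decide) (by decide)
    (fuel := 14) (by decide) (by decide) h
  rw [terms_DP0_0_m1] at h0
  simp only [List.map_cons, List.map_nil, List.sum_cons, List.sum_nil, add_zero, tpow_ofNat, tpow_negSucc, zero_add, Nat.reduceAdd, pow_zero, mul_one,
      pow_one] at h0
  linear_combination h0

/-- Edge list of instance `DP0_1_1`: the tree `DP0`: the domino `{(0,0),(1,0)}` with its six outer neighbours as pendant leaves, root `(1, 1)`. [folklore] -/
def E_DP0_1_1 : List (ZZ × ZZ) :=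
  [((0, 0), (1, 0)), ((0, 0), (0, 1)), ((-1, 0), (0, 0)), ((0, -1), (0, 0)), ((1, 0), (2, 0)), ((1, 0), (1, 1)), ((1, -1), (1, 0))]

/-- Kernel certificate: unit darts, connected. [folklore] -/
private theorem good_DP0_1_1 : GoodEdgeList E_DP0_1_1 := ⟨by decide, ⟨(1, 1), by decide, 14, by decide⟩⟩

/-- The domino monomials of instance `DP0_1_1` (kernel evaluation of `dominoTerms`). [folklore] -/
private theorem terms_DP0_1_1 : dominoTerms E_DP0_1_1 14 (1, 1) (0, 0) =
  [(0, 2, Int.negSucc 0), (1, 3, Int.negSucc 1), (2, 3, Int.negSucc 0), (3, 3, Int.ofNat 0), (4, 2, Int.ofNat 1), (5, 1, Int.ofNat 0), (6, 2,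
      Int.ofNat 0)] := by
  decide

/-- The exact domino relation instantiated on `DP0_1_1`. [folklore] -/
private theorem inst_DP0_1_1 {x σ : ℝ} {c : Fin 7 → ℂ} (h : ExactDominoRelationZ2 x σ c) :
    c 0 * ((x : ℂ) ^ (2 : ℕ) * (tOf σ)⁻¹) + c 1 * ((x : ℂ) ^ (3 : ℕ) * (tOf σ)⁻¹ ^ (2 : ℕ)) + c 2 * ((x : ℂ) ^ (3 : ℕ) * (tOf σ)⁻¹) +
      c 3 * ((x : ℂ) ^ (3 : ℕ)) + c 4 * ((x : ℂ) ^ (2 : ℕ) * tOf σ) + c 5 * ((x : ℂ)) + c 6 * ((x : ℂ) ^ (2 : ℕ)) = 0 := by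
  have h0 := inst good_DP0_1_1 (r := (1, 1)) (v := (0, 0)) 0 (by decide) (by decide) (by decide)
    (fuel := 14) (by decide) (by decide) h
  rw [terms_DP0_1_1] at h0
  simp only [List.map_cons, List.map_nil, List.sum_cons, List.sum_nil, add_zero, tpow_ofNat, tpow_negSucc, zero_add, Nat.reduceAdd, pow_zero, mul_one,
      pow_one] at h0
  linear_combination h0

/-- Edge list of instance `DPa_1_m1`: `DP0` with the unit square above the domino closed (edge `(0,1)–(1,1)`), root `(1, -1)`. [folklore] -/
def E_DPa_1_m1 : List (ZZ × ZZ) :=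
  [((0, 0), (1, 0)), ((0, 0), (0, 1)), ((-1, 0), (0, 0)), ((0, -1), (0, 0)), ((1, 0), (2, 0)), ((1, 0), (1, 1)), ((1, -1), (1, 0)), ((0, 1), (1, 1))]

/-- Kernel certificate: unit darts, connected. [folklore] -/
private theorem good_DPa_1_m1 : GoodEdgeList E_DPa_1_m1 := ⟨by decide, ⟨(1, -1), by decide, 16, by decide⟩⟩

/-- The domino monomials of instance `DPa_1_m1` (kernel evaluation of `dominoTerms`). [folklore] -/
private theorem terms_DPa_1_m1 : dominoTerms E_DPa_1_m1 16 (1, -1) (0, 0) =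
  [(0, 5, Int.ofNat 3), (0, 2, Int.ofNat 1), (1, 3, Int.ofNat 0), (1, 4, Int.ofNat 2), (2, 5, Int.ofNat 1), (2, 3, Int.ofNat 1), (3, 5, Int.ofNat 2),
      (3, 3, Int.ofNat 2), (4, 2, Int.negSucc 0), (5, 2, Int.ofNat 0), (5, 5, Int.negSucc 1), (6, 1, Int.ofNat 0)] := by
  decide

/-- The exact domino relation instantiated on `DPa_1_m1`. [folklore] -/
private theorem inst_DPa_1_m1 {x σ : ℝ} {c : Fin 7 → ℂ} (h : ExactDominoRelationZ2 x σ c) :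
    c 0 * ((x : ℂ) ^ (2 : ℕ) * tOf σ + (x : ℂ) ^ (5 : ℕ) * tOf σ ^ (3 : ℕ)) + c 1 * ((x : ℂ) ^ (3 : ℕ) + (x : ℂ) ^ (4 : ℕ) * tOf σ ^ (2 : ℕ)) +
      c 2 * ((x : ℂ) ^ (3 : ℕ) * tOf σ + (x : ℂ) ^ (5 : ℕ) * tOf σ) + c 3 * ((x : ℂ) ^ (3 : ℕ) * tOf σ ^ (2 : ℕ) +
          (x : ℂ) ^ (5 : ℕ) * tOf σ ^ (2 : ℕ)) +
      c 4 * ((x : ℂ) ^ (2 : ℕ) * (tOf σ)⁻¹) + c 5 * ((x : ℂ) ^ (2 : ℕ) + (x : ℂ) ^ (5 : ℕ) * (tOf σ)⁻¹ ^ (2 : ℕ)) + c 6 * ((x : ℂ)) = 0 := by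
  have h0 := inst good_DPa_1_m1 (r := (1, -1)) (v := (0, 0)) 0 (by decide) (by decide) (by decide)
    (fuel := 16) (by decide) (by decide) h
  rw [terms_DPa_1_m1] at h0
  simp only [List.map_cons, List.map_nil, List.sum_cons, List.sum_nil, add_zero, tpow_ofNat, tpow_negSucc, zero_add, Nat.reduceAdd, pow_zero, mul_one,
      pow_one] at h0
  linear_combination h0

/-- Edge list of instance `DPb_0_1`: `DP0` with the unit square below the domino closed (edge `(0,-1)–(1,-1)`), root `(0, 1)`. [folklore] -/
def E_DPb_0_1 : List (ZZ × ZZ) :=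
  [((0, 0), (1, 0)), ((0, 0), (0, 1)), ((-1, 0), (0, 0)), ((0, -1), (0, 0)), ((1, 0), (2, 0)), ((1, 0), (1, 1)), ((1, -1), (1, 0)), ((0, -1), (1,
      -1))]

/-- Kernel certificate: unit darts, connected. [folklore] -/
private theorem good_DPb_0_1 : GoodEdgeList E_DPb_0_1 := ⟨by decide, ⟨(0, 1), by decide, 16, by decide⟩⟩

/-- The domino monomials of instance `DPb_0_1` (kernel evaluation of `dominoTerms`). [folklore] -/
private theorem terms_DPb_0_1 : dominoTerms E_DPb_0_1 16 (0, 1) (0, 0) =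
  [(0, 2, Int.ofNat 1), (0, 5, Int.ofNat 3), (1, 1, Int.ofNat 0), (2, 2, Int.negSucc 0), (3, 2, Int.ofNat 0), (3, 5, Int.negSucc 1), (4, 3,
      Int.ofNat 1), (4, 5, Int.ofNat 1), (5, 3, Int.ofNat 2), (5, 5, Int.ofNat 2), (6, 3, Int.ofNat 0), (6, 4, Int.ofNat 2)] := by
  decide

/-- The exact domino relation instantiated on `DPb_0_1`. [folklore] -/
private theorem inst_DPb_0_1 {x σ : ℝ} {c : Fin 7 → ℂ} (h : ExactDominoRelationZ2 x σ c) :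
    c 0 * ((x : ℂ) ^ (2 : ℕ) * tOf σ + (x : ℂ) ^ (5 : ℕ) * tOf σ ^ (3 : ℕ)) + c 1 * ((x : ℂ)) + c 2 * ((x : ℂ) ^ (2 : ℕ) * (tOf σ)⁻¹) +
      c 3 * ((x : ℂ) ^ (2 : ℕ) + (x : ℂ) ^ (5 : ℕ) * (tOf σ)⁻¹ ^ (2 : ℕ)) + c 4 * ((x : ℂ) ^ (3 : ℕ) * tOf σ + (x : ℂ) ^ (5 : ℕ) * tOf σ) +
      c 5 * ((x : ℂ) ^ (3 : ℕ) * tOf σ ^ (2 : ℕ) + (x : ℂ) ^ (5 : ℕ) * tOf σ ^ (2 : ℕ)) + c 6 * ((x : ℂ) ^ (3 : ℕ) +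
          (x : ℂ) ^ (4 : ℕ) * tOf σ ^ (2 : ℕ)) = 0 := by
  have h0 := inst good_DPb_0_1 (r := (0, 1)) (v := (0, 0)) 1 (by decide) (by decide) (by decide)
    (fuel := 16) (by decide) (by decide) h
  rw [terms_DPb_0_1] at h0
  simp only [List.map_cons, List.map_nil, List.sum_cons, List.sum_nil, add_zero, tpow_ofNat, tpow_negSucc, zero_add, Nat.reduceAdd, pow_zero, mul_one,
      pow_one] at h0
  linear_combination h0

/-- Edge list of instance `DPa_m1_0`: `DP0` with the unit square above the domino closed (edge `(0,1)–(1,1)`), root `(-1, 0)`. [folklore] -/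
def E_DPa_m1_0 : List (ZZ × ZZ) :=
  [((0, 0), (1, 0)), ((0, 0), (0, 1)), ((-1, 0), (0, 0)), ((0, -1), (0, 0)), ((1, 0), (2, 0)), ((1, 0), (1, 1)), ((1, -1), (1, 0)), ((0, 1), (1, 1))]

/-- Kernel certificate: unit darts, connected. [folklore] -/
private theorem good_DPa_m1_0 : GoodEdgeList E_DPa_m1_0 := ⟨by decide, ⟨(-1, 0), by decide, 16, by decide⟩⟩

/-- The domino monomials of instance `DPa_m1_0` (kernel evaluation of `dominoTerms`). [folklore] -/
private theorem terms_DPa_m1_0 : dominoTerms E_DPa_m1_0 16 (-1, 0) (0, 0) =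
  [(0, 2, Int.ofNat 0), (0, 5, Int.negSucc 1), (1, 2, Int.ofNat 1), (1, 5, Int.ofNat 3), (2, 1, Int.ofNat 0), (3, 2, Int.negSucc 0), (4, 3,
      Int.ofNat 0), (4, 5, Int.ofNat 0), (5, 3, Int.ofNat 1), (5, 4, Int.negSucc 0), (6, 3, Int.negSucc 0), (6, 5, Int.negSucc 0)] := by
  decide

/-- The exact domino relation instantiated on `DPa_m1_0`. [folklore] -/
private theorem inst_DPa_m1_0 {x σ : ℝ} {c : Fin 7 → ℂ} (h : ExactDominoRelationZ2 x σ c) :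
    c 0 * ((x : ℂ) ^ (2 : ℕ) + (x : ℂ) ^ (5 : ℕ) * (tOf σ)⁻¹ ^ (2 : ℕ)) + c 1 * ((x : ℂ) ^ (2 : ℕ) * tOf σ + (x : ℂ) ^ (5 : ℕ) * tOf σ ^ (3 : ℕ)) +
      c 2 * ((x : ℂ)) + c 3 * ((x : ℂ) ^ (2 : ℕ) * (tOf σ)⁻¹) + c 4 * ((x : ℂ) ^ (3 : ℕ) + (x : ℂ) ^ (5 : ℕ)) + c 5 * ((x : ℂ) ^ (3 : ℕ) * tOf σ +
      (x : ℂ) ^ (4 : ℕ) * (tOf σ)⁻¹) + c 6 * ((x : ℂ) ^ (3 : ℕ) * (tOf σ)⁻¹ + (x : ℂ) ^ (5 : ℕ) * (tOf σ)⁻¹) = 0 := by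
  have h0 := inst good_DPa_m1_0 (r := (-1, 0)) (v := (0, 0)) 1 (by decide) (by decide) (by decide)
    (fuel := 16) (by decide) (by decide) h
  rw [terms_DPa_m1_0] at h0
  simp only [List.map_cons, List.map_nil, List.sum_cons, List.sum_nil, add_zero, tpow_ofNat, tpow_negSucc, zero_add, Nat.reduceAdd, pow_zero, mul_one,
      pow_one] at h0
  linear_combination h0

/-- Edge list of instance `DPb_2_0`: `DP0` with the unit square below the domino closed (edge `(0,-1)–(1,-1)`), root `(2, 0)`. [folklore] -/
def E_DPb_2_0 : List (ZZ × ZZ) :=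
  [((0, 0), (1, 0)), ((0, 0), (0, 1)), ((-1, 0), (0, 0)), ((0, -1), (0, 0)), ((1, 0), (2, 0)), ((1, 0), (1, 1)), ((1, -1), (1, 0)), ((0, -1), (1,
      -1))]

/-- Kernel certificate: unit darts, connected. [folklore] -/
private theorem good_DPb_2_0 : GoodEdgeList E_DPb_2_0 := ⟨by decide, ⟨(2, 0), by decide, 16, by decide⟩⟩

/-- The domino monomials of instance `DPb_2_0` (kernel evaluation of `dominoTerms`). [folklore] -/
private theorem terms_DPb_2_0 : dominoTerms E_DPb_2_0 16 (2, 0) (0, 0) =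
  [(0, 5, Int.negSucc 1), (0, 2, Int.ofNat 0), (1, 3, Int.negSucc 0), (1, 5, Int.negSucc 0), (2, 3, Int.ofNat 0), (2, 5, Int.ofNat 0), (3, 3,
      Int.ofNat 1), (3, 4, Int.negSucc 0), (4, 1, Int.ofNat 0), (5, 2, Int.negSucc 0), (6, 2, Int.ofNat 1), (6, 5, Int.ofNat 3)] := by
  decide

/-- The exact domino relation instantiated on `DPb_2_0`. [folklore] -/
private theorem inst_DPb_2_0 {x σ : ℝ} {c : Fin 7 → ℂ} (h : ExactDominoRelationZ2 x σ c) :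
    c 0 * ((x : ℂ) ^ (2 : ℕ) + (x : ℂ) ^ (5 : ℕ) * (tOf σ)⁻¹ ^ (2 : ℕ)) + c 1 * ((x : ℂ) ^ (3 : ℕ) * (tOf σ)⁻¹ + (x : ℂ) ^ (5 : ℕ) * (tOf σ)⁻¹) +
      c 2 * ((x : ℂ) ^ (3 : ℕ) + (x : ℂ) ^ (5 : ℕ)) + c 3 * ((x : ℂ) ^ (3 : ℕ) * tOf σ + (x : ℂ) ^ (4 : ℕ) * (tOf σ)⁻¹) + c 4 * ((x : ℂ)) +
      c 5 * ((x : ℂ) ^ (2 : ℕ) * (tOf σ)⁻¹) + c 6 * ((x : ℂ) ^ (2 : ℕ) * tOf σ + (x : ℂ) ^ (5 : ℕ) * tOf σ ^ (3 : ℕ)) = 0 := by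
  have h0 := inst good_DPb_2_0 (r := (2, 0)) (v := (0, 0)) 0 (by decide) (by decide) (by decide)
    (fuel := 16) (by decide) (by decide) h
  rw [terms_DPb_2_0] at h0
  simp only [List.map_cons, List.map_nil, List.sum_cons, List.sum_nil, add_zero, tpow_ofNat, tpow_negSucc, zero_add, Nat.reduceAdd, pow_zero, mul_one,
      pow_one] at h0
  linear_combination h0

/-- Edge list of instance `DPa_2_0`: `DP0` with the unit square above the domino closed (edge `(0,1)–(1,1)`), root `(2, 0)`. [folklore] -/
def E_DPa_2_0 : List (ZZ × ZZ) :=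
  [((0, 0), (1, 0)), ((0, 0), (0, 1)), ((-1, 0), (0, 0)), ((0, -1), (0, 0)), ((1, 0), (2, 0)), ((1, 0), (1, 1)), ((1, -1), (1, 0)), ((0, 1), (1, 1))]

/-- Kernel certificate: unit darts, connected. [folklore] -/
private theorem good_DPa_2_0 : GoodEdgeList E_DPa_2_0 := ⟨by decide, ⟨(2, 0), by decide, 16, by decide⟩⟩

/-- The domino monomials of instance `DPa_2_0` (kernel evaluation of `dominoTerms`). [folklore] -/
private theorem terms_DPa_2_0 : dominoTerms E_DPa_2_0 16 (2, 0) (0, 0) =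
  [(0, 5, Int.ofNat 2), (0, 2, Int.ofNat 0), (1, 3, Int.negSucc 0), (1, 4, Int.ofNat 1), (2, 5, Int.ofNat 0), (2, 3, Int.ofNat 0), (3, 5, Int.ofNat 1),
      (3, 3, Int.ofNat 1), (4, 1, Int.ofNat 0), (5, 2, Int.negSucc 0), (5, 5, Int.negSucc 2), (6, 2, Int.ofNat 1)] := by
  decide

/-- The exact domino relation instantiated on `DPa_2_0`. [folklore] -/
private theorem inst_DPa_2_0 {x σ : ℝ} {c : Fin 7 → ℂ} (h : ExactDominoRelationZ2 x σ c) :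
    c 0 * ((x : ℂ) ^ (2 : ℕ) + (x : ℂ) ^ (5 : ℕ) * tOf σ ^ (2 : ℕ)) + c 1 * ((x : ℂ) ^ (3 : ℕ) * (tOf σ)⁻¹ + (x : ℂ) ^ (4 : ℕ) * tOf σ) +
      c 2 * ((x : ℂ) ^ (3 : ℕ) + (x : ℂ) ^ (5 : ℕ)) + c 3 * ((x : ℂ) ^ (3 : ℕ) * tOf σ + (x : ℂ) ^ (5 : ℕ) * tOf σ) + c 4 * ((x : ℂ)) +
      c 5 * ((x : ℂ) ^ (2 : ℕ) * (tOf σ)⁻¹ + (x : ℂ) ^ (5 : ℕ) * (tOf σ)⁻¹ ^ (3 : ℕ)) + c 6 * ((x : ℂ) ^ (2 : ℕ) * tOf σ) = 0 := by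
  have h0 := inst good_DPa_2_0 (r := (2, 0)) (v := (0, 0)) 0 (by decide) (by decide) (by decide)
    (fuel := 16) (by decide) (by decide) h
  rw [terms_DPa_2_0] at h0
  simp only [List.map_cons, List.map_nil, List.sum_cons, List.sum_nil, add_zero, tpow_ofNat, tpow_negSucc, zero_add, Nat.reduceAdd, pow_zero, mul_one,
      pow_one] at h0
  linear_combination h0

/-- Edge list of instance `DPb_m1_0`: `DP0` with the unit square below the domino closed (edge `(0,-1)–(1,-1)`), root `(-1, 0)`. [folklore] -/
def E_DPb_m1_0 : List (ZZ × ZZ) :=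
  [((0, 0), (1, 0)), ((0, 0), (0, 1)), ((-1, 0), (0, 0)), ((0, -1), (0, 0)), ((1, 0), (2, 0)), ((1, 0), (1, 1)), ((1, -1), (1, 0)), ((0, -1), (1,
      -1))]

/-- Kernel certificate: unit darts, connected. [folklore] -/
private theorem good_DPb_m1_0 : GoodEdgeList E_DPb_m1_0 := ⟨by decide, ⟨(-1, 0), by decide, 16, by decide⟩⟩

/-- The domino monomials of instance `DPb_m1_0` (kernel evaluation of `dominoTerms`). [folklore] -/
private theorem terms_DPb_m1_0 : dominoTerms E_DPb_m1_0 16 (-1, 0) (0, 0) =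
  [(0, 2, Int.ofNat 0), (0, 5, Int.ofNat 2), (1, 2, Int.ofNat 1), (2, 1, Int.ofNat 0), (3, 2, Int.negSucc 0), (3, 5, Int.negSucc 2), (4, 3,
      Int.ofNat 0), (4, 5, Int.ofNat 0), (5, 3, Int.ofNat 1), (5, 5, Int.ofNat 1), (6, 3, Int.negSucc 0), (6, 4, Int.ofNat 1)] := by
  decide

/-- The exact domino relation instantiated on `DPb_m1_0`. [folklore] -/
private theorem inst_DPb_m1_0 {x σ : ℝ} {c : Fin 7 → ℂ} (h : ExactDominoRelationZ2 x σ c) :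
    c 0 * ((x : ℂ) ^ (2 : ℕ) + (x : ℂ) ^ (5 : ℕ) * tOf σ ^ (2 : ℕ)) + c 1 * ((x : ℂ) ^ (2 : ℕ) * tOf σ) + c 2 * ((x : ℂ)) +
      c 3 * ((x : ℂ) ^ (2 : ℕ) * (tOf σ)⁻¹ + (x : ℂ) ^ (5 : ℕ) * (tOf σ)⁻¹ ^ (3 : ℕ)) + c 4 * ((x : ℂ) ^ (3 : ℕ) + (x : ℂ) ^ (5 : ℕ)) +
      c 5 * ((x : ℂ) ^ (3 : ℕ) * tOf σ + (x : ℂ) ^ (5 : ℕ) * tOf σ) + c 6 * ((x : ℂ) ^ (3 : ℕ) * (tOf σ)⁻¹ + (x : ℂ) ^ (4 : ℕ) * tOf σ) = 0 := by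
  have h0 := inst good_DPb_m1_0 (r := (-1, 0)) (v := (0, 0)) 1 (by decide) (by decide) (by decide)
    (fuel := 16) (by decide) (by decide) h
  rw [terms_DPb_m1_0] at h0
  simp only [List.map_cons, List.map_nil, List.sum_cons, List.sum_nil, add_zero, tpow_ofNat, tpow_negSucc, zero_add, Nat.reduceAdd, pow_zero, mul_one,
      pow_one] at h0
  linear_combination h0

/-- Edge list of instance `DPab_m1_0`: `DP0` with both unit squares above and below closed, root `(-1, 0)`. [folklore] -/
def E_DPab_m1_0 : List (ZZ × ZZ) :=
  [((0, 0), (1, 0)), ((0, 0), (0, 1)), ((-1, 0), (0, 0)), ((0, -1), (0, 0)), ((1, 0), (2, 0)), ((1, 0), (1, 1)), ((1, -1), (1, 0)), ((0, 1), (1, 1)),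
      ((0, -1), (1, -1))]

/-- Kernel certificate: unit darts, connected. [folklore] -/
private theorem good_DPab_m1_0 : GoodEdgeList E_DPab_m1_0 := ⟨by decide, ⟨(-1, 0), by decide, 18, by decide⟩⟩

/-- The domino monomials of instance `DPab_m1_0` (kernel evaluation of `dominoTerms`). [folklore] -/
private theorem terms_DPab_m1_0 : dominoTerms E_DPab_m1_0 18 (-1, 0) (0, 0) =
  [(0, 2, Int.ofNat 0), (0, 5, Int.negSucc 1), (0, 5, Int.ofNat 2), (1, 2, Int.ofNat 1), (1, 5, Int.ofNat 3), (1, 7, Int.ofNat 3), (2, 1, Int.ofNat 0),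
      (3, 2, Int.negSucc 0), (3, 5, Int.negSucc 2), (3, 7, Int.negSucc 2), (4, 3, Int.ofNat 0), (4, 5, Int.ofNat 0), (4, 5, Int.ofNat 0), (5, 3,
      Int.ofNat 1), (5, 5, Int.ofNat 1), (5, 4, Int.negSucc 0), (6, 3, Int.negSucc 0), (6, 5, Int.negSucc 0), (6, 4, Int.ofNat 1)] := by
  decide

/-- The exact domino relation instantiated on `DPab_m1_0`. [folklore] -/
private theorem inst_DPab_m1_0 {x σ : ℝ} {c : Fin 7 → ℂ} (h : ExactDominoRelationZ2 x σ c) :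
    c 0 * ((x : ℂ) ^ (2 : ℕ) + (x : ℂ) ^ (5 : ℕ) * (tOf σ)⁻¹ ^ (2 : ℕ) + (x : ℂ) ^ (5 : ℕ) * tOf σ ^ (2 : ℕ)) + c 1 * ((x : ℂ) ^ (2 : ℕ) * tOf σ +
      (x : ℂ) ^ (5 : ℕ) * tOf σ ^ (3 : ℕ) + (x : ℂ) ^ (7 : ℕ) * tOf σ ^ (3 : ℕ)) + c 2 * ((x : ℂ)) + c 3 * ((x : ℂ) ^ (2 : ℕ) * (tOf σ)⁻¹ +
      (x : ℂ) ^ (5 : ℕ) * (tOf σ)⁻¹ ^ (3 : ℕ) + (x : ℂ) ^ (7 : ℕ) * (tOf σ)⁻¹ ^ (3 : ℕ)) + c 4 * ((x : ℂ) ^ (3 : ℕ) + (2 : ℂ) * (x : ℂ) ^ (5 : ℕ)) +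
      c 5 * ((x : ℂ) ^ (3 : ℕ) * tOf σ + (x : ℂ) ^ (4 : ℕ) * (tOf σ)⁻¹ + (x : ℂ) ^ (5 : ℕ) * tOf σ) + c 6 * ((x : ℂ) ^ (3 : ℕ) * (tOf σ)⁻¹ +
      (x : ℂ) ^ (4 : ℕ) * tOf σ + (x : ℂ) ^ (5 : ℕ) * (tOf σ)⁻¹) = 0 := by
  have h0 := inst good_DPab_m1_0 (r := (-1, 0)) (v := (0, 0)) 1 (by decide) (by decide) (by decide)
    (fuel := 18) (by decide) (by decide) h
  rw [terms_DPab_m1_0] at h0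
  simp only [List.map_cons, List.map_nil, List.sum_cons, List.sum_nil, add_zero, tpow_ofNat, tpow_negSucc, zero_add, Nat.reduceAdd, pow_zero, mul_one,
      pow_one] at h0
  linear_combination h0

/-- Edge list of instance `DPab_2_0`: `DP0` with both unit squares above and below closed, root `(2, 0)`. [folklore] -/
def E_DPab_2_0 : List (ZZ × ZZ) :=
  [((0, 0), (1, 0)), ((0, 0), (0, 1)), ((-1, 0), (0, 0)), ((0, -1), (0, 0)), ((1, 0), (2, 0)), ((1, 0), (1, 1)), ((1, -1), (1, 0)), ((0, 1), (1, 1)),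
      ((0, -1), (1, -1))]

/-- Kernel certificate: unit darts, connected. [folklore] -/
private theorem good_DPab_2_0 : GoodEdgeList E_DPab_2_0 := ⟨by decide, ⟨(2, 0), by decide, 18, by decide⟩⟩

/-- The domino monomials of instance `DPab_2_0` (kernel evaluation of `dominoTerms`). [folklore] -/
private theorem terms_DPab_2_0 : dominoTerms E_DPab_2_0 18 (2, 0) (0, 0) =
  [(0, 5, Int.ofNat 2), (0, 5, Int.negSucc 1), (0, 2, Int.ofNat 0), (1, 3, Int.negSucc 0), (1, 5, Int.negSucc 0), (1, 4, Int.ofNat 1), (2, 5,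
      Int.ofNat 0), (2, 3, Int.ofNat 0), (2, 5, Int.ofNat 0), (3, 5, Int.ofNat 1), (3, 3, Int.ofNat 1), (3, 4, Int.negSucc 0), (4, 1, Int.ofNat 0), (5,
      2, Int.negSucc 0), (5, 5, Int.negSucc 2), (5, 7, Int.negSucc 2), (6, 2, Int.ofNat 1), (6, 7, Int.ofNat 3), (6, 5, Int.ofNat 3)] := by
  decide

/-- The exact domino relation instantiated on `DPab_2_0`. [folklore] -/
private theorem inst_DPab_2_0 {x σ : ℝ} {c : Fin 7 → ℂ} (h : ExactDominoRelationZ2 x σ c) :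
    c 0 * ((x : ℂ) ^ (2 : ℕ) + (x : ℂ) ^ (5 : ℕ) * (tOf σ)⁻¹ ^ (2 : ℕ) + (x : ℂ) ^ (5 : ℕ) * tOf σ ^ (2 : ℕ)) + c 1 * ((x : ℂ) ^ (3 : ℕ) * (tOf σ)⁻¹ +
      (x : ℂ) ^ (4 : ℕ) * tOf σ + (x : ℂ) ^ (5 : ℕ) * (tOf σ)⁻¹) + c 2 * ((x : ℂ) ^ (3 : ℕ) + (2 : ℂ) * (x : ℂ) ^ (5 : ℕ)) +
      c 3 * ((x : ℂ) ^ (3 : ℕ) * tOf σ + (x : ℂ) ^ (4 : ℕ) * (tOf σ)⁻¹ + (x : ℂ) ^ (5 : ℕ) * tOf σ) + c 4 * ((x : ℂ)) +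
          c 5 * ((x : ℂ) ^ (2 : ℕ) * (tOf σ)⁻¹ +
      (x : ℂ) ^ (5 : ℕ) * (tOf σ)⁻¹ ^ (3 : ℕ) + (x : ℂ) ^ (7 : ℕ) * (tOf σ)⁻¹ ^ (3 : ℕ)) + c 6 * ((x : ℂ) ^ (2 : ℕ) * tOf σ +
      (x : ℂ) ^ (5 : ℕ) * tOf σ ^ (3 : ℕ) + (x : ℂ) ^ (7 : ℕ) * tOf σ ^ (3 : ℕ)) = 0 := by
  have h0 := inst good_DPab_2_0 (r := (2, 0)) (v := (0, 0)) 0 (by decide) (by decide) (by decide)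
    (fuel := 18) (by decide) (by decide) h
  rw [terms_DPab_2_0] at h0
  simp only [List.map_cons, List.map_nil, List.sum_cons, List.sum_nil, add_zero, tpow_ofNat, tpow_negSucc, zero_add, Nat.reduceAdd, pow_zero, mul_one,
      pow_one] at h0
  linear_combination h0

/-- Edge list of instance `DPnw_2_0`: `DP0` with the unit square north-west of `(0,0)` closed through the extra vertex `(-1,1)`, root `(2, 0)`. [folklore] -/
def E_DPnw_2_0 : List (ZZ × ZZ) :=
  [((0, 0), (1, 0)), ((0, 0), (0, 1)), ((-1, 0), (0, 0)), ((0, -1), (0, 0)), ((1, 0), (2, 0)), ((1, 0), (1, 1)), ((1, -1), (1, 0)), ((-1, 0), (-1, 1)),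
      ((-1, 1), (0, 1))]

/-- Kernel certificate: unit darts, connected. [folklore] -/
private theorem good_DPnw_2_0 : GoodEdgeList E_DPnw_2_0 := ⟨by decide, ⟨(2, 0), by decide, 18, by decide⟩⟩

/-- The domino monomials of instance `DPnw_2_0` (kernel evaluation of `dominoTerms`). [folklore] -/
private theorem terms_DPnw_2_0 : dominoTerms E_DPnw_2_0 18 (2, 0) (0, 0) =
  [(0, 2, Int.ofNat 0), (1, 3, Int.negSucc 0), (1, 6, Int.negSucc 2), (2, 3, Int.ofNat 0), (2, 6, Int.ofNat 2), (3, 3, Int.ofNat 1), (4, 1,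
      Int.ofNat 0), (5, 2, Int.negSucc 0), (6, 2, Int.ofNat 1)] := by
  decide

/-- The exact domino relation instantiated on `DPnw_2_0`. [folklore] -/
private theorem inst_DPnw_2_0 {x σ : ℝ} {c : Fin 7 → ℂ} (h : ExactDominoRelationZ2 x σ c) :
    c 0 * ((x : ℂ) ^ (2 : ℕ)) + c 1 * ((x : ℂ) ^ (3 : ℕ) * (tOf σ)⁻¹ + (x : ℂ) ^ (6 : ℕ) * (tOf σ)⁻¹ ^ (3 : ℕ)) + c 2 * ((x : ℂ) ^ (3 : ℕ) +
      (x : ℂ) ^ (6 : ℕ) * tOf σ ^ (2 : ℕ)) + c 3 * ((x : ℂ) ^ (3 : ℕ) * tOf σ) + c 4 * ((x : ℂ)) + c 5 * ((x : ℂ) ^ (2 : ℕ) * (tOf σ)⁻¹) +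
      c 6 * ((x : ℂ) ^ (2 : ℕ) * tOf σ) = 0 := by
  have h0 := inst good_DPnw_2_0 (r := (2, 0)) (v := (0, 0)) 0 (by decide) (by decide) (by decide)
    (fuel := 18) (by decide) (by decide) h
  rw [terms_DPnw_2_0] at h0
  simp only [List.map_cons, List.map_nil, List.sum_cons, List.sum_nil, add_zero, tpow_ofNat, tpow_negSucc, zero_add, Nat.reduceAdd, pow_zero, mul_one,
      pow_one] at h0
  linear_combination h0

/-- Edge list of instance `DPse_m1_0`: `DP0` with the unit square south-east of `(1,0)` closed through `(2,-1)` (the `R180` image of `DPnw`), root `(-1, 0)`. [folklore] -/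
def E_DPse_m1_0 : List (ZZ × ZZ) :=
  [((0, 0), (1, 0)), ((0, 0), (0, 1)), ((-1, 0), (0, 0)), ((0, -1), (0, 0)), ((1, 0), (2, 0)), ((1, 0), (1, 1)), ((1, -1), (1, 0)), ((2, -1), (2, 0)),
      ((1, -1), (2, -1))]

/-- Kernel certificate: unit darts, connected. [folklore] -/
private theorem good_DPse_m1_0 : GoodEdgeList E_DPse_m1_0 := ⟨by decide, ⟨(-1, 0), by decide, 18, by decide⟩⟩

/-- The domino monomials of instance `DPse_m1_0` (kernel evaluation of `dominoTerms`). [folklore] -/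
private theorem terms_DPse_m1_0 : dominoTerms E_DPse_m1_0 18 (-1, 0) (0, 0) =
  [(0, 2, Int.ofNat 0), (1, 2, Int.ofNat 1), (2, 1, Int.ofNat 0), (3, 2, Int.negSucc 0), (4, 3, Int.ofNat 0), (4, 6, Int.ofNat 2), (5, 3, Int.ofNat 1),
      (6, 3, Int.negSucc 0), (6, 6, Int.negSucc 2)] := by
  decide

/-- The exact domino relation instantiated on `DPse_m1_0`. [folklore] -/
private theorem inst_DPse_m1_0 {x σ : ℝ} {c : Fin 7 → ℂ} (h : ExactDominoRelationZ2 x σ c) :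
    c 0 * ((x : ℂ) ^ (2 : ℕ)) + c 1 * ((x : ℂ) ^ (2 : ℕ) * tOf σ) + c 2 * ((x : ℂ)) + c 3 * ((x : ℂ) ^ (2 : ℕ) * (tOf σ)⁻¹) +
        c 4 * ((x : ℂ) ^ (3 : ℕ) +
      (x : ℂ) ^ (6 : ℕ) * tOf σ ^ (2 : ℕ)) + c 5 * ((x : ℂ) ^ (3 : ℕ) * tOf σ) + c 6 * ((x : ℂ) ^ (3 : ℕ) * (tOf σ)⁻¹ +
      (x : ℂ) ^ (6 : ℕ) * (tOf σ)⁻¹ ^ (3 : ℕ)) = 0 := by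
  have h0 := inst good_DPse_m1_0 (r := (-1, 0)) (v := (0, 0)) 1 (by decide) (by decide) (by decide)
    (fuel := 18) (by decide) (by decide) h
  rw [terms_DPse_m1_0] at h0
  simp only [List.map_cons, List.map_nil, List.sum_cons, List.sum_nil, add_zero, tpow_ofNat, tpow_negSucc, zero_add, Nat.reduceAdd, pow_zero, mul_one,
      pow_one] at h0
  linear_combination h0

/-- Edge list of instance `DPnw_1_m1`: `DP0` with the unit square north-west of `(0,0)` closed through the extra vertex `(-1,1)`, root `(1, -1)`. [folklore] -/
def E_DPnw_1_m1 : List (ZZ × ZZ) :=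
  [((0, 0), (1, 0)), ((0, 0), (0, 1)), ((-1, 0), (0, 0)), ((0, -1), (0, 0)), ((1, 0), (2, 0)), ((1, 0), (1, 1)), ((1, -1), (1, 0)), ((-1, 0), (-1, 1)),
      ((-1, 1), (0, 1))]

/-- Kernel certificate: unit darts, connected. [folklore] -/
private theorem good_DPnw_1_m1 : GoodEdgeList E_DPnw_1_m1 := ⟨by decide, ⟨(1, -1), by decide, 18, by decide⟩⟩

/-- The domino monomials of instance `DPnw_1_m1` (kernel evaluation of `dominoTerms`). [folklore] -/
private theorem terms_DPnw_1_m1 : dominoTerms E_DPnw_1_m1 18 (1, -1) (0, 0) =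
  [(0, 2, Int.ofNat 1), (1, 3, Int.ofNat 0), (1, 6, Int.negSucc 1), (2, 3, Int.ofNat 1), (2, 6, Int.ofNat 3), (3, 3, Int.ofNat 2), (4, 2,
      Int.negSucc 0), (5, 2, Int.ofNat 0), (6, 1, Int.ofNat 0)] := by
  decide

/-- The exact domino relation instantiated on `DPnw_1_m1`. [folklore] -/
private theorem inst_DPnw_1_m1 {x σ : ℝ} {c : Fin 7 → ℂ} (h : ExactDominoRelationZ2 x σ c) :
    c 0 * ((x : ℂ) ^ (2 : ℕ) * tOf σ) + c 1 * ((x : ℂ) ^ (3 : ℕ) + (x : ℂ) ^ (6 : ℕ) * (tOf σ)⁻¹ ^ (2 : ℕ)) + c 2 * ((x : ℂ) ^ (3 : ℕ) * tOf σ +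
      (x : ℂ) ^ (6 : ℕ) * tOf σ ^ (3 : ℕ)) + c 3 * ((x : ℂ) ^ (3 : ℕ) * tOf σ ^ (2 : ℕ)) + c 4 * ((x : ℂ) ^ (2 : ℕ) * (tOf σ)⁻¹) +
          c 5 * ((x : ℂ) ^ (2 : ℕ)) +
      c 6 * ((x : ℂ)) = 0 := by
  have h0 := inst good_DPnw_1_m1 (r := (1, -1)) (v := (0, 0)) 0 (by decide) (by decide) (by decide)
    (fuel := 18) (by decide) (by decide) h
  rw [terms_DPnw_1_m1] at h0
  simp only [List.map_cons, List.map_nil, List.sum_cons, List.sum_nil, add_zero, tpow_ofNat, tpow_negSucc, zero_add, Nat.reduceAdd, pow_zero, mul_one,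
      pow_one] at h0
  linear_combination h0

/-- Edge list of instance `DPse_0_1`: `DP0` with the unit square south-east of `(1,0)` closed through `(2,-1)` (the `R180` image of `DPnw`), root `(0, 1)`. [folklore] -/
def E_DPse_0_1 : List (ZZ × ZZ) :=
  [((0, 0), (1, 0)), ((0, 0), (0, 1)), ((-1, 0), (0, 0)), ((0, -1), (0, 0)), ((1, 0), (2, 0)), ((1, 0), (1, 1)), ((1, -1), (1, 0)), ((2, -1), (2, 0)),
      ((1, -1), (2, -1))]

/-- Kernel certificate: unit darts, connected. [folklore] -/
private theorem good_DPse_0_1 : GoodEdgeList E_DPse_0_1 := ⟨by decide, ⟨(0, 1), by decide, 18, by decide⟩⟩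

/-- The domino monomials of instance `DPse_0_1` (kernel evaluation of `dominoTerms`). [folklore] -/
private theorem terms_DPse_0_1 : dominoTerms E_DPse_0_1 18 (0, 1) (0, 0) =
  [(0, 2, Int.ofNat 1), (1, 1, Int.ofNat 0), (2, 2, Int.negSucc 0), (3, 2, Int.ofNat 0), (4, 3, Int.ofNat 1), (4, 6, Int.ofNat 3), (5, 3, Int.ofNat 2),
      (6, 3, Int.ofNat 0), (6, 6, Int.negSucc 1)] := by
  decide

/-- The exact domino relation instantiated on `DPse_0_1`. [folklore] -/
private theorem inst_DPse_0_1 {x σ : ℝ} {c : Fin 7 → ℂ} (h : ExactDominoRelationZ2 x σ c) :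
    c 0 * ((x : ℂ) ^ (2 : ℕ) * tOf σ) + c 1 * ((x : ℂ)) + c 2 * ((x : ℂ) ^ (2 : ℕ) * (tOf σ)⁻¹) + c 3 * ((x : ℂ) ^ (2 : ℕ)) +
      c 4 * ((x : ℂ) ^ (3 : ℕ) * tOf σ + (x : ℂ) ^ (6 : ℕ) * tOf σ ^ (3 : ℕ)) + c 5 * ((x : ℂ) ^ (3 : ℕ) * tOf σ ^ (2 : ℕ)) +
          c 6 * ((x : ℂ) ^ (3 : ℕ) +
      (x : ℂ) ^ (6 : ℕ) * (tOf σ)⁻¹ ^ (2 : ℕ)) = 0 := by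
  have h0 := inst good_DPse_0_1 (r := (0, 1)) (v := (0, 0)) 1 (by decide) (by decide) (by decide)
    (fuel := 18) (by decide) (by decide) h
  rw [terms_DPse_0_1] at h0
  simp only [List.map_cons, List.map_nil, List.sum_cons, List.sum_nil, add_zero, tpow_ofNat, tpow_negSucc, zero_add, Nat.reduceAdd, pow_zero, mul_one,
      pow_one] at h0
  linear_combination h0

/-- Edge list of instance `DPne_m1_0`: `DP0` with the unit square north-east of `(1,0)` closed through `(2,1)`, root `(-1, 0)`. [folklore] -/
def E_DPne_m1_0 : List (ZZ × ZZ) :=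
  [((0, 0), (1, 0)), ((0, 0), (0, 1)), ((-1, 0), (0, 0)), ((0, -1), (0, 0)), ((1, 0), (2, 0)), ((1, 0), (1, 1)), ((1, -1), (1, 0)), ((2, 0), (2, 1)),
      ((1, 1), (2, 1))]

/-- Kernel certificate: unit darts, connected. [folklore] -/
private theorem good_DPne_m1_0 : GoodEdgeList E_DPne_m1_0 := ⟨by decide, ⟨(-1, 0), by decide, 18, by decide⟩⟩

/-- The domino monomials of instance `DPne_m1_0` (kernel evaluation of `dominoTerms`). [folklore] -/
private theorem terms_DPne_m1_0 : dominoTerms E_DPne_m1_0 18 (-1, 0) (0, 0) =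
  [(0, 2, Int.ofNat 0), (1, 2, Int.ofNat 1), (2, 1, Int.ofNat 0), (3, 2, Int.negSucc 0), (4, 3, Int.ofNat 0), (4, 6, Int.negSucc 1), (5, 3,
      Int.ofNat 1), (5, 6, Int.ofNat 3), (6, 3, Int.negSucc 0)] := by
  decide

/-- The exact domino relation instantiated on `DPne_m1_0`. [folklore] -/
private theorem inst_DPne_m1_0 {x σ : ℝ} {c : Fin 7 → ℂ} (h : ExactDominoRelationZ2 x σ c) :
    c 0 * ((x : ℂ) ^ (2 : ℕ)) + c 1 * ((x : ℂ) ^ (2 : ℕ) * tOf σ) + c 2 * ((x : ℂ)) + c 3 * ((x : ℂ) ^ (2 : ℕ) * (tOf σ)⁻¹) +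
        c 4 * ((x : ℂ) ^ (3 : ℕ) +
      (x : ℂ) ^ (6 : ℕ) * (tOf σ)⁻¹ ^ (2 : ℕ)) + c 5 * ((x : ℂ) ^ (3 : ℕ) * tOf σ + (x : ℂ) ^ (6 : ℕ) * tOf σ ^ (3 : ℕ)) +
      c 6 * ((x : ℂ) ^ (3 : ℕ) * (tOf σ)⁻¹) = 0 := by
  have h0 := inst good_DPne_m1_0 (r := (-1, 0)) (v := (0, 0)) 1 (by decide) (by decide) (by decide)
    (fuel := 18) (by decide) (by decide) h
  rw [terms_DPne_m1_0] at h0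
  simp only [List.map_cons, List.map_nil, List.sum_cons, List.sum_nil, add_zero, tpow_ofNat, tpow_negSucc, zero_add, Nat.reduceAdd, pow_zero, mul_one,
      pow_one] at h0
  linear_combination h0

/-- Edge list of instance `DPsw_2_0`: `DP0` with the unit square south-west of `(0,0)` closed through `(-1,-1)` (the `R180` image of `DPne`), root `(2, 0)`. [folklore] -/
def E_DPsw_2_0 : List (ZZ × ZZ) :=
  [((0, 0), (1, 0)), ((0, 0), (0, 1)), ((-1, 0), (0, 0)), ((0, -1), (0, 0)), ((1, 0), (2, 0)), ((1, 0), (1, 1)), ((1, -1), (1, 0)), ((-1, -1), (-1,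
      0)), ((-1, -1), (0, -1))]

/-- Kernel certificate: unit darts, connected. [folklore] -/
private theorem good_DPsw_2_0 : GoodEdgeList E_DPsw_2_0 := ⟨by decide, ⟨(2, 0), by decide, 18, by decide⟩⟩

/-- The domino monomials of instance `DPsw_2_0` (kernel evaluation of `dominoTerms`). [folklore] -/
private theorem terms_DPsw_2_0 : dominoTerms E_DPsw_2_0 18 (2, 0) (0, 0) =
  [(0, 2, Int.ofNat 0), (1, 3, Int.negSucc 0), (2, 3, Int.ofNat 0), (2, 6, Int.negSucc 1), (3, 3, Int.ofNat 1), (3, 6, Int.ofNat 3), (4, 1,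
      Int.ofNat 0), (5, 2, Int.negSucc 0), (6, 2, Int.ofNat 1)] := by
  decide

/-- The exact domino relation instantiated on `DPsw_2_0`. [folklore] -/
private theorem inst_DPsw_2_0 {x σ : ℝ} {c : Fin 7 → ℂ} (h : ExactDominoRelationZ2 x σ c) :
    c 0 * ((x : ℂ) ^ (2 : ℕ)) + c 1 * ((x : ℂ) ^ (3 : ℕ) * (tOf σ)⁻¹) + c 2 * ((x : ℂ) ^ (3 : ℕ) + (x : ℂ) ^ (6 : ℕ) * (tOf σ)⁻¹ ^ (2 : ℕ)) +
      c 3 * ((x : ℂ) ^ (3 : ℕ) * tOf σ + (x : ℂ) ^ (6 : ℕ) * tOf σ ^ (3 : ℕ)) + c 4 * ((x : ℂ)) + c 5 * ((x : ℂ) ^ (2 : ℕ) * (tOf σ)⁻¹) +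
      c 6 * ((x : ℂ) ^ (2 : ℕ) * tOf σ) = 0 := by
  have h0 := inst good_DPsw_2_0 (r := (2, 0)) (v := (0, 0)) 0 (by decide) (by decide) (by decide)
    (fuel := 18) (by decide) (by decide) h
  rw [terms_DPsw_2_0] at h0
  simp only [List.map_cons, List.map_nil, List.sum_cons, List.sum_nil, add_zero, tpow_ofNat, tpow_negSucc, zero_add, Nat.reduceAdd, pow_zero, mul_one,
      pow_one] at h0
  linear_combination h0

/-- Edge list of instance `DPne_0_1`: `DP0` with the unit square north-east of `(1,0)` closed through `(2,1)`, root `(0, 1)`. [folklore] -/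
def E_DPne_0_1 : List (ZZ × ZZ) :=
  [((0, 0), (1, 0)), ((0, 0), (0, 1)), ((-1, 0), (0, 0)), ((0, -1), (0, 0)), ((1, 0), (2, 0)), ((1, 0), (1, 1)), ((1, -1), (1, 0)), ((2, 0), (2, 1)),
      ((1, 1), (2, 1))]

/-- Kernel certificate: unit darts, connected. [folklore] -/
private theorem good_DPne_0_1 : GoodEdgeList E_DPne_0_1 := ⟨by decide, ⟨(0, 1), by decide, 18, by decide⟩⟩

/-- The domino monomials of instance `DPne_0_1` (kernel evaluation of `dominoTerms`). [folklore] -/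
private theorem terms_DPne_0_1 : dominoTerms E_DPne_0_1 18 (0, 1) (0, 0) =
  [(0, 2, Int.ofNat 1), (1, 1, Int.ofNat 0), (2, 2, Int.negSucc 0), (3, 2, Int.ofNat 0), (4, 3, Int.ofNat 1), (4, 6, Int.negSucc 0), (5, 3,
      Int.ofNat 2), (5, 6, Int.ofNat 4), (6, 3, Int.ofNat 0)] := by
  decide

/-- The exact domino relation instantiated on `DPne_0_1`. [folklore] -/
private theorem inst_DPne_0_1 {x σ : ℝ} {c : Fin 7 → ℂ} (h : ExactDominoRelationZ2 x σ c) :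
    c 0 * ((x : ℂ) ^ (2 : ℕ) * tOf σ) + c 1 * ((x : ℂ)) + c 2 * ((x : ℂ) ^ (2 : ℕ) * (tOf σ)⁻¹) + c 3 * ((x : ℂ) ^ (2 : ℕ)) +
      c 4 * ((x : ℂ) ^ (3 : ℕ) * tOf σ + (x : ℂ) ^ (6 : ℕ) * (tOf σ)⁻¹) + c 5 * ((x : ℂ) ^ (3 : ℕ) * tOf σ ^ (2 : ℕ) +
          (x : ℂ) ^ (6 : ℕ) * tOf σ ^ (4 : ℕ)) +
      c 6 * ((x : ℂ) ^ (3 : ℕ)) = 0 := by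
  have h0 := inst good_DPne_0_1 (r := (0, 1)) (v := (0, 0)) 1 (by decide) (by decide) (by decide)
    (fuel := 18) (by decide) (by decide) h
  rw [terms_DPne_0_1] at h0
  simp only [List.map_cons, List.map_nil, List.sum_cons, List.sum_nil, add_zero, tpow_ofNat, tpow_negSucc, zero_add, pow_zero, mul_one, pow_one] at h0
  linear_combination h0

/-- Edge list of instance `DPsw_1_m1`: `DP0` with the unit square south-west of `(0,0)` closed through `(-1,-1)` (the `R180` image of `DPne`), root `(1, -1)`. [folklore] -/
def E_DPsw_1_m1 : List (ZZ × ZZ) :=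
  [((0, 0), (1, 0)), ((0, 0), (0, 1)), ((-1, 0), (0, 0)), ((0, -1), (0, 0)), ((1, 0), (2, 0)), ((1, 0), (1, 1)), ((1, -1), (1, 0)), ((-1, -1), (-1,
      0)), ((-1, -1), (0, -1))]

/-- Kernel certificate: unit darts, connected. [folklore] -/
private theorem good_DPsw_1_m1 : GoodEdgeList E_DPsw_1_m1 := ⟨by decide, ⟨(1, -1), by decide, 18, by decide⟩⟩

/-- The domino monomials of instance `DPsw_1_m1` (kernel evaluation of `dominoTerms`). [folklore] -/
private theorem terms_DPsw_1_m1 : dominoTerms E_DPsw_1_m1 18 (1, -1) (0, 0) =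
  [(0, 2, Int.ofNat 1), (1, 3, Int.ofNat 0), (2, 3, Int.ofNat 1), (2, 6, Int.negSucc 0), (3, 3, Int.ofNat 2), (3, 6, Int.ofNat 4), (4, 2,
      Int.negSucc 0), (5, 2, Int.ofNat 0), (6, 1, Int.ofNat 0)] := by
  decide

/-- The exact domino relation instantiated on `DPsw_1_m1`. [folklore] -/
private theorem inst_DPsw_1_m1 {x σ : ℝ} {c : Fin 7 → ℂ} (h : ExactDominoRelationZ2 x σ c) :
    c 0 * ((x : ℂ) ^ (2 : ℕ) * tOf σ) + c 1 * ((x : ℂ) ^ (3 : ℕ)) + c 2 * ((x : ℂ) ^ (3 : ℕ) * tOf σ + (x : ℂ) ^ (6 : ℕ) * (tOf σ)⁻¹) +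
      c 3 * ((x : ℂ) ^ (3 : ℕ) * tOf σ ^ (2 : ℕ) + (x : ℂ) ^ (6 : ℕ) * tOf σ ^ (4 : ℕ)) + c 4 * ((x : ℂ) ^ (2 : ℕ) * (tOf σ)⁻¹) +
          c 5 * ((x : ℂ) ^ (2 : ℕ)) +
      c 6 * ((x : ℂ)) = 0 := by
  have h0 := inst good_DPsw_1_m1 (r := (1, -1)) (v := (0, 0)) 0 (by decide) (by decide) (by decide)
    (fuel := 18) (by decide) (by decide) h
  rw [terms_DPsw_1_m1] at h0
  simp only [List.map_cons, List.map_nil, List.sum_cons, List.sum_nil, add_zero, tpow_ofNat, tpow_negSucc, zero_add, pow_zero, mul_one, pow_one] at h0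
  linear_combination h0

/-! ### Algebraic core: the twenty-two rows force `c = 0`

The rotation `R180` about the centre of the domino maps the domino stencil to itself, slot `k ↦ π(k)`
(`π` swaps `1 ↔ 6`, `2 ↔ 4`, `3 ↔ 5`, fixes `0`) and preserves windings, so the row of the image
instance is the `π`-permuted row. Sum and difference of the relations of an `R180`-pair split the
unknowns into the symmetric combinations `(2c₀, c₁ + c₆, c₂ + c₄, c₃ + c₅)` and the antisymmetric
ones `(c₁ - c₆, c₂ - c₄, c₃ - c₅)`. In each sector a few `4 × 4` (resp. `3 × 3`) minors of the row
matrix — expanded below by their cofactors — generate, with explicit multipliers, a monomial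
`x^a t^b` (exact Nullstellensatz certificates over `ℚ`, found by linear algebra and checked by
`linear_combination`; `s` stands for `t⁻¹`, used only through `t s = 1`). -/

/-- Cofactor expansion: minor 1 of the symmetric sector annihilates every unknown of the sector. [folklore] -/
private theorem minor_sym1 {x t s U0 U1 U2 U3 : ℂ} (hs : t * s = 1)
    (h1 : (x ^ (2 : ℕ) * t) * U0 + (x + x ^ (3 : ℕ)) * U1 + (x ^ (2 : ℕ) * s + x ^ (3 : ℕ) * t) * U2 + (x ^ (2 : ℕ) +
        x ^ (3 : ℕ) * t ^ (2 : ℕ)) * U3 = 0)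
    (h2 : (x ^ (2 : ℕ)) * U0 + (x ^ (2 : ℕ) * t + x ^ (3 : ℕ) * s) * U1 + (x + x ^ (3 : ℕ)) * U2 + (x ^ (2 : ℕ) * s + x ^ (3 : ℕ) * t) * U3 = 0)
    (h3 : (x ^ (2 : ℕ)) * U0 + (x ^ (2 : ℕ) * t + x ^ (3 : ℕ) * s + x ^ (6 : ℕ) * s ^ (3 : ℕ)) * U1 + (x + x ^ (3 : ℕ) +
        x ^ (6 : ℕ) * t ^ (2 : ℕ)) * U2 +
      (x ^ (2 : ℕ) * s + x ^ (3 : ℕ) * t) * U3 = 0)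
    (h4 : (x ^ (2 : ℕ)) * U0 + (x ^ (2 : ℕ) * t + x ^ (3 : ℕ) * s) * U1 + (x + x ^ (3 : ℕ) + x ^ (6 : ℕ) * s ^ (2 : ℕ)) * U2 + (x ^ (2 : ℕ) * s +
      x ^ (3 : ℕ) * t + x ^ (6 : ℕ) * t ^ (3 : ℕ)) * U3 = 0) :
    (-(x ^ (15 : ℕ) * t) + -(x ^ (15 : ℕ) * t ^ (5 : ℕ)) + x ^ (16 : ℕ) * s + x ^ (16 : ℕ) * t ^ (7 : ℕ)) * U0 = 0 ∧
    (-(x ^ (15 : ℕ) * t) + -(x ^ (15 : ℕ) * t ^ (5 : ℕ)) + x ^ (16 : ℕ) * s + x ^ (16 : ℕ) * t ^ (7 : ℕ)) * U1 = 0 ∧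
    (-(x ^ (15 : ℕ) * t) + -(x ^ (15 : ℕ) * t ^ (5 : ℕ)) + x ^ (16 : ℕ) * s + x ^ (16 : ℕ) * t ^ (7 : ℕ)) * U2 = 0 ∧
    (-(x ^ (15 : ℕ) * t) + -(x ^ (15 : ℕ) * t ^ (5 : ℕ)) + x ^ (16 : ℕ) * s + x ^ (16 : ℕ) * t ^ (7 : ℕ)) * U3 = 0 := by
  refine ⟨?_, ?_, ?_, ?_⟩
  · linear_combination (-(x ^ (13 : ℕ)) + x ^ (14 : ℕ) * s ^ (6 : ℕ) + x ^ (14 : ℕ) * t ^ (6 : ℕ) + -(x ^ (15 : ℕ)) + x ^ (15 : ℕ) * s ^ (4 : ℕ) +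
        x ^ (15 : ℕ) * t ^ (4 : ℕ)) * h1 + (-(x ^ (8 : ℕ) * t ^ (3 : ℕ)) + -(x ^ (9 : ℕ) * t) + -(x ^ (10 : ℕ) * s) + x ^ (10 : ℕ) * s ^ (5 : ℕ) +
            -(x ^ (10 : ℕ) * t ^ (3 : ℕ)) +
        x ^ (11 : ℕ) * s ^ (3 : ℕ) + (2 : ℂ) * x ^ (11 : ℕ) * t ^ (5 : ℕ) + -(x ^ (13 : ℕ) * t ^ (5 : ℕ)) + x ^ (14 : ℕ) * s +
            -(x ^ (14 : ℕ) * s ^ (5 : ℕ)) +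
        -(x ^ (15 : ℕ) * s ^ (3 : ℕ)) + x ^ (15 : ℕ) * t + -(x ^ (15 : ℕ) * t ^ (5 : ℕ))) * h2 + (x ^ (8 : ℕ) * t ^ (3 : ℕ) +
            -(x ^ (9 : ℕ) * s ^ (3 : ℕ)) + x ^ (10 : ℕ) * t ^ (3 : ℕ) + -(x ^ (11 : ℕ) * t ^ (5 : ℕ))) * h3 + (x ^ (9 : ℕ) * s ^ (3 : ℕ) +
            x ^ (9 : ℕ) * t + x ^ (10 : ℕ) * s + -(x ^ (10 : ℕ) * s ^ (5 : ℕ)) + -(x ^ (11 : ℕ) * s ^ (3 : ℕ)) +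
        -(x ^ (11 : ℕ) * t ^ (5 : ℕ))) * h4 + ((-(x ^ (16 : ℕ) * s ^ (5 : ℕ)) + -(x ^ (17 : ℕ) * s ^ (3 : ℕ))) * U0 + (-(x ^ (14 : ℕ)) +
            -(x ^ (14 : ℕ) * t * s) +
        -(x ^ (14 : ℕ) * t ^ (2 : ℕ) * s ^ (2 : ℕ)) + (-2 : ℂ) * x ^ (16 : ℕ) + x ^ (16 : ℕ) * s ^ (4 : ℕ) + -(x ^ (16 : ℕ) * t * s) +
        -(x ^ (16 : ℕ) * t ^ (2 : ℕ) * s ^ (2 : ℕ)) + x ^ (16 : ℕ) * t ^ (4 : ℕ) + x ^ (17 : ℕ) * s ^ (2 : ℕ) + x ^ (17 : ℕ) * t ^ (2 : ℕ) +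
        x ^ (17 : ℕ) * t ^ (3 : ℕ) * s + x ^ (17 : ℕ) * t ^ (4 : ℕ) * s ^ (2 : ℕ) + -(x ^ (18 : ℕ)) + x ^ (18 : ℕ) * t ^ (4 : ℕ)) * U1 +
        (x ^ (15 : ℕ) * t * s ^ (2 : ℕ) + -(x ^ (16 : ℕ) * t ^ (5 : ℕ)) + -(x ^ (17 : ℕ) * s ^ (5 : ℕ)) + x ^ (17 : ℕ) * t ^ (4 : ℕ) * s +
        -(x ^ (18 : ℕ) * s ^ (3 : ℕ))) * U2 + (-(x ^ (15 : ℕ)) + -(x ^ (15 : ℕ) * t * s) + -(x ^ (15 : ℕ) * t ^ (2 : ℕ) * s ^ (2 : ℕ)) +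
        x ^ (15 : ℕ) * t ^ (4 : ℕ) + x ^ (16 : ℕ) * s ^ (2 : ℕ) + x ^ (16 : ℕ) * t * s ^ (3 : ℕ) + -(x ^ (16 : ℕ) * t ^ (2 : ℕ)) +
        x ^ (16 : ℕ) * t ^ (2 : ℕ) * s ^ (4 : ℕ) + -(x ^ (17 : ℕ)) + x ^ (17 : ℕ) * t * s + -(x ^ (17 : ℕ) * t * s ^ (5 : ℕ)) +
        x ^ (17 : ℕ) * t ^ (2 : ℕ) * s ^ (2 : ℕ) + x ^ (17 : ℕ) * t ^ (4 : ℕ) + -(x ^ (18 : ℕ) * t * s ^ (3 : ℕ))) * U3) * hs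
  · linear_combination (-(x ^ (14 : ℕ) * t ^ (5 : ℕ))) * h1 + (x ^ (9 : ℕ) * t ^ (4 : ℕ) + -(x ^ (10 : ℕ) * t ^ (2 : ℕ)) +
      x ^ (14 : ℕ) * t ^ (6 : ℕ)) * h2 + (-(x ^ (9 : ℕ) * t ^ (4 : ℕ)) + x ^ (10 : ℕ) * t ^ (2 : ℕ)) * h3 + ((x ^ (15 : ℕ) * t +
      x ^ (15 : ℕ) * t ^ (2 : ℕ) * s + x ^ (15 : ℕ) * t ^ (3 : ℕ) * s ^ (2 : ℕ) + -(x ^ (16 : ℕ) * s) +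
        -(x ^ (16 : ℕ) * t * s ^ (2 : ℕ)) + -(x ^ (17 : ℕ) * t ^ (5 : ℕ))) * U1 + (x ^ (16 : ℕ) * t ^ (4 : ℕ)) * U2 +
            (-(x ^ (16 : ℕ) * t ^ (5 : ℕ))) * U3) * hs
  · linear_combination (x ^ (14 : ℕ)) * h1 + (x ^ (9 : ℕ) * t ^ (3 : ℕ) + -(x ^ (10 : ℕ) * t ^ (5 : ℕ)) + -(x ^ (14 : ℕ) * t)) * h2 +
      (-(x ^ (9 : ℕ) * t ^ (3 : ℕ)) + x ^ (10 : ℕ) * t ^ (5 : ℕ)) * h3 + ((x ^ (15 : ℕ) + x ^ (15 : ℕ) * t * s +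
      x ^ (15 : ℕ) * t ^ (2 : ℕ) * s ^ (2 : ℕ) + -(x ^ (16 : ℕ) * t ^ (2 : ℕ)) + -(x ^ (16 : ℕ) * t ^ (3 : ℕ) * s) +
        -(x ^ (16 : ℕ) * t ^ (4 : ℕ) * s ^ (2 : ℕ)) + x ^ (17 : ℕ)) * U1 + (x ^ (16 : ℕ)) * U3) * hs
  · linear_combination (-(x ^ (14 : ℕ) * s ^ (5 : ℕ))) * h1 + (x ^ (9 : ℕ) * t ^ (2 : ℕ) + x ^ (10 : ℕ) + -(x ^ (10 : ℕ) * s ^ (4 : ℕ)) +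
      -(x ^ (10 : ℕ) * t ^ (4 : ℕ)) + x ^ (14 : ℕ) * s ^ (4 : ℕ)) * h2 + (x ^ (9 : ℕ) * s ^ (2 : ℕ) + -(x ^ (10 : ℕ))) * h3 +
      (-(x ^ (9 : ℕ) * s ^ (2 : ℕ)) + -(x ^ (9 : ℕ) * t ^ (2 : ℕ)) + x ^ (10 : ℕ) * s ^ (4 : ℕ) + x ^ (10 : ℕ) * t ^ (4 : ℕ)) * h4 +
      ((x ^ (16 : ℕ) * s ^ (4 : ℕ)) * U0 + (-(x ^ (16 : ℕ) * s ^ (3 : ℕ))) * U1 + (-(x ^ (16 : ℕ) * t ^ (2 : ℕ)) + -(x ^ (16 : ℕ) * t ^ (3 : ℕ) * s) +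
        x ^ (17 : ℕ) * s ^ (4 : ℕ)) * U2 + (x ^ (15 : ℕ) * t + x ^ (15 : ℕ) * t ^ (2 : ℕ) * s + -(x ^ (16 : ℕ) * s) +
            -(x ^ (16 : ℕ) * t * s ^ (2 : ℕ)) +
        -(x ^ (16 : ℕ) * t ^ (2 : ℕ) * s ^ (3 : ℕ)) + x ^ (17 : ℕ) * t * s ^ (4 : ℕ)) * U3) * hs

/-- Cofactor expansion: minor 2 of the symmetric sector annihilates every unknown of the sector. [folklore] -/
private theorem minor_sym2 {x t s U0 U1 U2 U3 : ℂ} (hs : t * s = 1)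
    (h1 : (x ^ (2 : ℕ) * t) * U0 + (x + x ^ (3 : ℕ)) * U1 + (x ^ (2 : ℕ) * s + x ^ (3 : ℕ) * t) * U2 + (x ^ (2 : ℕ) +
        x ^ (3 : ℕ) * t ^ (2 : ℕ)) * U3 = 0)
    (h2 : (x ^ (2 : ℕ) * t + x ^ (5 : ℕ) * t ^ (3 : ℕ)) * U0 + (x + x ^ (3 : ℕ) + x ^ (4 : ℕ) * t ^ (2 : ℕ)) * U1 + (x ^ (2 : ℕ) * s +
        x ^ (3 : ℕ) * t +
      x ^ (5 : ℕ) * t) * U2 + (x ^ (2 : ℕ) + x ^ (3 : ℕ) * t ^ (2 : ℕ) + x ^ (5 : ℕ) * s ^ (2 : ℕ) + x ^ (5 : ℕ) * t ^ (2 : ℕ)) * U3 = 0)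
    (h3 : (x ^ (2 : ℕ) * t) * U0 + (x + x ^ (3 : ℕ) + x ^ (6 : ℕ) * s ^ (2 : ℕ)) * U1 + (x ^ (2 : ℕ) * s + x ^ (3 : ℕ) * t +
        x ^ (6 : ℕ) * t ^ (3 : ℕ)) * U2 +
      (x ^ (2 : ℕ) + x ^ (3 : ℕ) * t ^ (2 : ℕ)) * U3 = 0)
    (h4 : (x ^ (2 : ℕ) * t) * U0 + (x + x ^ (3 : ℕ)) * U1 + (x ^ (2 : ℕ) * s + x ^ (3 : ℕ) * t + x ^ (6 : ℕ) * s) * U2 + (x ^ (2 : ℕ) +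
      x ^ (3 : ℕ) * t ^ (2 : ℕ) + x ^ (6 : ℕ) * t ^ (4 : ℕ)) * U3 = 0) :
    (x ^ (19 : ℕ) * s ^ (4 : ℕ) + -(x ^ (20 : ℕ) * t ^ (2 : ℕ)) + x ^ (20 : ℕ) * t ^ (6 : ℕ) + -(x ^ (20 : ℕ) * t ^ (10 : ℕ))) * U0 = 0 ∧
    (x ^ (19 : ℕ) * s ^ (4 : ℕ) + -(x ^ (20 : ℕ) * t ^ (2 : ℕ)) + x ^ (20 : ℕ) * t ^ (6 : ℕ) + -(x ^ (20 : ℕ) * t ^ (10 : ℕ))) * U1 = 0 ∧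
    (x ^ (19 : ℕ) * s ^ (4 : ℕ) + -(x ^ (20 : ℕ) * t ^ (2 : ℕ)) + x ^ (20 : ℕ) * t ^ (6 : ℕ) + -(x ^ (20 : ℕ) * t ^ (10 : ℕ))) * U2 = 0 ∧
    (x ^ (19 : ℕ) * s ^ (4 : ℕ) + -(x ^ (20 : ℕ) * t ^ (2 : ℕ)) + x ^ (20 : ℕ) * t ^ (6 : ℕ) + -(x ^ (20 : ℕ) * t ^ (10 : ℕ))) * U3 = 0 := by
  refine ⟨?_, ?_, ?_, ?_⟩
  · linear_combination (x ^ (12 : ℕ) * s ^ (3 : ℕ) + -(x ^ (12 : ℕ) * t) + x ^ (13 : ℕ) * s ^ (5 : ℕ) + -(x ^ (13 : ℕ) * t ^ (3 : ℕ)) +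
      (3 : ℂ) * x ^ (13 : ℕ) * t ^ (7 : ℕ) +
        (3 : ℂ) * x ^ (14 : ℕ) * s ^ (3 : ℕ) + -(x ^ (14 : ℕ) * t) + (-2 : ℂ) * x ^ (14 : ℕ) * t ^ (5 : ℕ) + x ^ (15 : ℕ) * s +
            -(x ^ (15 : ℕ) * t ^ (3 : ℕ)) +
        x ^ (15 : ℕ) * t ^ (7 : ℕ) + x ^ (16 : ℕ) * t ^ (9 : ℕ) + x ^ (17 : ℕ) * s + x ^ (17 : ℕ) * s ^ (5 : ℕ) + -(x ^ (17 : ℕ) * t ^ (3 : ℕ))) * h1 +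
            (-(x ^ (13 : ℕ) * t ^ (7 : ℕ)) + -(x ^ (14 : ℕ) * s ^ (3 : ℕ)) + x ^ (14 : ℕ) * t + -(x ^ (15 : ℕ) * s) + x ^ (15 : ℕ) * t ^ (3 : ℕ) +
        -(x ^ (15 : ℕ) * t ^ (7 : ℕ))) * h2 + (-(x ^ (12 : ℕ) * s ^ (3 : ℕ)) + x ^ (13 : ℕ) * t ^ (3 : ℕ) + -(x ^ (13 : ℕ) * t ^ (7 : ℕ)) +
            -(x ^ (14 : ℕ) * s ^ (3 : ℕ)) + -(x ^ (14 : ℕ) * t) +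
        x ^ (14 : ℕ) * t ^ (5 : ℕ)) * h3 + (x ^ (12 : ℕ) * t + -(x ^ (13 : ℕ) * s ^ (5 : ℕ)) + -(x ^ (13 : ℕ) * t ^ (7 : ℕ)) +
            -(x ^ (14 : ℕ) * s ^ (3 : ℕ)) + x ^ (14 : ℕ) * t +
        x ^ (14 : ℕ) * t ^ (5 : ℕ)) * h4 + ((-(x ^ (19 : ℕ) * s ^ (4 : ℕ)) + x ^ (19 : ℕ) * t * s + x ^ (19 : ℕ) * t ^ (2 : ℕ) * s ^ (2 : ℕ) +
            x ^ (20 : ℕ) * t ^ (2 : ℕ)) * U0 +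
        (x ^ (18 : ℕ) * s + x ^ (18 : ℕ) * t * s ^ (2 : ℕ) + -(x ^ (19 : ℕ) * t ^ (2 : ℕ) * s) + x ^ (19 : ℕ) * t ^ (5 : ℕ) +
            x ^ (19 : ℕ) * t ^ (6 : ℕ) * s +
        x ^ (20 : ℕ) * s + -(x ^ (20 : ℕ) * t ^ (3 : ℕ)) + -(x ^ (20 : ℕ) * t ^ (4 : ℕ) * s)) * U1 + (x ^ (18 : ℕ) * t * s +
        x ^ (18 : ℕ) * t ^ (2 : ℕ) * s ^ (2 : ℕ) + -(x ^ (18 : ℕ) * t ^ (8 : ℕ)) + x ^ (19 : ℕ) * s ^ (2 : ℕ) + x ^ (19 : ℕ) * t ^ (2 : ℕ) +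
        x ^ (19 : ℕ) * t ^ (6 : ℕ) + -(x ^ (20 : ℕ) * s ^ (4 : ℕ)) + x ^ (20 : ℕ) * t * s + x ^ (20 : ℕ) * t ^ (2 : ℕ) * s ^ (2 : ℕ) +
        -(x ^ (20 : ℕ) * t ^ (4 : ℕ))) * U2 + (x ^ (18 : ℕ) * t ^ (5 : ℕ) + x ^ (18 : ℕ) * t ^ (6 : ℕ) * s + x ^ (19 : ℕ) * s +
        (2 : ℂ) * x ^ (19 : ℕ) * t * s ^ (2 : ℕ) + x ^ (19 : ℕ) * t ^ (2 : ℕ) * s ^ (3 : ℕ) + x ^ (19 : ℕ) * t ^ (3 : ℕ) * s ^ (4 : ℕ) +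
        -(x ^ (20 : ℕ) * s ^ (3 : ℕ)) + -(x ^ (20 : ℕ) * t * s ^ (4 : ℕ)) + x ^ (20 : ℕ) * t ^ (3 : ℕ) * s ^ (2 : ℕ) + x ^ (20 : ℕ) * t ^ (5 : ℕ) +
        x ^ (20 : ℕ) * t ^ (6 : ℕ) * s) * U3) * hs
  · linear_combination (-(x ^ (13 : ℕ) * s ^ (2 : ℕ)) + x ^ (13 : ℕ) * t ^ (2 : ℕ) + x ^ (14 : ℕ) * t ^ (4 : ℕ) +
      (-3 : ℂ) * x ^ (14 : ℕ) * t ^ (8 : ℕ) +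
        -(x ^ (17 : ℕ) * t ^ (10 : ℕ))) * h1 + (x ^ (14 : ℕ) * t ^ (8 : ℕ)) * h2 + (x ^ (13 : ℕ) * s ^ (2 : ℕ) + -(x ^ (14 : ℕ) * t ^ (4 : ℕ)) +
            x ^ (14 : ℕ) * t ^ (8 : ℕ)) * h3 + (-(x ^ (13 : ℕ) * t ^ (2 : ℕ)) + x ^ (14 : ℕ) * t ^ (8 : ℕ)) * h4 + ((x ^ (20 : ℕ) * t ^ (2 : ℕ) +
            x ^ (20 : ℕ) * t ^ (3 : ℕ) * s + -(x ^ (20 : ℕ) * t ^ (6 : ℕ)) + -(x ^ (20 : ℕ) * t ^ (7 : ℕ) * s)) * U1 +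
        (-(x ^ (19 : ℕ) * t ^ (2 : ℕ) * s) + x ^ (19 : ℕ) * t ^ (9 : ℕ) + -(x ^ (20 : ℕ) * t ^ (7 : ℕ))) * U2 + (-(x ^ (19 : ℕ) * t ^ (6 : ℕ)) +
        -(x ^ (19 : ℕ) * t ^ (7 : ℕ) * s)) * U3) * hs
  · linear_combination (-(x ^ (13 : ℕ) * s ^ (3 : ℕ)) + (2 : ℂ) * x ^ (14 : ℕ) * t ^ (3 : ℕ) + x ^ (14 : ℕ) * t ^ (7 : ℕ) +
      x ^ (17 : ℕ) * t ^ (5 : ℕ)) * h1 + (-(x ^ (14 : ℕ) * t ^ (3 : ℕ))) * h2 + (-(x ^ (14 : ℕ) * t ^ (7 : ℕ))) * h3 + (x ^ (13 : ℕ) * s ^ (3 : ℕ) +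
      -(x ^ (14 : ℕ) * t ^ (3 : ℕ))) * h4 + ((x ^ (20 : ℕ) * t ^ (5 : ℕ) + x ^ (20 : ℕ) * t ^ (6 : ℕ) * s) * U1 + (-(x ^ (19 : ℕ) * t ^ (4 : ℕ)) +
      x ^ (20 : ℕ) * t ^ (2 : ℕ)) * U2 +
        (-(x ^ (19 : ℕ) * t ^ (3 : ℕ) * s ^ (2 : ℕ))) * U3) * hs
  · linear_combination (-(x ^ (14 : ℕ) * s ^ (2 : ℕ)) + (-2 : ℂ) * x ^ (14 : ℕ) * t ^ (2 : ℕ) + x ^ (14 : ℕ) * t ^ (6 : ℕ) + -(x ^ (17 : ℕ))) * h1 +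
      (x ^ (14 : ℕ) * s ^ (2 : ℕ)) * h2 + (x ^ (14 : ℕ) * t ^ (2 : ℕ)) * h3 + (x ^ (14 : ℕ) * t ^ (2 : ℕ) + -(x ^ (14 : ℕ) * t ^ (6 : ℕ))) * h4 +
      ((-(x ^ (19 : ℕ) * t) + -(x ^ (19 : ℕ) * t ^ (2 : ℕ) * s)) * U0 + (-(x ^ (18 : ℕ)) + -(x ^ (18 : ℕ) * t * s) + -(x ^ (20 : ℕ)) +
        -(x ^ (20 : ℕ) * t * s)) * U1 + (-(x ^ (19 : ℕ) * s) + -(x ^ (20 : ℕ) * t) + x ^ (20 : ℕ) * t ^ (5 : ℕ)) * U2 + (-(x ^ (19 : ℕ)) +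
        -(x ^ (19 : ℕ) * t * s)) * U3) * hs

/-- Cofactor expansion: minor 3 of the symmetric sector annihilates every unknown of the sector. [folklore] -/
private theorem minor_sym3 {x t s U0 U1 U2 U3 : ℂ} (hs : t * s = 1)
    (h1 : (x ^ (2 : ℕ)) * U0 + (x ^ (2 : ℕ) * t + x ^ (3 : ℕ) * s) * U1 + (x + x ^ (3 : ℕ)) * U2 + (x ^ (2 : ℕ) * s + x ^ (3 : ℕ) * t) * U3 = 0)
    (h2 : (x ^ (2 : ℕ) + x ^ (5 : ℕ) * s ^ (2 : ℕ) + x ^ (5 : ℕ) * t ^ (2 : ℕ)) * U0 + (x ^ (2 : ℕ) * t + x ^ (3 : ℕ) * s + x ^ (4 : ℕ) * t +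
        x ^ (5 : ℕ) * s +
      x ^ (5 : ℕ) * t ^ (3 : ℕ) + x ^ (7 : ℕ) * t ^ (3 : ℕ)) * U1 + (x + x ^ (3 : ℕ) + (2 : ℂ) * x ^ (5 : ℕ)) * U2 + (x ^ (2 : ℕ) * s +
          x ^ (3 : ℕ) * t +
      x ^ (4 : ℕ) * s + x ^ (5 : ℕ) * s ^ (3 : ℕ) + x ^ (5 : ℕ) * t + x ^ (7 : ℕ) * s ^ (3 : ℕ)) * U3 = 0)
    (h3 : (x ^ (2 : ℕ)) * U0 + (x ^ (2 : ℕ) * t + x ^ (3 : ℕ) * s + x ^ (6 : ℕ) * s ^ (3 : ℕ)) * U1 + (x + x ^ (3 : ℕ) +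
        x ^ (6 : ℕ) * t ^ (2 : ℕ)) * U2 +
      (x ^ (2 : ℕ) * s + x ^ (3 : ℕ) * t) * U3 = 0)
    (h4 : (x ^ (2 : ℕ)) * U0 + (x ^ (2 : ℕ) * t + x ^ (3 : ℕ) * s) * U1 + (x + x ^ (3 : ℕ) + x ^ (6 : ℕ) * s ^ (2 : ℕ)) * U2 + (x ^ (2 : ℕ) * s +
      x ^ (3 : ℕ) * t + x ^ (6 : ℕ) * t ^ (3 : ℕ)) * U3 = 0) :
    (x ^ (18 : ℕ) * s ^ (2 : ℕ) + x ^ (18 : ℕ) * s ^ (6 : ℕ) + x ^ (18 : ℕ) * t ^ (2 : ℕ) + x ^ (18 : ℕ) * t ^ (6 : ℕ) + (-2 : ℂ) * x ^ (19 : ℕ) +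
      -(x ^ (20 : ℕ) * s ^ (6 : ℕ)) + -(x ^ (20 : ℕ) * t ^ (6 : ℕ)) + x ^ (21 : ℕ) * s ^ (8 : ℕ) + x ^ (21 : ℕ) * t ^ (8 : ℕ)) * U0 = 0 ∧
    (x ^ (18 : ℕ) * s ^ (2 : ℕ) + x ^ (18 : ℕ) * s ^ (6 : ℕ) + x ^ (18 : ℕ) * t ^ (2 : ℕ) + x ^ (18 : ℕ) * t ^ (6 : ℕ) + (-2 : ℂ) * x ^ (19 : ℕ) +
      -(x ^ (20 : ℕ) * s ^ (6 : ℕ)) + -(x ^ (20 : ℕ) * t ^ (6 : ℕ)) + x ^ (21 : ℕ) * s ^ (8 : ℕ) + x ^ (21 : ℕ) * t ^ (8 : ℕ)) * U1 = 0 ∧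
    (x ^ (18 : ℕ) * s ^ (2 : ℕ) + x ^ (18 : ℕ) * s ^ (6 : ℕ) + x ^ (18 : ℕ) * t ^ (2 : ℕ) + x ^ (18 : ℕ) * t ^ (6 : ℕ) + (-2 : ℂ) * x ^ (19 : ℕ) +
      -(x ^ (20 : ℕ) * s ^ (6 : ℕ)) + -(x ^ (20 : ℕ) * t ^ (6 : ℕ)) + x ^ (21 : ℕ) * s ^ (8 : ℕ) + x ^ (21 : ℕ) * t ^ (8 : ℕ)) * U2 = 0 ∧
    (x ^ (18 : ℕ) * s ^ (2 : ℕ) + x ^ (18 : ℕ) * s ^ (6 : ℕ) + x ^ (18 : ℕ) * t ^ (2 : ℕ) + x ^ (18 : ℕ) * t ^ (6 : ℕ) + (-2 : ℂ) * x ^ (19 : ℕ) +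
      -(x ^ (20 : ℕ) * s ^ (6 : ℕ)) + -(x ^ (20 : ℕ) * t ^ (6 : ℕ)) + x ^ (21 : ℕ) * s ^ (8 : ℕ) + x ^ (21 : ℕ) * t ^ (8 : ℕ)) * U3 = 0 := by
  refine ⟨?_, ?_, ?_, ?_⟩
  · linear_combination (x ^ (11 : ℕ) * s ^ (4 : ℕ) + x ^ (11 : ℕ) * t ^ (4 : ℕ) + x ^ (12 : ℕ) * s ^ (2 : ℕ) + x ^ (12 : ℕ) * s ^ (6 : ℕ) +
      x ^ (12 : ℕ) * t ^ (2 : ℕ) +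
        x ^ (12 : ℕ) * t ^ (6 : ℕ) + (-3 : ℂ) * x ^ (13 : ℕ) + (-2 : ℂ) * x ^ (14 : ℕ) * s ^ (2 : ℕ) + (4 : ℂ) * x ^ (14 : ℕ) * s ^ (6 : ℕ) +
        (-2 : ℂ) * x ^ (14 : ℕ) * t ^ (2 : ℕ) + (4 : ℂ) * x ^ (14 : ℕ) * t ^ (6 : ℕ) + (-3 : ℂ) * x ^ (15 : ℕ) +
            (2 : ℂ) * x ^ (15 : ℕ) * s ^ (4 : ℕ) +
        (2 : ℂ) * x ^ (15 : ℕ) * t ^ (4 : ℕ) + -(x ^ (16 : ℕ) * s ^ (2 : ℕ)) + (3 : ℂ) * x ^ (16 : ℕ) * s ^ (6 : ℕ) + -(x ^ (16 : ℕ) * t ^ (2 : ℕ)) +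
        (3 : ℂ) * x ^ (16 : ℕ) * t ^ (6 : ℕ) + (-2 : ℂ) * x ^ (17 : ℕ) + x ^ (17 : ℕ) * s ^ (4 : ℕ) + x ^ (17 : ℕ) * s ^ (8 : ℕ) +
            x ^ (17 : ℕ) * t ^ (4 : ℕ) +
        x ^ (17 : ℕ) * t ^ (8 : ℕ) + x ^ (19 : ℕ) * s ^ (8 : ℕ) + x ^ (19 : ℕ) * t ^ (8 : ℕ)) * h1 + (x ^ (13 : ℕ) + -(x ^ (14 : ℕ) * s ^ (6 : ℕ)) +
            -(x ^ (14 : ℕ) * t ^ (6 : ℕ)) + x ^ (15 : ℕ) + -(x ^ (15 : ℕ) * s ^ (4 : ℕ)) +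
        -(x ^ (15 : ℕ) * t ^ (4 : ℕ))) * h2 + (-(x ^ (11 : ℕ) * t ^ (4 : ℕ)) + -(x ^ (12 : ℕ) * t ^ (2 : ℕ)) + -(x ^ (12 : ℕ) * t ^ (6 : ℕ)) +
            x ^ (13 : ℕ) + -(x ^ (13 : ℕ) * s ^ (4 : ℕ)) +
        x ^ (13 : ℕ) * t ^ (4 : ℕ) + -(x ^ (14 : ℕ) * s ^ (6 : ℕ)) + (2 : ℂ) * x ^ (14 : ℕ) * t ^ (2 : ℕ) + (-2 : ℂ) * x ^ (14 : ℕ) * t ^ (6 : ℕ) +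
        x ^ (15 : ℕ) + -(x ^ (15 : ℕ) * s ^ (4 : ℕ)) + -(x ^ (16 : ℕ) * s ^ (6 : ℕ)) + x ^ (16 : ℕ) * t ^ (2 : ℕ) +
            -(x ^ (16 : ℕ) * t ^ (6 : ℕ))) * h3 + (-(x ^ (11 : ℕ) * s ^ (4 : ℕ)) + -(x ^ (12 : ℕ) * s ^ (2 : ℕ)) + -(x ^ (12 : ℕ) * s ^ (6 : ℕ)) +
            x ^ (13 : ℕ) + x ^ (13 : ℕ) * s ^ (4 : ℕ) +
        -(x ^ (13 : ℕ) * t ^ (4 : ℕ)) + (2 : ℂ) * x ^ (14 : ℕ) * s ^ (2 : ℕ) + (-2 : ℂ) * x ^ (14 : ℕ) * s ^ (6 : ℕ) + -(x ^ (14 : ℕ) * t ^ (6 : ℕ)) +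
        x ^ (15 : ℕ) + -(x ^ (15 : ℕ) * t ^ (4 : ℕ)) + x ^ (16 : ℕ) * s ^ (2 : ℕ) + -(x ^ (16 : ℕ) * s ^ (6 : ℕ)) +
            -(x ^ (16 : ℕ) * t ^ (6 : ℕ))) * h4 + ((x ^ (19 : ℕ) * s ^ (4 : ℕ) + x ^ (19 : ℕ) * t * s ^ (5 : ℕ) + x ^ (19 : ℕ) * t ^ (4 : ℕ) +
            x ^ (19 : ℕ) * t ^ (5 : ℕ) * s +
        x ^ (20 : ℕ) * s ^ (2 : ℕ) + x ^ (20 : ℕ) * t * s ^ (3 : ℕ) + x ^ (20 : ℕ) * t ^ (2 : ℕ) + x ^ (20 : ℕ) * t ^ (3 : ℕ) * s) * U0 +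
            (x ^ (17 : ℕ) * t +
        x ^ (17 : ℕ) * t ^ (2 : ℕ) * s + x ^ (17 : ℕ) * t ^ (3 : ℕ) * s ^ (2 : ℕ) + x ^ (18 : ℕ) * s + x ^ (18 : ℕ) * t * s ^ (2 : ℕ) +
        x ^ (18 : ℕ) * t ^ (3 : ℕ) + x ^ (18 : ℕ) * t ^ (4 : ℕ) * s + x ^ (18 : ℕ) * t ^ (5 : ℕ) * s ^ (2 : ℕ) + x ^ (19 : ℕ) * s ^ (3 : ℕ) +
        -(x ^ (19 : ℕ) * s ^ (7 : ℕ)) + -(x ^ (19 : ℕ) * t) + x ^ (19 : ℕ) * t * s ^ (4 : ℕ) + -(x ^ (19 : ℕ) * t ^ (2 : ℕ) * s) +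
        x ^ (19 : ℕ) * t ^ (2 : ℕ) * s ^ (5 : ℕ) + -(x ^ (19 : ℕ) * t ^ (3 : ℕ) * s ^ (2 : ℕ)) + -(x ^ (20 : ℕ) * s) +
            -(x ^ (20 : ℕ) * t * s ^ (2 : ℕ)) +
        x ^ (20 : ℕ) * t ^ (2 : ℕ) * s ^ (3 : ℕ) + (2 : ℂ) * x ^ (20 : ℕ) * t ^ (3 : ℕ) + (2 : ℂ) * x ^ (20 : ℕ) * t ^ (4 : ℕ) * s +
        (2 : ℂ) * x ^ (20 : ℕ) * t ^ (5 : ℕ) * s ^ (2 : ℕ) + -(x ^ (20 : ℕ) * t ^ (7 : ℕ)) + x ^ (21 : ℕ) * s ^ (3 : ℕ) +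
            -(x ^ (21 : ℕ) * s ^ (7 : ℕ)) +
        x ^ (21 : ℕ) * t * s ^ (4 : ℕ) + x ^ (21 : ℕ) * t ^ (2 : ℕ) * s ^ (5 : ℕ) + x ^ (22 : ℕ) * t ^ (2 : ℕ) * s ^ (3 : ℕ) +
            x ^ (22 : ℕ) * t ^ (3 : ℕ) +
        x ^ (22 : ℕ) * t ^ (4 : ℕ) * s + x ^ (22 : ℕ) * t ^ (5 : ℕ) * s ^ (2 : ℕ) + -(x ^ (22 : ℕ) * t ^ (7 : ℕ))) * U1 +
            (x ^ (19 : ℕ) * s ^ (2 : ℕ) +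
        x ^ (19 : ℕ) * t * s ^ (3 : ℕ) + x ^ (19 : ℕ) * t ^ (2 : ℕ) + x ^ (19 : ℕ) * t ^ (3 : ℕ) * s + x ^ (20 : ℕ) * s ^ (4 : ℕ) +
        x ^ (20 : ℕ) * t * s ^ (5 : ℕ) + x ^ (20 : ℕ) * t ^ (4 : ℕ) + x ^ (20 : ℕ) * t ^ (5 : ℕ) * s + x ^ (21 : ℕ) * s ^ (2 : ℕ) +
        x ^ (21 : ℕ) * t * s ^ (3 : ℕ) + x ^ (21 : ℕ) * t ^ (2 : ℕ) + x ^ (21 : ℕ) * t ^ (3 : ℕ) * s + x ^ (22 : ℕ) * s ^ (4 : ℕ) +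
        x ^ (22 : ℕ) * t * s ^ (5 : ℕ) + x ^ (22 : ℕ) * t ^ (4 : ℕ) + x ^ (22 : ℕ) * t ^ (5 : ℕ) * s) * U2 + (x ^ (17 : ℕ) * s +
        x ^ (17 : ℕ) * t * s ^ (2 : ℕ) + x ^ (17 : ℕ) * t ^ (2 : ℕ) * s ^ (3 : ℕ) + x ^ (18 : ℕ) * s ^ (3 : ℕ) + x ^ (18 : ℕ) * t +
        x ^ (18 : ℕ) * t * s ^ (4 : ℕ) + x ^ (18 : ℕ) * t ^ (2 : ℕ) * s + x ^ (18 : ℕ) * t ^ (2 : ℕ) * s ^ (5 : ℕ) + -(x ^ (19 : ℕ) * s) +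
        -(x ^ (19 : ℕ) * t * s ^ (2 : ℕ)) + -(x ^ (19 : ℕ) * t ^ (2 : ℕ) * s ^ (3 : ℕ)) + x ^ (19 : ℕ) * t ^ (3 : ℕ) +
            x ^ (19 : ℕ) * t ^ (4 : ℕ) * s +
        x ^ (19 : ℕ) * t ^ (5 : ℕ) * s ^ (2 : ℕ) + -(x ^ (19 : ℕ) * t ^ (7 : ℕ)) + (2 : ℂ) * x ^ (20 : ℕ) * s ^ (3 : ℕ) +
            -(x ^ (20 : ℕ) * s ^ (7 : ℕ)) +
        -(x ^ (20 : ℕ) * t) + (2 : ℂ) * x ^ (20 : ℕ) * t * s ^ (4 : ℕ) + -(x ^ (20 : ℕ) * t ^ (2 : ℕ) * s) +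
        (2 : ℂ) * x ^ (20 : ℕ) * t ^ (2 : ℕ) * s ^ (5 : ℕ) + x ^ (20 : ℕ) * t ^ (3 : ℕ) * s ^ (2 : ℕ) + x ^ (21 : ℕ) * t ^ (3 : ℕ) +
        x ^ (21 : ℕ) * t ^ (4 : ℕ) * s + x ^ (21 : ℕ) * t ^ (5 : ℕ) * s ^ (2 : ℕ) + -(x ^ (21 : ℕ) * t ^ (7 : ℕ)) + x ^ (22 : ℕ) * s ^ (3 : ℕ) +
        -(x ^ (22 : ℕ) * s ^ (7 : ℕ)) + x ^ (22 : ℕ) * t * s ^ (4 : ℕ) + x ^ (22 : ℕ) * t ^ (2 : ℕ) * s ^ (5 : ℕ) +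
        x ^ (22 : ℕ) * t ^ (3 : ℕ) * s ^ (2 : ℕ)) * U3) * hs
  · linear_combination (-(x ^ (12 : ℕ) * s ^ (3 : ℕ)) + -(x ^ (12 : ℕ) * t ^ (5 : ℕ)) + (2 : ℂ) * x ^ (13 : ℕ) * t ^ (3 : ℕ) +
      x ^ (14 : ℕ) * s ^ (3 : ℕ) +
        -(x ^ (14 : ℕ) * t) + (-3 : ℂ) * x ^ (14 : ℕ) * t ^ (5 : ℕ) + x ^ (15 : ℕ) * s + -(x ^ (15 : ℕ) * s ^ (5 : ℕ)) +
            -(x ^ (17 : ℕ) * t ^ (3 : ℕ)) +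
        -(x ^ (17 : ℕ) * t ^ (7 : ℕ))) * h1 + (x ^ (14 : ℕ) * t ^ (5 : ℕ)) * h2 + (x ^ (12 : ℕ) * s ^ (3 : ℕ) + x ^ (12 : ℕ) * t +
            x ^ (12 : ℕ) * t ^ (5 : ℕ) + (-2 : ℂ) * x ^ (13 : ℕ) * t ^ (3 : ℕ) + -(x ^ (14 : ℕ) * s ^ (3 : ℕ)) +
        x ^ (14 : ℕ) * t ^ (5 : ℕ) + x ^ (15 : ℕ) * s ^ (5 : ℕ)) * h3 + (-(x ^ (12 : ℕ) * t) + x ^ (14 : ℕ) * t + x ^ (14 : ℕ) * t ^ (5 : ℕ) +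
            -(x ^ (15 : ℕ) * s)) * h4 + ((-(x ^ (19 : ℕ) * t ^ (3 : ℕ)) + -(x ^ (19 : ℕ) * t ^ (4 : ℕ) * s)) * U0 + (-(x ^ (18 : ℕ) * s ^ (2 : ℕ)) +
            -(x ^ (18 : ℕ) * t ^ (2 : ℕ)) +
        -(x ^ (18 : ℕ) * t ^ (3 : ℕ) * s) + -(x ^ (18 : ℕ) * t ^ (4 : ℕ) * s ^ (2 : ℕ)) + (2 : ℂ) * x ^ (19 : ℕ) + (2 : ℂ) * x ^ (19 : ℕ) * t * s +
        (2 : ℂ) * x ^ (19 : ℕ) * t ^ (2 : ℕ) * s ^ (2 : ℕ) + -(x ^ (19 : ℕ) * t ^ (4 : ℕ)) + -(x ^ (20 : ℕ) * t ^ (3 : ℕ) * s) +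
        -(x ^ (20 : ℕ) * t ^ (4 : ℕ) * s ^ (2 : ℕ)) + x ^ (20 : ℕ) * t ^ (6 : ℕ)) * U1 + (-(x ^ (18 : ℕ) * t * s ^ (2 : ℕ)) +
            x ^ (20 : ℕ) * t * s ^ (2 : ℕ) +
        -(x ^ (20 : ℕ) * t ^ (3 : ℕ)) + -(x ^ (20 : ℕ) * t ^ (4 : ℕ) * s) + -(x ^ (21 : ℕ) * s ^ (3 : ℕ)) + -(x ^ (21 : ℕ) * t * s ^ (4 : ℕ))) * U2 +
        (-(x ^ (18 : ℕ) * t ^ (4 : ℕ)) + -(x ^ (19 : ℕ) * t ^ (3 : ℕ) * s) + -(x ^ (19 : ℕ) * t ^ (4 : ℕ) * s ^ (2 : ℕ)) +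
            x ^ (19 : ℕ) * t ^ (6 : ℕ) +
        -(x ^ (21 : ℕ) * t ^ (3 : ℕ) * s) + -(x ^ (21 : ℕ) * t ^ (4 : ℕ) * s ^ (2 : ℕ))) * U3) * hs
  · linear_combination (-(x ^ (12 : ℕ) * s ^ (4 : ℕ)) + -(x ^ (12 : ℕ) * t ^ (4 : ℕ)) + (3 : ℂ) * x ^ (14 : ℕ) + x ^ (14 : ℕ) * s ^ (4 : ℕ) +
      x ^ (14 : ℕ) * t ^ (4 : ℕ) +
        -(x ^ (15 : ℕ) * s ^ (6 : ℕ)) + -(x ^ (15 : ℕ) * t ^ (6 : ℕ)) + x ^ (17 : ℕ) * s ^ (2 : ℕ) + x ^ (17 : ℕ) * t ^ (2 : ℕ)) * h1 +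
            (-(x ^ (14 : ℕ))) * h2 + (x ^ (12 : ℕ) * t ^ (4 : ℕ) + -(x ^ (14 : ℕ)) + -(x ^ (14 : ℕ) * t ^ (4 : ℕ)) + x ^ (15 : ℕ) * t ^ (6 : ℕ)) * h3 +
            (x ^ (12 : ℕ) * s ^ (4 : ℕ) + -(x ^ (14 : ℕ)) + -(x ^ (14 : ℕ) * s ^ (4 : ℕ)) + x ^ (15 : ℕ) * s ^ (6 : ℕ)) * h4 + ((-(x ^ (18 : ℕ) * t) +
            -(x ^ (18 : ℕ) * t ^ (2 : ℕ) * s) + -(x ^ (18 : ℕ) * t ^ (3 : ℕ) * s ^ (2 : ℕ)) + -(x ^ (19 : ℕ) * s) +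
        x ^ (20 : ℕ) * t ^ (2 : ℕ) * s + x ^ (20 : ℕ) * t ^ (3 : ℕ) * s ^ (2 : ℕ) + -(x ^ (21 : ℕ) * t ^ (3 : ℕ)) +
            -(x ^ (21 : ℕ) * t ^ (4 : ℕ) * s) +
        -(x ^ (21 : ℕ) * t ^ (5 : ℕ) * s ^ (2 : ℕ))) * U1 + (-(x ^ (18 : ℕ) * s) + -(x ^ (18 : ℕ) * t * s ^ (2 : ℕ)) +
        -(x ^ (18 : ℕ) * t ^ (2 : ℕ) * s ^ (3 : ℕ)) + -(x ^ (19 : ℕ) * t) + x ^ (20 : ℕ) * t * s ^ (2 : ℕ) +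
            x ^ (20 : ℕ) * t ^ (2 : ℕ) * s ^ (3 : ℕ) +
        -(x ^ (21 : ℕ) * s ^ (3 : ℕ)) + -(x ^ (21 : ℕ) * t * s ^ (4 : ℕ)) + -(x ^ (21 : ℕ) * t ^ (2 : ℕ) * s ^ (5 : ℕ))) * U3) * hs
  · linear_combination (-(x ^ (12 : ℕ) * s ^ (5 : ℕ)) + -(x ^ (12 : ℕ) * t ^ (3 : ℕ)) + (2 : ℂ) * x ^ (13 : ℕ) * s ^ (3 : ℕ) + -(x ^ (14 : ℕ) * s) +
        (-3 : ℂ) * x ^ (14 : ℕ) * s ^ (5 : ℕ) + x ^ (14 : ℕ) * t ^ (3 : ℕ) + x ^ (15 : ℕ) * t + -(x ^ (15 : ℕ) * t ^ (5 : ℕ)) +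
            -(x ^ (17 : ℕ) * s ^ (3 : ℕ)) +
        -(x ^ (17 : ℕ) * s ^ (7 : ℕ))) * h1 + (x ^ (14 : ℕ) * s ^ (5 : ℕ)) * h2 + (-(x ^ (12 : ℕ) * s) + x ^ (14 : ℕ) * s + x ^ (14 : ℕ) * s ^ (5 : ℕ) +
            -(x ^ (15 : ℕ) * t)) * h3 + (x ^ (12 : ℕ) * s + x ^ (12 : ℕ) * s ^ (5 : ℕ) + x ^ (12 : ℕ) * t ^ (3 : ℕ) +
            (-2 : ℂ) * x ^ (13 : ℕ) * s ^ (3 : ℕ) + x ^ (14 : ℕ) * s ^ (5 : ℕ) +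
        -(x ^ (14 : ℕ) * t ^ (3 : ℕ)) + x ^ (15 : ℕ) * t ^ (5 : ℕ)) * h4 + ((-(x ^ (19 : ℕ) * s ^ (3 : ℕ)) + -(x ^ (19 : ℕ) * t * s ^ (4 : ℕ))) * U0 +
            (-(x ^ (18 : ℕ) * s ^ (4 : ℕ)) + x ^ (19 : ℕ) * s ^ (6 : ℕ) +
        -(x ^ (19 : ℕ) * t * s ^ (3 : ℕ)) + -(x ^ (19 : ℕ) * t ^ (2 : ℕ) * s ^ (4 : ℕ)) + -(x ^ (21 : ℕ) * t * s ^ (3 : ℕ)) +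
        -(x ^ (21 : ℕ) * t ^ (2 : ℕ) * s ^ (4 : ℕ))) * U1 + (-(x ^ (18 : ℕ) * t ^ (2 : ℕ) * s) + -(x ^ (20 : ℕ) * s ^ (3 : ℕ)) +
        -(x ^ (20 : ℕ) * t * s ^ (4 : ℕ)) + x ^ (20 : ℕ) * t ^ (2 : ℕ) * s + -(x ^ (21 : ℕ) * t ^ (3 : ℕ)) + -(x ^ (21 : ℕ) * t ^ (4 : ℕ) * s)) * U2 +
        (-(x ^ (18 : ℕ) * s ^ (2 : ℕ)) + -(x ^ (18 : ℕ) * t * s ^ (3 : ℕ)) + -(x ^ (18 : ℕ) * t ^ (2 : ℕ)) +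
            -(x ^ (18 : ℕ) * t ^ (2 : ℕ) * s ^ (4 : ℕ)) +
        (2 : ℂ) * x ^ (19 : ℕ) + -(x ^ (19 : ℕ) * s ^ (4 : ℕ)) + (2 : ℂ) * x ^ (19 : ℕ) * t * s + (2 : ℂ) * x ^ (19 : ℕ) * t ^ (2 : ℕ) * s ^ (2 : ℕ) +
        x ^ (20 : ℕ) * s ^ (6 : ℕ) + -(x ^ (20 : ℕ) * t * s ^ (3 : ℕ)) + -(x ^ (20 : ℕ) * t ^ (2 : ℕ) * s ^ (4 : ℕ))) * U3) * hs

/-- Nullstellensatz certificate of the symmetric sector: the minors generate `x^19 t^1` (exact). [folklore] -/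
private theorem cert_sym {x t s U : ℂ} (hs : t * s = 1)
    (h1 : (-(x ^ (15 : ℕ) * t) + -(x ^ (15 : ℕ) * t ^ (5 : ℕ)) + x ^ (16 : ℕ) * s + x ^ (16 : ℕ) * t ^ (7 : ℕ)) * U = 0)
    (h2 : (x ^ (19 : ℕ) * s ^ (4 : ℕ) + -(x ^ (20 : ℕ) * t ^ (2 : ℕ)) + x ^ (20 : ℕ) * t ^ (6 : ℕ) + -(x ^ (20 : ℕ) * t ^ (10 : ℕ))) * U = 0)
    (h3 : (x ^ (18 : ℕ) * s ^ (2 : ℕ) + x ^ (18 : ℕ) * s ^ (6 : ℕ) + x ^ (18 : ℕ) * t ^ (2 : ℕ) + x ^ (18 : ℕ) * t ^ (6 : ℕ) +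
        (-2 : ℂ) * x ^ (19 : ℕ) +
      -(x ^ (20 : ℕ) * s ^ (6 : ℕ)) + -(x ^ (20 : ℕ) * t ^ (6 : ℕ)) + x ^ (21 : ℕ) * s ^ (8 : ℕ) + x ^ (21 : ℕ) * t ^ (8 : ℕ)) * U = 0) :
    (x ^ (19 : ℕ) * t) * U = 0 := by
  linear_combination (((-11 : ℂ) / 2) * x ^ (4 : ℕ) + ((-11 : ℂ) / 2) * x ^ (4 : ℕ) * t ^ (4 : ℕ) + ((31 : ℂ) / 2) * x ^ (4 : ℕ) * t ^ (8 : ℕ) +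
        ((-37 : ℂ) / 2) * x ^ (4 : ℕ) * t ^ (12 : ℕ) + (6 : ℂ) * x ^ (4 : ℕ) * t ^ (16 : ℕ) + ((-7 : ℂ) / 2) * x ^ (4 : ℕ) * t ^ (20 : ℕ) +
        ((-7 : ℂ) / 2) * x ^ (4 : ℕ) * t ^ (24 : ℕ) + (16 : ℂ) * x ^ (5 : ℕ) * t ^ (2 : ℕ) + (-11 : ℂ) * x ^ (5 : ℕ) * t ^ (6 : ℕ) +
        (5 : ℂ) * x ^ (5 : ℕ) * t ^ (10 : ℕ) + ((7 : ℂ) / 2) * x ^ (5 : ℕ) * t ^ (18 : ℕ) + ((-19 : ℂ) / 2) * x ^ (6 : ℕ) +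
        ((23 : ℂ) / 2) * x ^ (6 : ℕ) * t ^ (4 : ℕ) + (-16 : ℂ) * x ^ (6 : ℕ) * t ^ (8 : ℕ) + (15 : ℂ) * x ^ (6 : ℕ) * t ^ (12 : ℕ) +
        (-13 : ℂ) * x ^ (6 : ℕ) * t ^ (16 : ℕ) + ((7 : ℂ) / 2) * x ^ (6 : ℕ) * t ^ (20 : ℕ) + ((7 : ℂ) / 2) * x ^ (6 : ℕ) * t ^ (24 : ℕ)) * h1 +
            ((-14 : ℂ) * t ^ (5 : ℕ) + (-9 : ℂ) * t ^ (9 : ℕ) + ((5 : ℂ) / 2) * t ^ (13 : ℕ) + (-7 : ℂ) * t ^ (17 : ℕ) +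
            ((-7 : ℂ) / 2) * t ^ (21 : ℕ) +
        ((11 : ℂ) / 2) * x * t ^ (3 : ℕ) + ((43 : ℂ) / 2) * x * t ^ (7 : ℕ) + (-16 : ℂ) * x ^ (2 : ℕ) * t ^ (5 : ℕ) +
            (7 : ℂ) * x ^ (2 : ℕ) * t ^ (9 : ℕ)) * h2 + (((19 : ℂ) / 2) * x * t ^ (7 : ℕ) + ((-23 : ℂ) / 2) * x * t ^ (11 : ℕ) +
            ((19 : ℂ) / 2) * x * t ^ (15 : ℕ) + ((-7 : ℂ) / 2) * x * t ^ (19 : ℕ) +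
        ((-7 : ℂ) / 2) * x * t ^ (23 : ℕ)) * h3 + ((((9 : ℂ) / 2) * x ^ (19 : ℕ) * t + ((9 : ℂ) / 2) * x ^ (19 : ℕ) * t ^ (2 : ℕ) * s +
            ((9 : ℂ) / 2) * x ^ (19 : ℕ) * t ^ (3 : ℕ) * s ^ (2 : ℕ) +
        ((9 : ℂ) / 2) * x ^ (19 : ℕ) * t ^ (4 : ℕ) * s ^ (3 : ℕ) + (11 : ℂ) * x ^ (19 : ℕ) * t ^ (5 : ℕ) +
        ((-19 : ℂ) / 2) * x ^ (19 : ℕ) * t ^ (5 : ℕ) * s ^ (4 : ℕ) + (11 : ℂ) * x ^ (19 : ℕ) * t ^ (6 : ℕ) * s +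
        ((-19 : ℂ) / 2) * x ^ (19 : ℕ) * t ^ (6 : ℕ) * s ^ (5 : ℕ) + ((41 : ℂ) / 2) * x ^ (19 : ℕ) * t ^ (7 : ℕ) * s ^ (2 : ℕ) +
        ((41 : ℂ) / 2) * x ^ (19 : ℕ) * t ^ (8 : ℕ) * s ^ (3 : ℕ) + ((-1 : ℂ) / 2) * x ^ (19 : ℕ) * t ^ (9 : ℕ) +
        ((23 : ℂ) / 2) * x ^ (19 : ℕ) * t ^ (9 : ℕ) * s ^ (4 : ℕ) + ((-1 : ℂ) / 2) * x ^ (19 : ℕ) * t ^ (10 : ℕ) * s +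
        ((23 : ℂ) / 2) * x ^ (19 : ℕ) * t ^ (10 : ℕ) * s ^ (5 : ℕ) + (-12 : ℂ) * x ^ (19 : ℕ) * t ^ (11 : ℕ) * s ^ (2 : ℕ) +
        (-12 : ℂ) * x ^ (19 : ℕ) * t ^ (12 : ℕ) * s ^ (3 : ℕ) + x ^ (19 : ℕ) * t ^ (13 : ℕ) +
            ((-19 : ℂ) / 2) * x ^ (19 : ℕ) * t ^ (13 : ℕ) * s ^ (4 : ℕ) +
        x ^ (19 : ℕ) * t ^ (14 : ℕ) * s + ((-19 : ℂ) / 2) * x ^ (19 : ℕ) * t ^ (14 : ℕ) * s ^ (5 : ℕ) +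
        ((21 : ℂ) / 2) * x ^ (19 : ℕ) * t ^ (15 : ℕ) * s ^ (2 : ℕ) + ((21 : ℂ) / 2) * x ^ (19 : ℕ) * t ^ (16 : ℕ) * s ^ (3 : ℕ) +
        ((21 : ℂ) / 2) * x ^ (19 : ℕ) * t ^ (17 : ℕ) + ((7 : ℂ) / 2) * x ^ (19 : ℕ) * t ^ (17 : ℕ) * s ^ (4 : ℕ) +
        ((21 : ℂ) / 2) * x ^ (19 : ℕ) * t ^ (18 : ℕ) * s + ((7 : ℂ) / 2) * x ^ (19 : ℕ) * t ^ (18 : ℕ) * s ^ (5 : ℕ) +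
        (7 : ℂ) * x ^ (19 : ℕ) * t ^ (19 : ℕ) * s ^ (2 : ℕ) + (7 : ℂ) * x ^ (19 : ℕ) * t ^ (20 : ℕ) * s ^ (3 : ℕ) +
        ((7 : ℂ) / 2) * x ^ (19 : ℕ) * t ^ (21 : ℕ) + ((7 : ℂ) / 2) * x ^ (19 : ℕ) * t ^ (21 : ℕ) * s ^ (4 : ℕ) +
        ((7 : ℂ) / 2) * x ^ (19 : ℕ) * t ^ (22 : ℕ) * s + ((7 : ℂ) / 2) * x ^ (19 : ℕ) * t ^ (22 : ℕ) * s ^ (5 : ℕ) +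
            ((-11 : ℂ) / 2) * x ^ (20 : ℕ) * s +
        ((-11 : ℂ) / 2) * x ^ (20 : ℕ) * t * s ^ (2 : ℕ) + ((-11 : ℂ) / 2) * x ^ (20 : ℕ) * t ^ (2 : ℕ) * s ^ (3 : ℕ) +
            (-16 : ℂ) * x ^ (20 : ℕ) * t ^ (3 : ℕ) +
        ((-43 : ℂ) / 2) * x ^ (20 : ℕ) * t ^ (4 : ℕ) * s + ((-43 : ℂ) / 2) * x ^ (20 : ℕ) * t ^ (5 : ℕ) * s ^ (2 : ℕ) +
        ((-43 : ℂ) / 2) * x ^ (20 : ℕ) * t ^ (6 : ℕ) * s ^ (3 : ℕ) + ((-31 : ℂ) / 2) * x ^ (20 : ℕ) * t ^ (7 : ℕ) +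
        ((37 : ℂ) / 2) * x ^ (20 : ℕ) * t ^ (11 : ℕ) + (-6 : ℂ) * x ^ (20 : ℕ) * t ^ (15 : ℕ) + ((7 : ℂ) / 2) * x ^ (20 : ℕ) * t ^ (19 : ℕ) +
        ((7 : ℂ) / 2) * x ^ (20 : ℕ) * t ^ (23 : ℕ) + ((19 : ℂ) / 2) * x ^ (21 : ℕ) * t + ((51 : ℂ) / 2) * x ^ (21 : ℕ) * t ^ (2 : ℕ) * s +
        ((51 : ℂ) / 2) * x ^ (21 : ℕ) * t ^ (3 : ℕ) * s ^ (2 : ℕ) + ((51 : ℂ) / 2) * x ^ (21 : ℕ) * t ^ (4 : ℕ) * s ^ (3 : ℕ) +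
        ((-15 : ℂ) / 2) * x ^ (21 : ℕ) * t ^ (5 : ℕ) + ((19 : ℂ) / 2) * x ^ (21 : ℕ) * t ^ (5 : ℕ) * s ^ (4 : ℕ) +
        ((-37 : ℂ) / 2) * x ^ (21 : ℕ) * t ^ (6 : ℕ) * s + ((19 : ℂ) / 2) * x ^ (21 : ℕ) * t ^ (6 : ℕ) * s ^ (5 : ℕ) +
        ((-37 : ℂ) / 2) * x ^ (21 : ℕ) * t ^ (7 : ℕ) * s ^ (2 : ℕ) + ((-37 : ℂ) / 2) * x ^ (21 : ℕ) * t ^ (8 : ℕ) * s ^ (3 : ℕ) +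
        ((9 : ℂ) / 2) * x ^ (21 : ℕ) * t ^ (9 : ℕ) + ((-23 : ℂ) / 2) * x ^ (21 : ℕ) * t ^ (9 : ℕ) * s ^ (4 : ℕ) +
        ((19 : ℂ) / 2) * x ^ (21 : ℕ) * t ^ (10 : ℕ) * s + ((-23 : ℂ) / 2) * x ^ (21 : ℕ) * t ^ (10 : ℕ) * s ^ (5 : ℕ) +
        ((19 : ℂ) / 2) * x ^ (21 : ℕ) * t ^ (11 : ℕ) * s ^ (2 : ℕ) + ((19 : ℂ) / 2) * x ^ (21 : ℕ) * t ^ (12 : ℕ) * s ^ (3 : ℕ) +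
        ((-7 : ℂ) / 2) * x ^ (21 : ℕ) * t ^ (13 : ℕ) + ((19 : ℂ) / 2) * x ^ (21 : ℕ) * t ^ (13 : ℕ) * s ^ (4 : ℕ) +
        ((-7 : ℂ) / 2) * x ^ (21 : ℕ) * t ^ (14 : ℕ) * s + ((19 : ℂ) / 2) * x ^ (21 : ℕ) * t ^ (14 : ℕ) * s ^ (5 : ℕ) +
        ((-7 : ℂ) / 2) * x ^ (21 : ℕ) * t ^ (15 : ℕ) * s ^ (2 : ℕ) + ((-7 : ℂ) / 2) * x ^ (21 : ℕ) * t ^ (16 : ℕ) * s ^ (3 : ℕ) +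
        (-7 : ℂ) * x ^ (21 : ℕ) * t ^ (17 : ℕ) + ((-7 : ℂ) / 2) * x ^ (21 : ℕ) * t ^ (17 : ℕ) * s ^ (4 : ℕ) +
            ((-7 : ℂ) / 2) * x ^ (21 : ℕ) * t ^ (18 : ℕ) * s +
        ((-7 : ℂ) / 2) * x ^ (21 : ℕ) * t ^ (18 : ℕ) * s ^ (5 : ℕ) + ((-7 : ℂ) / 2) * x ^ (21 : ℕ) * t ^ (19 : ℕ) * s ^ (2 : ℕ) +
        ((-7 : ℂ) / 2) * x ^ (21 : ℕ) * t ^ (20 : ℕ) * s ^ (3 : ℕ) + ((-7 : ℂ) / 2) * x ^ (21 : ℕ) * t ^ (21 : ℕ) * s ^ (4 : ℕ) +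
        ((-7 : ℂ) / 2) * x ^ (21 : ℕ) * t ^ (22 : ℕ) * s ^ (5 : ℕ) + ((-19 : ℂ) / 2) * x ^ (22 : ℕ) * s +
            ((-19 : ℂ) / 2) * x ^ (22 : ℕ) * t * s ^ (2 : ℕ) +
        ((-19 : ℂ) / 2) * x ^ (22 : ℕ) * t ^ (2 : ℕ) * s ^ (3 : ℕ) + ((-19 : ℂ) / 2) * x ^ (22 : ℕ) * t ^ (3 : ℕ) * s ^ (4 : ℕ) +
        ((23 : ℂ) / 2) * x ^ (22 : ℕ) * t ^ (4 : ℕ) * s + ((-19 : ℂ) / 2) * x ^ (22 : ℕ) * t ^ (4 : ℕ) * s ^ (5 : ℕ) +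
        ((23 : ℂ) / 2) * x ^ (22 : ℕ) * t ^ (5 : ℕ) * s ^ (2 : ℕ) + ((-19 : ℂ) / 2) * x ^ (22 : ℕ) * t ^ (5 : ℕ) * s ^ (6 : ℕ) +
        ((23 : ℂ) / 2) * x ^ (22 : ℕ) * t ^ (6 : ℕ) * s ^ (3 : ℕ) + ((-19 : ℂ) / 2) * x ^ (22 : ℕ) * t ^ (6 : ℕ) * s ^ (7 : ℕ) +
        ((13 : ℂ) / 2) * x ^ (22 : ℕ) * t ^ (7 : ℕ) + ((23 : ℂ) / 2) * x ^ (22 : ℕ) * t ^ (7 : ℕ) * s ^ (4 : ℕ) +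
        ((-19 : ℂ) / 2) * x ^ (22 : ℕ) * t ^ (8 : ℕ) * s + ((23 : ℂ) / 2) * x ^ (22 : ℕ) * t ^ (8 : ℕ) * s ^ (5 : ℕ) +
        ((-19 : ℂ) / 2) * x ^ (22 : ℕ) * t ^ (9 : ℕ) * s ^ (2 : ℕ) + ((23 : ℂ) / 2) * x ^ (22 : ℕ) * t ^ (9 : ℕ) * s ^ (6 : ℕ) +
        ((-19 : ℂ) / 2) * x ^ (22 : ℕ) * t ^ (10 : ℕ) * s ^ (3 : ℕ) + ((23 : ℂ) / 2) * x ^ (22 : ℕ) * t ^ (10 : ℕ) * s ^ (7 : ℕ) +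
        ((-23 : ℂ) / 2) * x ^ (22 : ℕ) * t ^ (11 : ℕ) + ((-19 : ℂ) / 2) * x ^ (22 : ℕ) * t ^ (11 : ℕ) * s ^ (4 : ℕ) +
        ((7 : ℂ) / 2) * x ^ (22 : ℕ) * t ^ (12 : ℕ) * s + ((-19 : ℂ) / 2) * x ^ (22 : ℕ) * t ^ (12 : ℕ) * s ^ (5 : ℕ) +
        ((7 : ℂ) / 2) * x ^ (22 : ℕ) * t ^ (13 : ℕ) * s ^ (2 : ℕ) + ((-19 : ℂ) / 2) * x ^ (22 : ℕ) * t ^ (13 : ℕ) * s ^ (6 : ℕ) +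
        ((7 : ℂ) / 2) * x ^ (22 : ℕ) * t ^ (14 : ℕ) * s ^ (3 : ℕ) + ((-19 : ℂ) / 2) * x ^ (22 : ℕ) * t ^ (14 : ℕ) * s ^ (7 : ℕ) +
        ((33 : ℂ) / 2) * x ^ (22 : ℕ) * t ^ (15 : ℕ) + ((7 : ℂ) / 2) * x ^ (22 : ℕ) * t ^ (15 : ℕ) * s ^ (4 : ℕ) +
        ((7 : ℂ) / 2) * x ^ (22 : ℕ) * t ^ (16 : ℕ) * s + ((7 : ℂ) / 2) * x ^ (22 : ℕ) * t ^ (16 : ℕ) * s ^ (5 : ℕ) +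
        ((7 : ℂ) / 2) * x ^ (22 : ℕ) * t ^ (17 : ℕ) * s ^ (2 : ℕ) + ((7 : ℂ) / 2) * x ^ (22 : ℕ) * t ^ (17 : ℕ) * s ^ (6 : ℕ) +
        ((7 : ℂ) / 2) * x ^ (22 : ℕ) * t ^ (18 : ℕ) * s ^ (3 : ℕ) + ((7 : ℂ) / 2) * x ^ (22 : ℕ) * t ^ (18 : ℕ) * s ^ (7 : ℕ) +
        ((-7 : ℂ) / 2) * x ^ (22 : ℕ) * t ^ (19 : ℕ) + ((7 : ℂ) / 2) * x ^ (22 : ℕ) * t ^ (19 : ℕ) * s ^ (4 : ℕ) +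
        ((7 : ℂ) / 2) * x ^ (22 : ℕ) * t ^ (20 : ℕ) * s ^ (5 : ℕ) + ((7 : ℂ) / 2) * x ^ (22 : ℕ) * t ^ (21 : ℕ) * s ^ (6 : ℕ) +
        ((7 : ℂ) / 2) * x ^ (22 : ℕ) * t ^ (22 : ℕ) * s ^ (7 : ℕ) + ((-7 : ℂ) / 2) * x ^ (22 : ℕ) * t ^ (23 : ℕ)) * U) * hs

/-- Cofactor expansion: minor 1 of the antisymmetric sector annihilates every unknown of the sector. [folklore] -/
private theorem minor_asym1 {x t s A1 A2 A3 : ℂ} (hs : t * s = 1)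
    (h1 : (x + -(x ^ (3 : ℕ))) * A1 + (x ^ (2 : ℕ) * s + -(x ^ (3 : ℕ) * t)) * A2 + (x ^ (2 : ℕ) + -(x ^ (3 : ℕ) * t ^ (2 : ℕ))) * A3 = 0)
    (h2 : (-(x) + x ^ (3 : ℕ) + x ^ (4 : ℕ) * t ^ (2 : ℕ)) * A1 + (-(x ^ (2 : ℕ) * s) + x ^ (3 : ℕ) * t + x ^ (5 : ℕ) * t) * A2 + (-(x ^ (2 : ℕ)) +
      x ^ (3 : ℕ) * t ^ (2 : ℕ) + -(x ^ (5 : ℕ) * s ^ (2 : ℕ)) + x ^ (5 : ℕ) * t ^ (2 : ℕ)) * A3 = 0)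
    (h3 : (x + -(x ^ (3 : ℕ))) * A1 + (x ^ (2 : ℕ) * s + -(x ^ (3 : ℕ) * t) + -(x ^ (6 : ℕ) * s)) * A2 + (x ^ (2 : ℕ) + -(x ^ (3 : ℕ) * t ^ (2 : ℕ)) +
      -(x ^ (6 : ℕ) * t ^ (4 : ℕ))) * A3 = 0) :
    (-(x ^ (12 : ℕ) * s ^ (3 : ℕ)) + x ^ (13 : ℕ) * t ^ (3 : ℕ) + -(x ^ (13 : ℕ) * t ^ (7 : ℕ)) + x ^ (14 : ℕ) * s ^ (3 : ℕ) + -(x ^ (14 : ℕ) * t) +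
      x ^ (14 : ℕ) * t ^ (5 : ℕ)) * A1 = 0 ∧
    (-(x ^ (12 : ℕ) * s ^ (3 : ℕ)) + x ^ (13 : ℕ) * t ^ (3 : ℕ) + -(x ^ (13 : ℕ) * t ^ (7 : ℕ)) + x ^ (14 : ℕ) * s ^ (3 : ℕ) + -(x ^ (14 : ℕ) * t) +
      x ^ (14 : ℕ) * t ^ (5 : ℕ)) * A2 = 0 ∧
    (-(x ^ (12 : ℕ) * s ^ (3 : ℕ)) + x ^ (13 : ℕ) * t ^ (3 : ℕ) + -(x ^ (13 : ℕ) * t ^ (7 : ℕ)) + x ^ (14 : ℕ) * s ^ (3 : ℕ) + -(x ^ (14 : ℕ) * t) +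
      x ^ (14 : ℕ) * t ^ (5 : ℕ)) * A3 = 0 := by
  refine ⟨?_, ?_, ?_⟩
  · linear_combination (x ^ (7 : ℕ) * s ^ (3 : ℕ) + (-2 : ℂ) * x ^ (8 : ℕ) * s + x ^ (8 : ℕ) * t ^ (3 : ℕ) + x ^ (9 : ℕ) * t +
      -(x ^ (9 : ℕ) * t ^ (5 : ℕ)) +
        -(x ^ (11 : ℕ) * s ^ (3 : ℕ)) + x ^ (11 : ℕ) * t + -(x ^ (11 : ℕ) * t ^ (5 : ℕ))) * h1 + (-(x ^ (8 : ℕ) * s) + x ^ (8 : ℕ) * t ^ (3 : ℕ) +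
            x ^ (9 : ℕ) * t + -(x ^ (9 : ℕ) * t ^ (5 : ℕ))) * h2 + (-(x ^ (7 : ℕ) * s ^ (3 : ℕ)) + x ^ (8 : ℕ) * s) * h3 + ((x ^ (12 : ℕ) * t) * A1 +
            (x ^ (13 : ℕ) * t ^ (4 : ℕ) + -(x ^ (14 : ℕ) * s ^ (2 : ℕ))) * A2 + (x ^ (13 : ℕ) * t +
        -(x ^ (13 : ℕ) * t ^ (3 : ℕ) * s ^ (2 : ℕ)) + -(x ^ (14 : ℕ) * t * s ^ (2 : ℕ)) + -(x ^ (14 : ℕ) * t ^ (4 : ℕ) * s)) * A3) * hs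
  · linear_combination (-(x ^ (6 : ℕ) * s ^ (2 : ℕ)) + x ^ (8 : ℕ) * s ^ (2 : ℕ) + -(x ^ (8 : ℕ) * t ^ (2 : ℕ)) + x ^ (9 : ℕ) * t ^ (4 : ℕ) +
      x ^ (10 : ℕ) * t ^ (6 : ℕ)) * h1 + (-(x ^ (7 : ℕ) * t ^ (4 : ℕ)) + x ^ (9 : ℕ) * t ^ (4 : ℕ)) * h2 + (x ^ (6 : ℕ) * s ^ (2 : ℕ) +
      -(x ^ (7 : ℕ) * t ^ (4 : ℕ)) + -(x ^ (8 : ℕ) * s ^ (2 : ℕ)) + x ^ (8 : ℕ) * t ^ (2 : ℕ)) * h3 + ((-(x ^ (12 : ℕ) * t ^ (5 : ℕ)) +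
      -(x ^ (13 : ℕ) * t ^ (3 : ℕ)) + x ^ (14 : ℕ) * t) * A2) * hs
  · linear_combination (x ^ (7 : ℕ) * s + -(x ^ (7 : ℕ) * t ^ (3 : ℕ)) + x ^ (8 : ℕ) * t + -(x ^ (9 : ℕ) * s) + -(x ^ (10 : ℕ) * t)) * h1 +
      (x ^ (7 : ℕ) * s + -(x ^ (9 : ℕ) * s)) * h2 + (x ^ (7 : ℕ) * t ^ (3 : ℕ) + -(x ^ (8 : ℕ) * t)) * h3 + ((-(x ^ (11 : ℕ) * t) +
      x ^ (13 : ℕ) * t) * A1 + (x ^ (13 : ℕ) * t ^ (2 : ℕ)) * A2 + (-(x ^ (12 : ℕ) * t) + x ^ (14 : ℕ) * t) * A3) * hs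

/-- Cofactor expansion: minor 2 of the antisymmetric sector annihilates every unknown of the sector. [folklore] -/
private theorem minor_asym2 {x t s A1 A2 A3 : ℂ} (hs : t * s = 1)
    (h1 : (x + -(x ^ (3 : ℕ))) * A1 + (x ^ (2 : ℕ) * s + -(x ^ (3 : ℕ) * t)) * A2 + (x ^ (2 : ℕ) + -(x ^ (3 : ℕ) * t ^ (2 : ℕ))) * A3 = 0)
    (h2 : (x ^ (2 : ℕ) + -(x ^ (3 : ℕ) * s ^ (2 : ℕ))) * A1 + (x ^ (2 : ℕ) * t + -(x ^ (3 : ℕ) * s)) * A2 + (x + -(x ^ (3 : ℕ))) * A3 = 0)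
    (h3 : (-(x) + x ^ (3 : ℕ) + x ^ (4 : ℕ) * t ^ (2 : ℕ)) * A1 + (-(x ^ (2 : ℕ) * s) + x ^ (3 : ℕ) * t + x ^ (5 : ℕ) * t) * A2 + (-(x ^ (2 : ℕ)) +
      x ^ (3 : ℕ) * t ^ (2 : ℕ) + -(x ^ (5 : ℕ) * s ^ (2 : ℕ)) + x ^ (5 : ℕ) * t ^ (2 : ℕ)) * A3 = 0) :
    (-(x ^ (8 : ℕ) * s) + -(x ^ (8 : ℕ) * t ^ (3 : ℕ)) + (2 : ℂ) * x ^ (9 : ℕ) * s ^ (3 : ℕ) + x ^ (9 : ℕ) * t + x ^ (9 : ℕ) * t ^ (5 : ℕ) +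
      -(x ^ (10 : ℕ) * s ^ (5 : ℕ)) + -(x ^ (10 : ℕ) * t ^ (3 : ℕ))) * A1 = 0 ∧
    (-(x ^ (8 : ℕ) * s) + -(x ^ (8 : ℕ) * t ^ (3 : ℕ)) + (2 : ℂ) * x ^ (9 : ℕ) * s ^ (3 : ℕ) + x ^ (9 : ℕ) * t + x ^ (9 : ℕ) * t ^ (5 : ℕ) +
      -(x ^ (10 : ℕ) * s ^ (5 : ℕ)) + -(x ^ (10 : ℕ) * t ^ (3 : ℕ))) * A2 = 0 ∧
    (-(x ^ (8 : ℕ) * s) + -(x ^ (8 : ℕ) * t ^ (3 : ℕ)) + (2 : ℂ) * x ^ (9 : ℕ) * s ^ (3 : ℕ) + x ^ (9 : ℕ) * t + x ^ (9 : ℕ) * t ^ (5 : ℕ) +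
      -(x ^ (10 : ℕ) * s ^ (5 : ℕ)) + -(x ^ (10 : ℕ) * t ^ (3 : ℕ))) * A3 = 0 := by
  refine ⟨?_, ?_, ?_⟩
  · linear_combination (x ^ (3 : ℕ) * s + (-2 : ℂ) * x ^ (4 : ℕ) * t + x ^ (5 : ℕ) * t ^ (3 : ℕ) + -(x ^ (6 : ℕ) * t) + -(x ^ (7 : ℕ) * s) +
      x ^ (7 : ℕ) * t ^ (3 : ℕ) +
        x ^ (8 : ℕ) * s ^ (3 : ℕ)) * h1 + (x ^ (7 : ℕ) * s ^ (3 : ℕ) + -(x ^ (8 : ℕ) * s)) * h2 + (x ^ (3 : ℕ) * s + (-2 : ℂ) * x ^ (4 : ℕ) * t +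
            x ^ (5 : ℕ) * t ^ (3 : ℕ)) * h3 + ((-(x ^ (7 : ℕ) * t)) * A1 + (-(x ^ (9 : ℕ) * s ^ (2 : ℕ)) + -(x ^ (9 : ℕ) * t ^ (2 : ℕ)) +
            x ^ (11 : ℕ) * s ^ (2 : ℕ)) * A2 + (-(x ^ (8 : ℕ) * t) +
        (-2 : ℂ) * x ^ (9 : ℕ) * s + x ^ (10 : ℕ) * t ^ (2 : ℕ) * s + x ^ (11 : ℕ) * s + x ^ (11 : ℕ) * t * s ^ (2 : ℕ)) * A3) * hs
  · linear_combination (-(x ^ (2 : ℕ)) + (3 : ℂ) * x ^ (4 : ℕ) + -(x ^ (5 : ℕ) * s ^ (2 : ℕ)) + x ^ (7 : ℕ) * s ^ (2 : ℕ) +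
      (-2 : ℂ) * x ^ (7 : ℕ) * t ^ (2 : ℕ) +
        x ^ (8 : ℕ) + -(x ^ (8 : ℕ) * s ^ (4 : ℕ))) * h1 + (-(x ^ (6 : ℕ) * s ^ (2 : ℕ)) + x ^ (7 : ℕ) * t ^ (4 : ℕ) + x ^ (8 : ℕ) * s ^ (2 : ℕ) +
            -(x ^ (8 : ℕ) * t ^ (2 : ℕ))) * h2 + (-(x ^ (2 : ℕ)) + (3 : ℂ) * x ^ (4 : ℕ) + -(x ^ (5 : ℕ) * s ^ (2 : ℕ)) +
            -(x ^ (5 : ℕ) * t ^ (2 : ℕ))) * h3 + ((x ^ (9 : ℕ) + x ^ (9 : ℕ) * t * s + x ^ (10 : ℕ) * t ^ (2 : ℕ) + x ^ (10 : ℕ) * t ^ (3 : ℕ) * s +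
            -(x ^ (11 : ℕ)) + -(x ^ (11 : ℕ) * t * s)) * A1 +
        (-(x ^ (7 : ℕ) * t) + x ^ (8 : ℕ) * s + (2 : ℂ) * x ^ (9 : ℕ) * t + x ^ (10 : ℕ) * s + x ^ (10 : ℕ) * t ^ (3 : ℕ) +
            -(x ^ (11 : ℕ) * s ^ (3 : ℕ)) +
        -(x ^ (11 : ℕ) * t)) * A2 + (x ^ (10 : ℕ) + x ^ (10 : ℕ) * t * s + -(x ^ (11 : ℕ) * s ^ (2 : ℕ)) +
            -(x ^ (11 : ℕ) * t * s ^ (3 : ℕ))) * A3) * hs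
  · linear_combination (x ^ (3 : ℕ) * t + (-2 : ℂ) * x ^ (4 : ℕ) * s + x ^ (5 : ℕ) * s ^ (3 : ℕ) + -(x ^ (6 : ℕ) * t ^ (3 : ℕ)) +
      (2 : ℂ) * x ^ (7 : ℕ) * t +
        -(x ^ (8 : ℕ) * s)) * h1 + (-(x ^ (7 : ℕ) * t ^ (3 : ℕ)) + x ^ (8 : ℕ) * t) * h2 + (x ^ (3 : ℕ) * t + (-2 : ℂ) * x ^ (4 : ℕ) * s +
            x ^ (5 : ℕ) * s ^ (3 : ℕ)) * h3 + (((2 : ℂ) * x ^ (8 : ℕ) * t + -(x ^ (9 : ℕ) * s) + -(x ^ (9 : ℕ) * t * s ^ (2 : ℕ)) +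
            -(x ^ (10 : ℕ) * t) + -(x ^ (10 : ℕ) * t ^ (2 : ℕ) * s) +
        x ^ (11 : ℕ) * s) * A1 + (x ^ (8 : ℕ) * t ^ (2 : ℕ) + -(x ^ (10 : ℕ) * s ^ (2 : ℕ)) + -(x ^ (10 : ℕ) * t ^ (2 : ℕ))) * A2 + (x ^ (8 : ℕ) * s +
        (2 : ℂ) * x ^ (9 : ℕ) * t + -(x ^ (10 : ℕ) * s) + -(x ^ (10 : ℕ) * t * s ^ (2 : ℕ)) + -(x ^ (11 : ℕ) * t)) * A3) * hs

/-- Cofactor expansion: minor 3 of the antisymmetric sector annihilates every unknown of the sector. [folklore] -/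
private theorem minor_asym3 {x t s A1 A2 A3 : ℂ} (hs : t * s = 1)
    (h1 : (x ^ (2 : ℕ) * t + -(x ^ (3 : ℕ) * s)) * A1 + (x + -(x ^ (3 : ℕ))) * A2 + (x ^ (2 : ℕ) * s + -(x ^ (3 : ℕ) * t)) * A3 = 0)
    (h2 : (x ^ (2 : ℕ) * t + -(x ^ (3 : ℕ) * s) + -(x ^ (5 : ℕ) * s) + x ^ (5 : ℕ) * t ^ (3 : ℕ)) * A1 + (x + -(x ^ (3 : ℕ)) + -(x ^ (5 : ℕ))) * A2 +
      (x ^ (2 : ℕ) * s + -(x ^ (3 : ℕ) * t) + -(x ^ (4 : ℕ) * s)) * A3 = 0)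
    (h3 : (x ^ (2 : ℕ) * t + -(x ^ (3 : ℕ) * s) + -(x ^ (4 : ℕ) * t) + -(x ^ (5 : ℕ) * s) + x ^ (5 : ℕ) * t ^ (3 : ℕ) +
        x ^ (7 : ℕ) * t ^ (3 : ℕ)) * A1 + (x +
      -(x ^ (3 : ℕ)) + (-2 : ℂ) * x ^ (5 : ℕ)) * A2 + (x ^ (2 : ℕ) * s + -(x ^ (3 : ℕ) * t) + -(x ^ (4 : ℕ) * s) + x ^ (5 : ℕ) * s ^ (3 : ℕ) +
      -(x ^ (5 : ℕ) * t) + x ^ (7 : ℕ) * s ^ (3 : ℕ)) * A3 = 0) :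
    (x ^ (9 : ℕ) + (-5 : ℂ) * x ^ (11 : ℕ) + x ^ (11 : ℕ) * s ^ (4 : ℕ) + x ^ (11 : ℕ) * t ^ (4 : ℕ) + x ^ (12 : ℕ) * s ^ (2 : ℕ) + -(x ^ (13 : ℕ)) +
      x ^ (13 : ℕ) * s ^ (4 : ℕ) + -(x ^ (14 : ℕ) * s ^ (2 : ℕ)) + (2 : ℂ) * x ^ (14 : ℕ) * t ^ (2 : ℕ) + x ^ (15 : ℕ) +
          -(x ^ (15 : ℕ) * t ^ (4 : ℕ))) * A1 = 0 ∧
    (x ^ (9 : ℕ) + (-5 : ℂ) * x ^ (11 : ℕ) + x ^ (11 : ℕ) * s ^ (4 : ℕ) + x ^ (11 : ℕ) * t ^ (4 : ℕ) + x ^ (12 : ℕ) * s ^ (2 : ℕ) + -(x ^ (13 : ℕ)) +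
      x ^ (13 : ℕ) * s ^ (4 : ℕ) + -(x ^ (14 : ℕ) * s ^ (2 : ℕ)) + (2 : ℂ) * x ^ (14 : ℕ) * t ^ (2 : ℕ) + x ^ (15 : ℕ) +
          -(x ^ (15 : ℕ) * t ^ (4 : ℕ))) * A2 = 0 ∧
    (x ^ (9 : ℕ) + (-5 : ℂ) * x ^ (11 : ℕ) + x ^ (11 : ℕ) * s ^ (4 : ℕ) + x ^ (11 : ℕ) * t ^ (4 : ℕ) + x ^ (12 : ℕ) * s ^ (2 : ℕ) + -(x ^ (13 : ℕ)) +
      x ^ (13 : ℕ) * s ^ (4 : ℕ) + -(x ^ (14 : ℕ) * s ^ (2 : ℕ)) + (2 : ℂ) * x ^ (14 : ℕ) * t ^ (2 : ℕ) + x ^ (15 : ℕ) +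
          -(x ^ (15 : ℕ) * t ^ (4 : ℕ))) * A3 = 0 := by
  refine ⟨?_, ?_, ?_⟩
  · linear_combination (x ^ (6 : ℕ) * s ^ (3 : ℕ) + -(x ^ (6 : ℕ) * t) + x ^ (7 : ℕ) * s + -(x ^ (9 : ℕ) * s) + (-2 : ℂ) * x ^ (10 : ℕ) * s ^ (3 : ℕ) +
      x ^ (10 : ℕ) * t +
        -(x ^ (12 : ℕ) * s ^ (3 : ℕ))) * h1 + (x ^ (5 : ℕ) * s + -(x ^ (6 : ℕ) * s ^ (3 : ℕ)) + x ^ (6 : ℕ) * t + (-3 : ℂ) * x ^ (7 : ℕ) * s +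
            x ^ (8 : ℕ) * t + x ^ (10 : ℕ) * s ^ (3 : ℕ)) * h2 + (-(x ^ (5 : ℕ) * s) + (2 : ℂ) * x ^ (7 : ℕ) * s + -(x ^ (8 : ℕ) * t)) * h3 +
            ((-(x ^ (9 : ℕ)) + (5 : ℂ) * x ^ (11 : ℕ) + x ^ (11 : ℕ) * t * s + x ^ (11 : ℕ) * t ^ (2 : ℕ) * s ^ (2 : ℕ) + x ^ (12 : ℕ) * s ^ (2 : ℕ) +
        (2 : ℂ) * x ^ (12 : ℕ) * t ^ (2 : ℕ) + x ^ (13 : ℕ) + x ^ (14 : ℕ) * s ^ (2 : ℕ) + (-2 : ℂ) * x ^ (14 : ℕ) * t ^ (2 : ℕ) + -(x ^ (15 : ℕ)) +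
        -(x ^ (15 : ℕ) * t * s) + -(x ^ (15 : ℕ) * t ^ (2 : ℕ) * s ^ (2 : ℕ))) * A1) * hs
  · linear_combination (-(x ^ (6 : ℕ)) + -(x ^ (7 : ℕ) * s ^ (2 : ℕ)) + (2 : ℂ) * x ^ (7 : ℕ) * t ^ (2 : ℕ) + x ^ (8 : ℕ) * s ^ (4 : ℕ) +
      -(x ^ (9 : ℕ) * s ^ (2 : ℕ)) +
        x ^ (9 : ℕ) * t ^ (2 : ℕ) + (-2 : ℂ) * x ^ (10 : ℕ) + (2 : ℂ) * x ^ (10 : ℕ) * s ^ (4 : ℕ) + -(x ^ (11 : ℕ) * t ^ (2 : ℕ)) + -(x ^ (12 : ℕ)) +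
        x ^ (12 : ℕ) * s ^ (4 : ℕ)) * h1 + ((3 : ℂ) * x ^ (7 : ℕ) * s ^ (2 : ℕ) + (-3 : ℂ) * x ^ (7 : ℕ) * t ^ (2 : ℕ) + -(x ^ (8 : ℕ) * s ^ (4 : ℕ)) +
            x ^ (8 : ℕ) * t ^ (4 : ℕ) +
        x ^ (9 : ℕ) * s ^ (2 : ℕ) + -(x ^ (9 : ℕ) * t ^ (2 : ℕ)) + -(x ^ (10 : ℕ) * s ^ (4 : ℕ)) + x ^ (10 : ℕ) * t ^ (4 : ℕ)) * h2 + (x ^ (6 : ℕ) +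
            (-2 : ℂ) * x ^ (7 : ℕ) * s ^ (2 : ℕ) + x ^ (7 : ℕ) * t ^ (2 : ℕ) + x ^ (8 : ℕ) + -(x ^ (8 : ℕ) * t ^ (4 : ℕ))) * h3 +
            (((-2 : ℂ) * x ^ (11 : ℕ) * s + -(x ^ (12 : ℕ) * s ^ (3 : ℕ)) + (-3 : ℂ) * x ^ (12 : ℕ) * t + -(x ^ (12 : ℕ) * t ^ (2 : ℕ) * s) +
            x ^ (13 : ℕ) * s +
        x ^ (13 : ℕ) * t * s ^ (2 : ℕ) + x ^ (13 : ℕ) * t ^ (2 : ℕ) * s ^ (3 : ℕ) + x ^ (13 : ℕ) * t ^ (3 : ℕ) + -(x ^ (14 : ℕ) * s ^ (3 : ℕ)) +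
        -(x ^ (14 : ℕ) * t) + x ^ (14 : ℕ) * t ^ (2 : ℕ) * s + x ^ (15 : ℕ) * s + x ^ (15 : ℕ) * t * s ^ (2 : ℕ) +
            x ^ (15 : ℕ) * t ^ (2 : ℕ) * s ^ (3 : ℕ) +
        x ^ (15 : ℕ) * t ^ (3 : ℕ)) * A1 + ((-2 : ℂ) * x ^ (11 : ℕ) * t + (-3 : ℂ) * x ^ (12 : ℕ) * s + -(x ^ (12 : ℕ) * t * s ^ (2 : ℕ)) +
        -(x ^ (12 : ℕ) * t ^ (3 : ℕ)) + x ^ (13 : ℕ) * s ^ (3 : ℕ) + x ^ (13 : ℕ) * t + x ^ (13 : ℕ) * t ^ (2 : ℕ) * s +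
        x ^ (13 : ℕ) * t ^ (3 : ℕ) * s ^ (2 : ℕ) + -(x ^ (14 : ℕ) * s) + -(x ^ (14 : ℕ) * t * s ^ (2 : ℕ)) + x ^ (14 : ℕ) * t ^ (3 : ℕ) +
        x ^ (15 : ℕ) * s ^ (3 : ℕ) + x ^ (15 : ℕ) * t + x ^ (15 : ℕ) * t ^ (2 : ℕ) * s + x ^ (15 : ℕ) * t ^ (3 : ℕ) * s ^ (2 : ℕ)) * A3) * hs
  · linear_combination (x ^ (5 : ℕ) * t + (-2 : ℂ) * x ^ (7 : ℕ) * t + x ^ (8 : ℕ) * s + -(x ^ (8 : ℕ) * t ^ (3 : ℕ)) + -(x ^ (9 : ℕ) * t) +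
      x ^ (10 : ℕ) * s +
        x ^ (12 : ℕ) * t ^ (3 : ℕ)) * h1 + (-(x ^ (5 : ℕ) * t) + -(x ^ (6 : ℕ) * s) + x ^ (6 : ℕ) * t ^ (3 : ℕ) + (3 : ℂ) * x ^ (7 : ℕ) * t +
            -(x ^ (8 : ℕ) * s) + -(x ^ (10 : ℕ) * t ^ (3 : ℕ))) * h2 + (x ^ (6 : ℕ) * s + -(x ^ (6 : ℕ) * t ^ (3 : ℕ)) + -(x ^ (7 : ℕ) * t) +
            x ^ (8 : ℕ) * t ^ (3 : ℕ)) * h3 + ((-(x ^ (9 : ℕ)) + (5 : ℂ) * x ^ (11 : ℕ) + x ^ (11 : ℕ) * t * s +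
            x ^ (11 : ℕ) * t ^ (2 : ℕ) * s ^ (2 : ℕ) + x ^ (12 : ℕ) * s ^ (2 : ℕ) +
        (2 : ℂ) * x ^ (12 : ℕ) * t ^ (2 : ℕ) + x ^ (13 : ℕ) + x ^ (14 : ℕ) * s ^ (2 : ℕ) + (-2 : ℂ) * x ^ (14 : ℕ) * t ^ (2 : ℕ) + -(x ^ (15 : ℕ)) +
        -(x ^ (15 : ℕ) * t * s) + -(x ^ (15 : ℕ) * t ^ (2 : ℕ) * s ^ (2 : ℕ))) * A3) * hs

/-- Cofactor expansion: minor 4 of the antisymmetric sector annihilates every unknown of the sector. [folklore] -/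
private theorem minor_asym4 {x t s A1 A2 A3 : ℂ} (hs : t * s = 1)
    (h1 : (x ^ (2 : ℕ) * t + -(x ^ (3 : ℕ) * s) + -(x ^ (5 : ℕ) * s) + x ^ (5 : ℕ) * t ^ (3 : ℕ)) * A1 + (x + -(x ^ (3 : ℕ)) + -(x ^ (5 : ℕ))) * A2 +
      (x ^ (2 : ℕ) * s + -(x ^ (3 : ℕ) * t) + -(x ^ (4 : ℕ) * s)) * A3 = 0)
    (h2 : (-(x ^ (2 : ℕ) * t) + x ^ (3 : ℕ) * s + x ^ (4 : ℕ) * t) * A1 + (-(x) + x ^ (3 : ℕ) + x ^ (5 : ℕ)) * A2 + (-(x ^ (2 : ℕ) * s) +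
        x ^ (3 : ℕ) * t +
      -(x ^ (5 : ℕ) * s ^ (3 : ℕ)) + x ^ (5 : ℕ) * t) * A3 = 0)
    (h3 : (x ^ (2 : ℕ) * t + -(x ^ (3 : ℕ) * s) + -(x ^ (4 : ℕ) * t) + -(x ^ (5 : ℕ) * s) + x ^ (5 : ℕ) * t ^ (3 : ℕ) +
        x ^ (7 : ℕ) * t ^ (3 : ℕ)) * A1 + (x +
      -(x ^ (3 : ℕ)) + (-2 : ℂ) * x ^ (5 : ℕ)) * A2 + (x ^ (2 : ℕ) * s + -(x ^ (3 : ℕ) * t) + -(x ^ (4 : ℕ) * s) + x ^ (5 : ℕ) * s ^ (3 : ℕ) +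
      -(x ^ (5 : ℕ) * t) + x ^ (7 : ℕ) * s ^ (3 : ℕ)) * A3 = 0) :
    (x ^ (9 : ℕ) + (-5 : ℂ) * x ^ (11 : ℕ) + x ^ (11 : ℕ) * s ^ (4 : ℕ) + x ^ (11 : ℕ) * t ^ (4 : ℕ) + (-2 : ℂ) * x ^ (13 : ℕ) +
      x ^ (13 : ℕ) * s ^ (4 : ℕ) + x ^ (13 : ℕ) * t ^ (4 : ℕ) + x ^ (14 : ℕ) * s ^ (2 : ℕ) + x ^ (14 : ℕ) * t ^ (2 : ℕ) + (2 : ℂ) * x ^ (15 : ℕ) +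
      -(x ^ (15 : ℕ) * s ^ (4 : ℕ)) + -(x ^ (15 : ℕ) * t ^ (4 : ℕ)) + x ^ (16 : ℕ) * s ^ (2 : ℕ) + x ^ (16 : ℕ) * t ^ (2 : ℕ) +
          (2 : ℂ) * x ^ (17 : ℕ) +
      -(x ^ (17 : ℕ) * s ^ (4 : ℕ)) + -(x ^ (17 : ℕ) * t ^ (4 : ℕ))) * A1 = 0 ∧
    (x ^ (9 : ℕ) + (-5 : ℂ) * x ^ (11 : ℕ) + x ^ (11 : ℕ) * s ^ (4 : ℕ) + x ^ (11 : ℕ) * t ^ (4 : ℕ) + (-2 : ℂ) * x ^ (13 : ℕ) +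
      x ^ (13 : ℕ) * s ^ (4 : ℕ) + x ^ (13 : ℕ) * t ^ (4 : ℕ) + x ^ (14 : ℕ) * s ^ (2 : ℕ) + x ^ (14 : ℕ) * t ^ (2 : ℕ) + (2 : ℂ) * x ^ (15 : ℕ) +
      -(x ^ (15 : ℕ) * s ^ (4 : ℕ)) + -(x ^ (15 : ℕ) * t ^ (4 : ℕ)) + x ^ (16 : ℕ) * s ^ (2 : ℕ) + x ^ (16 : ℕ) * t ^ (2 : ℕ) +
          (2 : ℂ) * x ^ (17 : ℕ) +
      -(x ^ (17 : ℕ) * s ^ (4 : ℕ)) + -(x ^ (17 : ℕ) * t ^ (4 : ℕ))) * A2 = 0 ∧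
    (x ^ (9 : ℕ) + (-5 : ℂ) * x ^ (11 : ℕ) + x ^ (11 : ℕ) * s ^ (4 : ℕ) + x ^ (11 : ℕ) * t ^ (4 : ℕ) + (-2 : ℂ) * x ^ (13 : ℕ) +
      x ^ (13 : ℕ) * s ^ (4 : ℕ) + x ^ (13 : ℕ) * t ^ (4 : ℕ) + x ^ (14 : ℕ) * s ^ (2 : ℕ) + x ^ (14 : ℕ) * t ^ (2 : ℕ) + (2 : ℂ) * x ^ (15 : ℕ) +
      -(x ^ (15 : ℕ) * s ^ (4 : ℕ)) + -(x ^ (15 : ℕ) * t ^ (4 : ℕ)) + x ^ (16 : ℕ) * s ^ (2 : ℕ) + x ^ (16 : ℕ) * t ^ (2 : ℕ) +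
          (2 : ℂ) * x ^ (17 : ℕ) +
      -(x ^ (17 : ℕ) * s ^ (4 : ℕ)) + -(x ^ (17 : ℕ) * t ^ (4 : ℕ))) * A3 = 0 := by
  refine ⟨?_, ?_, ?_⟩
  · linear_combination (x ^ (5 : ℕ) * s + (-2 : ℂ) * x ^ (7 : ℕ) * s + -(x ^ (8 : ℕ) * s ^ (3 : ℕ)) + x ^ (8 : ℕ) * t + -(x ^ (9 : ℕ) * s) +
      x ^ (10 : ℕ) * t +
        x ^ (12 : ℕ) * s ^ (3 : ℕ)) * h1 + (-(x ^ (6 : ℕ) * s ^ (3 : ℕ)) + x ^ (6 : ℕ) * t + -(x ^ (7 : ℕ) * s) + x ^ (9 : ℕ) * s +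
            (2 : ℂ) * x ^ (10 : ℕ) * s ^ (3 : ℕ) + -(x ^ (10 : ℕ) * t) +
        x ^ (12 : ℕ) * s ^ (3 : ℕ)) * h2 + (-(x ^ (5 : ℕ) * s) + -(x ^ (6 : ℕ) * s ^ (3 : ℕ)) + x ^ (6 : ℕ) * t + x ^ (7 : ℕ) * s +
            x ^ (8 : ℕ) * s ^ (3 : ℕ) + -(x ^ (8 : ℕ) * t) +
        x ^ (9 : ℕ) * s + x ^ (10 : ℕ) * s ^ (3 : ℕ) + -(x ^ (10 : ℕ) * t)) * h3 + ((-(x ^ (9 : ℕ)) + (5 : ℂ) * x ^ (11 : ℕ) + x ^ (11 : ℕ) * t * s +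
            x ^ (11 : ℕ) * t ^ (2 : ℕ) * s ^ (2 : ℕ) + (2 : ℂ) * x ^ (12 : ℕ) * s ^ (2 : ℕ) +
        (2 : ℂ) * x ^ (12 : ℕ) * t ^ (2 : ℕ) + (2 : ℂ) * x ^ (13 : ℕ) + x ^ (13 : ℕ) * t * s + x ^ (13 : ℕ) * t ^ (2 : ℕ) * s ^ (2 : ℕ) +
        -(x ^ (14 : ℕ) * s ^ (2 : ℕ)) + -(x ^ (14 : ℕ) * t ^ (2 : ℕ)) + (-2 : ℂ) * x ^ (15 : ℕ) + (-2 : ℂ) * x ^ (15 : ℕ) * t * s +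
        (-2 : ℂ) * x ^ (15 : ℕ) * t ^ (2 : ℕ) * s ^ (2 : ℕ) + -(x ^ (16 : ℕ) * s ^ (2 : ℕ)) + -(x ^ (16 : ℕ) * t ^ (2 : ℕ)) +
            (-2 : ℂ) * x ^ (17 : ℕ) +
        (-2 : ℂ) * x ^ (17 : ℕ) * t * s + (-2 : ℂ) * x ^ (17 : ℕ) * t ^ (2 : ℕ) * s ^ (2 : ℕ)) * A1) * hs
  · linear_combination (-(x ^ (6 : ℕ)) + (2 : ℂ) * x ^ (7 : ℕ) * s ^ (2 : ℕ) + -(x ^ (7 : ℕ) * t ^ (2 : ℕ)) + x ^ (8 : ℕ) * t ^ (4 : ℕ) +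
      x ^ (9 : ℕ) * s ^ (2 : ℕ) +
        -(x ^ (9 : ℕ) * t ^ (2 : ℕ)) + (-2 : ℂ) * x ^ (10 : ℕ) + (2 : ℂ) * x ^ (10 : ℕ) * t ^ (4 : ℕ) + -(x ^ (11 : ℕ) * s ^ (2 : ℕ)) +
            -(x ^ (12 : ℕ)) +
        x ^ (12 : ℕ) * t ^ (4 : ℕ)) * h1 + (x ^ (6 : ℕ) + x ^ (7 : ℕ) * s ^ (2 : ℕ) + (-2 : ℂ) * x ^ (7 : ℕ) * t ^ (2 : ℕ) +
            -(x ^ (8 : ℕ) * s ^ (4 : ℕ)) + x ^ (9 : ℕ) * s ^ (2 : ℕ) +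
        -(x ^ (9 : ℕ) * t ^ (2 : ℕ)) + (2 : ℂ) * x ^ (10 : ℕ) + (-2 : ℂ) * x ^ (10 : ℕ) * s ^ (4 : ℕ) + x ^ (11 : ℕ) * t ^ (2 : ℕ) + x ^ (12 : ℕ) +
        -(x ^ (12 : ℕ) * s ^ (4 : ℕ))) * h2 + ((2 : ℂ) * x ^ (6 : ℕ) + -(x ^ (7 : ℕ) * s ^ (2 : ℕ)) + -(x ^ (7 : ℕ) * t ^ (2 : ℕ)) + x ^ (8 : ℕ) +
            -(x ^ (8 : ℕ) * s ^ (4 : ℕ)) +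
        -(x ^ (8 : ℕ) * t ^ (4 : ℕ)) + (2 : ℂ) * x ^ (10 : ℕ) + -(x ^ (10 : ℕ) * s ^ (4 : ℕ)) + -(x ^ (10 : ℕ) * t ^ (4 : ℕ))) * h3 +
            (((-2 : ℂ) * x ^ (11 : ℕ) * s + -(x ^ (12 : ℕ) * s ^ (3 : ℕ)) + (-3 : ℂ) * x ^ (12 : ℕ) * t + -(x ^ (12 : ℕ) * t ^ (2 : ℕ) * s) +
            x ^ (13 : ℕ) * s +
        x ^ (13 : ℕ) * t * s ^ (2 : ℕ) + x ^ (13 : ℕ) * t ^ (2 : ℕ) * s ^ (3 : ℕ) + x ^ (13 : ℕ) * t ^ (3 : ℕ) + (-2 : ℂ) * x ^ (14 : ℕ) * t +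
        (2 : ℂ) * x ^ (15 : ℕ) * s + (2 : ℂ) * x ^ (15 : ℕ) * t * s ^ (2 : ℕ) + (2 : ℂ) * x ^ (15 : ℕ) * t ^ (2 : ℕ) * s ^ (3 : ℕ) +
        (2 : ℂ) * x ^ (15 : ℕ) * t ^ (3 : ℕ) + x ^ (16 : ℕ) * s ^ (3 : ℕ) + x ^ (16 : ℕ) * t + x ^ (16 : ℕ) * t ^ (2 : ℕ) * s + x ^ (17 : ℕ) * s +
        x ^ (17 : ℕ) * t * s ^ (2 : ℕ) + x ^ (17 : ℕ) * t ^ (2 : ℕ) * s ^ (3 : ℕ) + x ^ (17 : ℕ) * t ^ (3 : ℕ)) * A1 + ((-2 : ℂ) * x ^ (11 : ℕ) * t +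
        (-3 : ℂ) * x ^ (12 : ℕ) * s + -(x ^ (12 : ℕ) * t * s ^ (2 : ℕ)) + -(x ^ (12 : ℕ) * t ^ (3 : ℕ)) + x ^ (13 : ℕ) * s ^ (3 : ℕ) +
            x ^ (13 : ℕ) * t +
        x ^ (13 : ℕ) * t ^ (2 : ℕ) * s + x ^ (13 : ℕ) * t ^ (3 : ℕ) * s ^ (2 : ℕ) + (-2 : ℂ) * x ^ (14 : ℕ) * s +
            (2 : ℂ) * x ^ (15 : ℕ) * s ^ (3 : ℕ) +
        (2 : ℂ) * x ^ (15 : ℕ) * t + (2 : ℂ) * x ^ (15 : ℕ) * t ^ (2 : ℕ) * s + (2 : ℂ) * x ^ (15 : ℕ) * t ^ (3 : ℕ) * s ^ (2 : ℕ) +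
            x ^ (16 : ℕ) * s +
        x ^ (16 : ℕ) * t * s ^ (2 : ℕ) + x ^ (16 : ℕ) * t ^ (3 : ℕ) + x ^ (17 : ℕ) * s ^ (3 : ℕ) + x ^ (17 : ℕ) * t + x ^ (17 : ℕ) * t ^ (2 : ℕ) * s +
        x ^ (17 : ℕ) * t ^ (3 : ℕ) * s ^ (2 : ℕ)) * A3) * hs
  · linear_combination (-(x ^ (6 : ℕ) * s) + x ^ (6 : ℕ) * t ^ (3 : ℕ) + x ^ (7 : ℕ) * t + -(x ^ (9 : ℕ) * t) + x ^ (10 : ℕ) * s +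
      (-2 : ℂ) * x ^ (10 : ℕ) * t ^ (3 : ℕ) +
        -(x ^ (12 : ℕ) * t ^ (3 : ℕ))) * h1 + (-(x ^ (5 : ℕ) * t) + (2 : ℂ) * x ^ (7 : ℕ) * t + -(x ^ (8 : ℕ) * s) + x ^ (8 : ℕ) * t ^ (3 : ℕ) +
            x ^ (9 : ℕ) * t + -(x ^ (10 : ℕ) * s) +
        -(x ^ (12 : ℕ) * t ^ (3 : ℕ))) * h2 + (-(x ^ (5 : ℕ) * t) + x ^ (6 : ℕ) * s + -(x ^ (6 : ℕ) * t ^ (3 : ℕ)) + x ^ (7 : ℕ) * t +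
            -(x ^ (8 : ℕ) * s) + x ^ (8 : ℕ) * t ^ (3 : ℕ) +
        x ^ (9 : ℕ) * t + -(x ^ (10 : ℕ) * s) + x ^ (10 : ℕ) * t ^ (3 : ℕ)) * h3 + ((-(x ^ (9 : ℕ)) + (5 : ℂ) * x ^ (11 : ℕ) + x ^ (11 : ℕ) * t * s +
            x ^ (11 : ℕ) * t ^ (2 : ℕ) * s ^ (2 : ℕ) + (2 : ℂ) * x ^ (12 : ℕ) * s ^ (2 : ℕ) +
        (2 : ℂ) * x ^ (12 : ℕ) * t ^ (2 : ℕ) + (2 : ℂ) * x ^ (13 : ℕ) + x ^ (13 : ℕ) * t * s + x ^ (13 : ℕ) * t ^ (2 : ℕ) * s ^ (2 : ℕ) +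
        -(x ^ (14 : ℕ) * s ^ (2 : ℕ)) + -(x ^ (14 : ℕ) * t ^ (2 : ℕ)) + (-2 : ℂ) * x ^ (15 : ℕ) + (-2 : ℂ) * x ^ (15 : ℕ) * t * s +
        (-2 : ℂ) * x ^ (15 : ℕ) * t ^ (2 : ℕ) * s ^ (2 : ℕ) + -(x ^ (16 : ℕ) * s ^ (2 : ℕ)) + -(x ^ (16 : ℕ) * t ^ (2 : ℕ)) +
            (-2 : ℂ) * x ^ (17 : ℕ) +
        (-2 : ℂ) * x ^ (17 : ℕ) * t * s + (-2 : ℂ) * x ^ (17 : ℕ) * t ^ (2 : ℕ) * s ^ (2 : ℕ)) * A3) * hs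

/-- Cofactor expansion: minor 5 of the antisymmetric sector annihilates every unknown of the sector. [folklore] -/
private theorem minor_asym5 {x t s A1 A2 A3 : ℂ} (hs : t * s = 1)
    (h1 : (x + -(x ^ (3 : ℕ))) * A1 + (x ^ (2 : ℕ) * s + -(x ^ (3 : ℕ) * t)) * A2 + (x ^ (2 : ℕ) + -(x ^ (3 : ℕ) * t ^ (2 : ℕ))) * A3 = 0)
    (h2 : (x ^ (2 : ℕ) * t + -(x ^ (3 : ℕ) * s)) * A1 + (x + -(x ^ (3 : ℕ))) * A2 + (x ^ (2 : ℕ) * s + -(x ^ (3 : ℕ) * t)) * A3 = 0)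
    (h3 : (x ^ (2 : ℕ) * t + -(x ^ (3 : ℕ) * s)) * A1 + (x + -(x ^ (3 : ℕ)) + -(x ^ (6 : ℕ) * s ^ (2 : ℕ))) * A2 + (x ^ (2 : ℕ) * s +
        -(x ^ (3 : ℕ) * t) +
      -(x ^ (6 : ℕ) * t ^ (3 : ℕ))) * A3 = 0) :
    (-(x ^ (8 : ℕ) * t ^ (3 : ℕ)) + x ^ (9 : ℕ) * s ^ (3 : ℕ) + (-2 : ℂ) * x ^ (10 : ℕ) * s + (3 : ℂ) * x ^ (10 : ℕ) * t ^ (3 : ℕ) +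
      -(x ^ (11 : ℕ) * t ^ (5 : ℕ))) * A1 = 0 ∧
    (-(x ^ (8 : ℕ) * t ^ (3 : ℕ)) + x ^ (9 : ℕ) * s ^ (3 : ℕ) + (-2 : ℂ) * x ^ (10 : ℕ) * s + (3 : ℂ) * x ^ (10 : ℕ) * t ^ (3 : ℕ) +
      -(x ^ (11 : ℕ) * t ^ (5 : ℕ))) * A2 = 0 ∧
    (-(x ^ (8 : ℕ) * t ^ (3 : ℕ)) + x ^ (9 : ℕ) * s ^ (3 : ℕ) + (-2 : ℂ) * x ^ (10 : ℕ) * s + (3 : ℂ) * x ^ (10 : ℕ) * t ^ (3 : ℕ) +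
      -(x ^ (11 : ℕ) * t ^ (5 : ℕ))) * A3 = 0 := by
  refine ⟨?_, ?_, ?_⟩
  · linear_combination (-(x ^ (7 : ℕ) * t ^ (3 : ℕ)) + x ^ (8 : ℕ) * s ^ (3 : ℕ) + -(x ^ (9 : ℕ) * s) + x ^ (9 : ℕ) * t ^ (3 : ℕ)) * h1 + (x ^ (3 : ℕ) +
      -(x ^ (4 : ℕ) * s ^ (2 : ℕ)) + -(x ^ (4 : ℕ) * t ^ (2 : ℕ)) + x ^ (5 : ℕ) + -(x ^ (8 : ℕ) * s ^ (2 : ℕ)) + x ^ (8 : ℕ) * t ^ (2 : ℕ) +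
        x ^ (9 : ℕ) + -(x ^ (9 : ℕ) * t ^ (4 : ℕ))) * h2 + (-(x ^ (3 : ℕ)) + x ^ (4 : ℕ) * s ^ (2 : ℕ) + x ^ (4 : ℕ) * t ^ (2 : ℕ) +
            -(x ^ (5 : ℕ))) * h3 + ((x ^ (10 : ℕ) * s + x ^ (11 : ℕ) * t + -(x ^ (12 : ℕ) * t ^ (3 : ℕ))) * A1 + (x ^ (9 : ℕ) * t ^ (2 : ℕ) +
            x ^ (10 : ℕ) + x ^ (10 : ℕ) * t * s +
        x ^ (11 : ℕ) * s ^ (2 : ℕ) + -(x ^ (11 : ℕ) * t ^ (2 : ℕ)) + -(x ^ (12 : ℕ))) * A2 + (x ^ (10 : ℕ) * t ^ (2 : ℕ) * s +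
            x ^ (11 : ℕ) * t * s ^ (2 : ℕ) +
        x ^ (11 : ℕ) * t ^ (3 : ℕ) + -(x ^ (12 : ℕ) * t)) * A3) * hs
  · linear_combination (x ^ (8 : ℕ) * t ^ (4 : ℕ) + -(x ^ (9 : ℕ) * t ^ (2 : ℕ))) * h1 + (x ^ (3 : ℕ) * s + (-2 : ℂ) * x ^ (4 : ℕ) * t +
      x ^ (5 : ℕ) * t ^ (3 : ℕ) + -(x ^ (7 : ℕ) * t ^ (3 : ℕ)) + x ^ (9 : ℕ) * t ^ (3 : ℕ)) * h2 + (-(x ^ (3 : ℕ) * s) + (2 : ℂ) * x ^ (4 : ℕ) * t +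
      -(x ^ (5 : ℕ) * t ^ (3 : ℕ))) * h3 + ((-(x ^ (10 : ℕ) * t ^ (2 : ℕ)) + x ^ (12 : ℕ) * t ^ (2 : ℕ)) * A1 + ((2 : ℂ) * x ^ (10 : ℕ) * s +
      -(x ^ (10 : ℕ) * t ^ (3 : ℕ)) +
        -(x ^ (11 : ℕ) * t ^ (2 : ℕ) * s)) * A2 + (-(x ^ (11 : ℕ) * t ^ (2 : ℕ))) * A3) * hs
  · linear_combination (-(x ^ (8 : ℕ) * s) + x ^ (9 : ℕ) * s ^ (3 : ℕ)) * h1 + (-(x ^ (2 : ℕ)) + (3 : ℂ) * x ^ (4 : ℕ) + -(x ^ (5 : ℕ) * s ^ (2 : ℕ)) +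
      -(x ^ (5 : ℕ) * t ^ (2 : ℕ)) + x ^ (7 : ℕ) * s ^ (2 : ℕ) +
        -(x ^ (9 : ℕ) * s ^ (2 : ℕ))) * h2 + (x ^ (2 : ℕ) + (-3 : ℂ) * x ^ (4 : ℕ) + x ^ (5 : ℕ) * s ^ (2 : ℕ) + x ^ (5 : ℕ) * t ^ (2 : ℕ)) * h3 +
            ((-(x ^ (9 : ℕ) * s) + x ^ (11 : ℕ) * s) * A1 + (x ^ (11 : ℕ) * t * s + x ^ (12 : ℕ) * s ^ (2 : ℕ)) * A2 + (x ^ (10 : ℕ) * s +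
        x ^ (11 : ℕ) * t ^ (2 : ℕ) * s + x ^ (12 : ℕ) * t * s ^ (2 : ℕ)) * A3) * hs

/-- Nullstellensatz certificate of the antisymmetric sector: the minors generate `x^12 t^0` (exact). [folklore] -/
private theorem cert_asym {x t s U : ℂ} (hs : t * s = 1)
    (h1 : (-(x ^ (12 : ℕ) * s ^ (3 : ℕ)) + x ^ (13 : ℕ) * t ^ (3 : ℕ) + -(x ^ (13 : ℕ) * t ^ (7 : ℕ)) + x ^ (14 : ℕ) * s ^ (3 : ℕ) +
        -(x ^ (14 : ℕ) * t) +
      x ^ (14 : ℕ) * t ^ (5 : ℕ)) * U = 0)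
    (h2 : (-(x ^ (8 : ℕ) * s) + -(x ^ (8 : ℕ) * t ^ (3 : ℕ)) + (2 : ℂ) * x ^ (9 : ℕ) * s ^ (3 : ℕ) + x ^ (9 : ℕ) * t + x ^ (9 : ℕ) * t ^ (5 : ℕ) +
      -(x ^ (10 : ℕ) * s ^ (5 : ℕ)) + -(x ^ (10 : ℕ) * t ^ (3 : ℕ))) * U = 0)
    (h3 : (x ^ (9 : ℕ) + (-5 : ℂ) * x ^ (11 : ℕ) + x ^ (11 : ℕ) * s ^ (4 : ℕ) + x ^ (11 : ℕ) * t ^ (4 : ℕ) + x ^ (12 : ℕ) * s ^ (2 : ℕ) +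
        -(x ^ (13 : ℕ)) +
      x ^ (13 : ℕ) * s ^ (4 : ℕ) + -(x ^ (14 : ℕ) * s ^ (2 : ℕ)) + (2 : ℂ) * x ^ (14 : ℕ) * t ^ (2 : ℕ) + x ^ (15 : ℕ) +
          -(x ^ (15 : ℕ) * t ^ (4 : ℕ))) * U = 0)
    (h4 : (x ^ (9 : ℕ) + (-5 : ℂ) * x ^ (11 : ℕ) + x ^ (11 : ℕ) * s ^ (4 : ℕ) + x ^ (11 : ℕ) * t ^ (4 : ℕ) + (-2 : ℂ) * x ^ (13 : ℕ) +
      x ^ (13 : ℕ) * s ^ (4 : ℕ) + x ^ (13 : ℕ) * t ^ (4 : ℕ) + x ^ (14 : ℕ) * s ^ (2 : ℕ) + x ^ (14 : ℕ) * t ^ (2 : ℕ) + (2 : ℂ) * x ^ (15 : ℕ) +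
      -(x ^ (15 : ℕ) * s ^ (4 : ℕ)) + -(x ^ (15 : ℕ) * t ^ (4 : ℕ)) + x ^ (16 : ℕ) * s ^ (2 : ℕ) + x ^ (16 : ℕ) * t ^ (2 : ℕ) +
          (2 : ℂ) * x ^ (17 : ℕ) +
      -(x ^ (17 : ℕ) * s ^ (4 : ℕ)) + -(x ^ (17 : ℕ) * t ^ (4 : ℕ))) * U = 0)
    (h5 : (-(x ^ (8 : ℕ) * t ^ (3 : ℕ)) + x ^ (9 : ℕ) * s ^ (3 : ℕ) + (-2 : ℂ) * x ^ (10 : ℕ) * s + (3 : ℂ) * x ^ (10 : ℕ) * t ^ (3 : ℕ) +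
      -(x ^ (11 : ℕ) * t ^ (5 : ℕ))) * U = 0) :
    (x ^ (12 : ℕ)) * U = 0 := by
  linear_combination (-(t ^ (3 : ℕ)) + ((-392 : ℂ) / 15) * t ^ (7 : ℕ) + ((-3367 : ℂ) / 20) * t ^ (11 : ℕ) + ((-868 : ℂ) / 5) * t ^ (15 : ℕ) +
        ((769 : ℂ) / 15) * x * t ^ (5 : ℕ) + ((6581 : ℂ) / 20) * x * t ^ (9 : ℕ) + ((973 : ℂ) / 6) * x * t ^ (13 : ℕ) +
            ((3614 : ℂ) / 15) * x * t ^ (17 : ℕ) +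
        ((-407 : ℂ) / 15) * x ^ (2 : ℕ) * t ^ (3 : ℕ) + ((-4633 : ℂ) / 30) * x ^ (2 : ℕ) * t ^ (7 : ℕ) +
            ((-1151 : ℂ) / 15) * x ^ (2 : ℕ) * t ^ (11 : ℕ) +
        ((-3089 : ℂ) / 60) * x ^ (2 : ℕ) * t ^ (15 : ℕ) + ((-1651 : ℂ) / 20) * x ^ (2 : ℕ) * t ^ (19 : ℕ) +
            ((967 : ℂ) / 20) * x ^ (3 : ℕ) * t ^ (5 : ℕ) +
        ((-7607 : ℂ) / 60) * x ^ (3 : ℕ) * t ^ (9 : ℕ) + ((1012 : ℂ) / 15) * x ^ (3 : ℕ) * t ^ (13 : ℕ) +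
            ((-196 : ℂ) / 15) * x ^ (3 : ℕ) * t ^ (17 : ℕ)) * h1 + (((769 : ℂ) / 30) * x ^ (4 : ℕ) * t ^ (5 : ℕ) +
            ((4489 : ℂ) / 30) * x ^ (4 : ℕ) * t ^ (9 : ℕ) + ((63 : ℂ) / 5) * x ^ (4 : ℕ) * t ^ (13 : ℕ) +
        ((169 : ℂ) / 10) * x ^ (4 : ℕ) * t ^ (17 : ℕ) + ((107 : ℂ) / 30) * x ^ (5 : ℕ) * t ^ (7 : ℕ) + ((-127 : ℂ) / 4) * x ^ (5 : ℕ) * t ^ (11 : ℕ) +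
        ((-955 : ℂ) / 6) * x ^ (5 : ℕ) * t ^ (15 : ℕ) + ((5323 : ℂ) / 30) * x ^ (5 : ℕ) * t ^ (19 : ℕ) +
            ((-227 : ℂ) / 60) * x ^ (6 : ℕ) * t ^ (5 : ℕ) +
        ((-881 : ℂ) / 6) * x ^ (6 : ℕ) * t ^ (9 : ℕ) + ((-1651 : ℂ) / 20) * x ^ (6 : ℕ) * t ^ (21 : ℕ) +
            ((148 : ℂ) / 15) * x ^ (7 : ℕ) * t ^ (7 : ℕ) +
        ((-1357 : ℂ) / 60) * x ^ (7 : ℕ) * t ^ (11 : ℕ)) * h2 + (((-1 : ℂ) / 2) * x ^ (3 : ℕ) * t ^ (4 : ℕ) +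
            ((83 : ℂ) / 12) * x ^ (3 : ℕ) * t ^ (8 : ℕ) + ((-241 : ℂ) / 12) * x ^ (3 : ℕ) * t ^ (12 : ℕ) +
        ((437 : ℂ) / 10) * x ^ (3 : ℕ) * t ^ (16 : ℕ) + ((-751 : ℂ) / 30) * x ^ (3 : ℕ) * t ^ (20 : ℕ) +
            ((523 : ℂ) / 60) * x ^ (4 : ℕ) * t ^ (6 : ℕ) +
        ((-827 : ℂ) / 20) * x ^ (4 : ℕ) * t ^ (10 : ℕ) + ((633 : ℂ) / 20) * x ^ (4 : ℕ) * t ^ (14 : ℕ) +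
            ((-329 : ℂ) / 60) * x ^ (4 : ℕ) * t ^ (18 : ℕ) +
        ((553 : ℂ) / 60) * x ^ (5 : ℕ) * t ^ (8 : ℕ) + ((-299 : ℂ) / 12) * x ^ (5 : ℕ) * t ^ (12 : ℕ) +
            ((1241 : ℂ) / 60) * x ^ (5 : ℕ) * t ^ (16 : ℕ) +
        ((-359 : ℂ) / 60) * x ^ (5 : ℕ) * t ^ (20 : ℕ) + ((1 : ℂ) / 2) * x ^ (6 : ℕ) * t ^ (10 : ℕ) + -(x ^ (6 : ℕ) * t ^ (14 : ℕ)) +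
        ((1 : ℂ) / 2) * x ^ (6 : ℕ) * t ^ (18 : ℕ)) * h3 + (((523 : ℂ) / 60) * x ^ (3 : ℕ) * t ^ (12 : ℕ) +
            ((-71 : ℂ) / 5) * x ^ (3 : ℕ) * t ^ (16 : ℕ) + ((359 : ℂ) / 60) * x ^ (3 : ℕ) * t ^ (20 : ℕ) +
        ((1 : ℂ) / 2) * x ^ (4 : ℕ) * t ^ (14 : ℕ) + ((-1 : ℂ) / 2) * x ^ (4 : ℕ) * t ^ (18 : ℕ)) * h4 +
            (((-719 : ℂ) / 20) * x ^ (4 : ℕ) * t ^ (17 : ℕ) + ((196 : ℂ) / 15) * x ^ (5 : ℕ) * t ^ (19 : ℕ) +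
            ((477 : ℂ) / 20) * x ^ (7 : ℕ) * t ^ (3 : ℕ) +
        ((-3877 : ℂ) / 60) * x ^ (7 : ℕ) * t ^ (7 : ℕ) + ((633 : ℂ) / 10) * x ^ (7 : ℕ) * t ^ (11 : ℕ) +
            ((-961 : ℂ) / 20) * x ^ (7 : ℕ) * t ^ (15 : ℕ) +
        ((381 : ℂ) / 20) * x ^ (7 : ℕ) * t ^ (19 : ℕ)) * h5 + ((-(x ^ (12 : ℕ)) + -(x ^ (12 : ℕ) * t * s) +
            -(x ^ (12 : ℕ) * t ^ (2 : ℕ) * s ^ (2 : ℕ)) + ((-1 : ℂ) / 2) * x ^ (12 : ℕ) * t ^ (4 : ℕ) +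
        ((-392 : ℂ) / 15) * x ^ (12 : ℕ) * t ^ (5 : ℕ) * s + ((-392 : ℂ) / 15) * x ^ (12 : ℕ) * t ^ (6 : ℕ) * s ^ (2 : ℕ) +
        ((-1123 : ℂ) / 60) * x ^ (12 : ℕ) * t ^ (8 : ℕ) + ((-3367 : ℂ) / 20) * x ^ (12 : ℕ) * t ^ (9 : ℕ) * s +
        ((-3367 : ℂ) / 20) * x ^ (12 : ℕ) * t ^ (10 : ℕ) * s ^ (2 : ℕ) + (-161 : ℂ) * x ^ (12 : ℕ) * t ^ (12 : ℕ) +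
        ((-868 : ℂ) / 5) * x ^ (12 : ℕ) * t ^ (13 : ℕ) * s + ((-868 : ℂ) / 5) * x ^ (12 : ℕ) * t ^ (14 : ℕ) * s ^ (2 : ℕ) +
        ((169 : ℂ) / 10) * x ^ (12 : ℕ) * t ^ (16 : ℕ) + ((667 : ℂ) / 20) * x ^ (13 : ℕ) * t ^ (6 : ℕ) +
            ((1787 : ℂ) / 60) * x ^ (13 : ℕ) * t ^ (7 : ℕ) * s +
        ((1787 : ℂ) / 60) * x ^ (13 : ℕ) * t ^ (8 : ℕ) * s ^ (2 : ℕ) + ((6313 : ℂ) / 60) * x ^ (13 : ℕ) * t ^ (10 : ℕ) +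
        ((4109 : ℂ) / 30) * x ^ (13 : ℕ) * t ^ (11 : ℕ) * s + ((4109 : ℂ) / 30) * x ^ (13 : ℕ) * t ^ (12 : ℕ) * s ^ (2 : ℕ) +
        ((1007 : ℂ) / 12) * x ^ (13 : ℕ) * t ^ (14 : ℕ) + ((2917 : ℂ) / 12) * x ^ (13 : ℕ) * t ^ (15 : ℕ) * s +
        ((2917 : ℂ) / 12) * x ^ (13 : ℕ) * t ^ (16 : ℕ) * s ^ (2 : ℕ) + ((5323 : ℂ) / 30) * x ^ (13 : ℕ) * t ^ (18 : ℕ) +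
        ((392 : ℂ) / 15) * x ^ (14 : ℕ) * t ^ (3 : ℕ) * s ^ (3 : ℕ) + ((7 : ℂ) / 2) * x ^ (14 : ℕ) * t ^ (4 : ℕ) +
        ((769 : ℂ) / 30) * x ^ (14 : ℕ) * t ^ (4 : ℕ) * s ^ (4 : ℕ) + ((437 : ℂ) / 60) * x ^ (14 : ℕ) * t ^ (5 : ℕ) * s +
        ((437 : ℂ) / 60) * x ^ (14 : ℕ) * t ^ (6 : ℕ) * s ^ (2 : ℕ) + ((8563 : ℂ) / 60) * x ^ (14 : ℕ) * t ^ (7 : ℕ) * s ^ (3 : ℕ) +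
        ((129 : ℂ) / 4) * x ^ (14 : ℕ) * t ^ (8 : ℕ) + ((4489 : ℂ) / 30) * x ^ (14 : ℕ) * t ^ (8 : ℕ) * s ^ (4 : ℕ) +
        ((2149 : ℂ) / 12) * x ^ (14 : ℕ) * t ^ (9 : ℕ) * s + ((2149 : ℂ) / 12) * x ^ (14 : ℕ) * t ^ (10 : ℕ) * s ^ (2 : ℕ) +
        ((719 : ℂ) / 30) * x ^ (14 : ℕ) * t ^ (11 : ℕ) * s ^ (3 : ℕ) + ((8557 : ℂ) / 20) * x ^ (14 : ℕ) * t ^ (12 : ℕ) +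
        ((63 : ℂ) / 5) * x ^ (14 : ℕ) * t ^ (12 : ℕ) * s ^ (4 : ℕ) + ((8557 : ℂ) / 20) * x ^ (14 : ℕ) * t ^ (13 : ℕ) * s +
        ((8557 : ℂ) / 20) * x ^ (14 : ℕ) * t ^ (14 : ℕ) * s ^ (2 : ℕ) + ((-63 : ℂ) / 5) * x ^ (14 : ℕ) * t ^ (15 : ℕ) * s ^ (3 : ℕ) +
        ((-1510 : ℂ) / 3) * x ^ (14 : ℕ) * t ^ (16 : ℕ) + ((169 : ℂ) / 10) * x ^ (14 : ℕ) * t ^ (16 : ℕ) * s ^ (4 : ℕ) +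
        ((-12943 : ℂ) / 30) * x ^ (14 : ℕ) * t ^ (17 : ℕ) * s + ((-12943 : ℂ) / 30) * x ^ (14 : ℕ) * t ^ (18 : ℕ) * s ^ (2 : ℕ) +
        ((381 : ℂ) / 20) * x ^ (14 : ℕ) * t ^ (19 : ℕ) * s ^ (3 : ℕ) + ((-1651 : ℂ) / 20) * x ^ (14 : ℕ) * t ^ (20 : ℕ) +
        ((-1 : ℂ) / 2) * x ^ (15 : ℕ) * t ^ (4 : ℕ) * s ^ (2 : ℕ) + ((-103 : ℂ) / 20) * x ^ (15 : ℕ) * t ^ (5 : ℕ) * s ^ (3 : ℕ) +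
        ((-8977 : ℂ) / 60) * x ^ (15 : ℕ) * t ^ (6 : ℕ) + ((107 : ℂ) / 30) * x ^ (15 : ℕ) * t ^ (6 : ℕ) * s ^ (4 : ℕ) +
        ((-9569 : ℂ) / 60) * x ^ (15 : ℕ) * t ^ (7 : ℕ) * s + ((-4577 : ℂ) / 30) * x ^ (15 : ℕ) * t ^ (8 : ℕ) * s ^ (2 : ℕ) +
        ((48 : ℂ) / 5) * x ^ (15 : ℕ) * t ^ (9 : ℕ) * s ^ (3 : ℕ) + ((-5771 : ℂ) / 20) * x ^ (15 : ℕ) * t ^ (10 : ℕ) +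
        ((-127 : ℂ) / 4) * x ^ (15 : ℕ) * t ^ (10 : ℕ) * s ^ (4 : ℕ) + ((-3989 : ℂ) / 15) * x ^ (15 : ℕ) * t ^ (11 : ℕ) * s +
        ((-17161 : ℂ) / 60) * x ^ (15 : ℕ) * t ^ (12 : ℕ) * s ^ (2 : ℕ) + ((-11479 : ℂ) / 60) * x ^ (15 : ℕ) * t ^ (13 : ℕ) * s ^ (3 : ℕ) +
        ((-6857 : ℂ) / 60) * x ^ (15 : ℕ) * t ^ (14 : ℕ) + ((-955 : ℂ) / 6) * x ^ (15 : ℕ) * t ^ (14 : ℕ) * s ^ (4 : ℕ) +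
        ((-6857 : ℂ) / 60) * x ^ (15 : ℕ) * t ^ (15 : ℕ) * s + ((-847 : ℂ) / 12) * x ^ (15 : ℕ) * t ^ (16 : ℕ) * s ^ (2 : ℕ) +
        ((2201 : ℂ) / 12) * x ^ (15 : ℕ) * t ^ (17 : ℕ) * s ^ (3 : ℕ) + ((3244 : ℂ) / 15) * x ^ (15 : ℕ) * t ^ (18 : ℕ) +
        ((5323 : ℂ) / 30) * x ^ (15 : ℕ) * t ^ (18 : ℕ) * s ^ (4 : ℕ) + ((2852 : ℂ) / 15) * x ^ (15 : ℕ) * t ^ (19 : ℕ) * s +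
        ((1651 : ℂ) / 10) * x ^ (15 : ℕ) * t ^ (20 : ℕ) * s ^ (2 : ℕ) + ((-197 : ℂ) / 60) * x ^ (16 : ℕ) * t ^ (3 : ℕ) * s ^ (3 : ℕ) +
        ((829 : ℂ) / 30) * x ^ (16 : ℕ) * t ^ (4 : ℕ) + ((-227 : ℂ) / 60) * x ^ (16 : ℕ) * t ^ (4 : ℕ) * s ^ (4 : ℕ) +
        ((829 : ℂ) / 30) * x ^ (16 : ℕ) * t ^ (5 : ℕ) * s + ((727 : ℂ) / 20) * x ^ (16 : ℕ) * t ^ (6 : ℕ) * s ^ (2 : ℕ) +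
        ((-4889 : ℂ) / 30) * x ^ (16 : ℕ) * t ^ (7 : ℕ) * s ^ (3 : ℕ) + ((1363 : ℂ) / 10) * x ^ (16 : ℕ) * t ^ (8 : ℕ) +
        ((-881 : ℂ) / 6) * x ^ (16 : ℕ) * t ^ (8 : ℕ) * s ^ (4 : ℕ) + ((1363 : ℂ) / 10) * x ^ (16 : ℕ) * t ^ (9 : ℕ) * s +
        ((1899 : ℂ) / 20) * x ^ (16 : ℕ) * t ^ (10 : ℕ) * s ^ (2 : ℕ) + ((2177 : ℂ) / 60) * x ^ (16 : ℕ) * t ^ (11 : ℕ) * s ^ (3 : ℕ) +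
        ((177 : ℂ) / 10) * x ^ (16 : ℕ) * t ^ (12 : ℕ) + ((177 : ℂ) / 10) * x ^ (16 : ℕ) * t ^ (13 : ℕ) * s +
        ((987 : ℂ) / 20) * x ^ (16 : ℕ) * t ^ (14 : ℕ) * s ^ (2 : ℕ) + ((-3011 : ℂ) / 60) * x ^ (16 : ℕ) * t ^ (15 : ℕ) * s ^ (3 : ℕ) +
        ((172 : ℂ) / 15) * x ^ (16 : ℕ) * t ^ (16 : ℕ) + ((172 : ℂ) / 15) * x ^ (16 : ℕ) * t ^ (17 : ℕ) * s +
        ((359 : ℂ) / 60) * x ^ (16 : ℕ) * t ^ (18 : ℕ) * s ^ (2 : ℕ) + ((-3451 : ℂ) / 60) * x ^ (16 : ℕ) * t ^ (19 : ℕ) * s ^ (3 : ℕ) +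
        ((-1651 : ℂ) / 20) * x ^ (16 : ℕ) * t ^ (20 : ℕ) * s ^ (4 : ℕ) + ((-477 : ℂ) / 10) * x ^ (17 : ℕ) * t ^ (3 : ℕ) * s +
        ((-236 : ℂ) / 5) * x ^ (17 : ℕ) * t ^ (4 : ℕ) * s ^ (2 : ℕ) + ((23 : ℂ) / 20) * x ^ (17 : ℕ) * t ^ (5 : ℕ) * s ^ (3 : ℕ) +
        ((809 : ℂ) / 60) * x ^ (17 : ℕ) * t ^ (6 : ℕ) + ((148 : ℂ) / 15) * x ^ (17 : ℕ) * t ^ (6 : ℕ) * s ^ (4 : ℕ) +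
        ((8563 : ℂ) / 60) * x ^ (17 : ℕ) * t ^ (7 : ℕ) * s + ((8701 : ℂ) / 60) * x ^ (17 : ℕ) * t ^ (8 : ℕ) * s ^ (2 : ℕ) +
        ((547 : ℂ) / 30) * x ^ (17 : ℕ) * t ^ (9 : ℕ) * s ^ (3 : ℕ) + ((241 : ℂ) / 10) * x ^ (17 : ℕ) * t ^ (10 : ℕ) +
        ((-1357 : ℂ) / 60) * x ^ (17 : ℕ) * t ^ (10 : ℕ) * s ^ (4 : ℕ) + ((-205 : ℂ) / 2) * x ^ (17 : ℕ) * t ^ (11 : ℕ) * s +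
        ((-5917 : ℂ) / 60) * x ^ (17 : ℕ) * t ^ (12 : ℕ) * s ^ (2 : ℕ) + ((-623 : ℂ) / 20) * x ^ (17 : ℕ) * t ^ (13 : ℕ) * s ^ (3 : ℕ) +
        ((-121 : ℂ) / 3) * x ^ (17 : ℕ) * t ^ (14 : ℕ) + ((1673 : ℂ) / 30) * x ^ (17 : ℕ) * t ^ (15 : ℕ) * s +
        ((371 : ℂ) / 20) * x ^ (17 : ℕ) * t ^ (16 : ℕ) * s ^ (2 : ℕ) + ((329 : ℂ) / 60) * x ^ (17 : ℕ) * t ^ (17 : ℕ) * s ^ (3 : ℕ) +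
        ((196 : ℂ) / 15) * x ^ (17 : ℕ) * t ^ (18 : ℕ) + ((-751 : ℂ) / 30) * x ^ (17 : ℕ) * t ^ (19 : ℕ) * s +
            ((-1 : ℂ) / 2) * x ^ (18 : ℕ) * t ^ (4 : ℕ) +
        ((-1 : ℂ) / 2) * x ^ (18 : ℕ) * t ^ (5 : ℕ) * s + ((-553 : ℂ) / 60) * x ^ (18 : ℕ) * t ^ (6 : ℕ) * s ^ (2 : ℕ) +
        ((-553 : ℂ) / 60) * x ^ (18 : ℕ) * t ^ (7 : ℕ) * s ^ (3 : ℕ) + ((-493 : ℂ) / 60) * x ^ (18 : ℕ) * t ^ (8 : ℕ) +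
        ((-493 : ℂ) / 60) * x ^ (18 : ℕ) * t ^ (9 : ℕ) * s + ((1009 : ℂ) / 30) * x ^ (18 : ℕ) * t ^ (10 : ℕ) * s ^ (2 : ℕ) +
        ((1009 : ℂ) / 30) * x ^ (18 : ℕ) * t ^ (11 : ℕ) * s ^ (3 : ℕ) + ((-41 : ℂ) / 15) * x ^ (18 : ℕ) * t ^ (12 : ℕ) +
        ((-41 : ℂ) / 15) * x ^ (18 : ℕ) * t ^ (13 : ℕ) * s + ((-2093 : ℂ) / 60) * x ^ (18 : ℕ) * t ^ (14 : ℕ) * s ^ (2 : ℕ) +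
        ((-2093 : ℂ) / 60) * x ^ (18 : ℕ) * t ^ (15 : ℕ) * s ^ (3 : ℕ) + ((389 : ℂ) / 60) * x ^ (18 : ℕ) * t ^ (16 : ℕ) +
        ((389 : ℂ) / 60) * x ^ (18 : ℕ) * t ^ (17 : ℕ) * s + ((359 : ℂ) / 30) * x ^ (18 : ℕ) * t ^ (18 : ℕ) * s ^ (2 : ℕ) +
        ((359 : ℂ) / 30) * x ^ (18 : ℕ) * t ^ (19 : ℕ) * s ^ (3 : ℕ) + ((523 : ℂ) / 60) * x ^ (19 : ℕ) * t ^ (6 : ℕ) +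
        ((523 : ℂ) / 60) * x ^ (19 : ℕ) * t ^ (7 : ℕ) * s + ((-1 : ℂ) / 2) * x ^ (19 : ℕ) * t ^ (8 : ℕ) * s ^ (2 : ℕ) +
        ((-1 : ℂ) / 2) * x ^ (19 : ℕ) * t ^ (9 : ℕ) * s ^ (3 : ℕ) + ((-482 : ℂ) / 15) * x ^ (19 : ℕ) * t ^ (10 : ℕ) +
        ((-482 : ℂ) / 15) * x ^ (19 : ℕ) * t ^ (11 : ℕ) * s + ((3 : ℂ) / 2) * x ^ (19 : ℕ) * t ^ (12 : ℕ) * s ^ (2 : ℕ) +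
        ((3 : ℂ) / 2) * x ^ (19 : ℕ) * t ^ (13 : ℕ) * s ^ (3 : ℕ) + ((2033 : ℂ) / 60) * x ^ (19 : ℕ) * t ^ (14 : ℕ) +
        ((2033 : ℂ) / 60) * x ^ (19 : ℕ) * t ^ (15 : ℕ) * s + -(x ^ (19 : ℕ) * t ^ (16 : ℕ) * s ^ (2 : ℕ)) +
            -(x ^ (19 : ℕ) * t ^ (17 : ℕ) * s ^ (3 : ℕ)) +
        ((-359 : ℂ) / 30) * x ^ (19 : ℕ) * t ^ (18 : ℕ) + ((-359 : ℂ) / 30) * x ^ (19 : ℕ) * t ^ (19 : ℕ) * s +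
            ((553 : ℂ) / 60) * x ^ (20 : ℕ) * t ^ (8 : ℕ) +
        ((553 : ℂ) / 60) * x ^ (20 : ℕ) * t ^ (9 : ℕ) * s + ((523 : ℂ) / 60) * x ^ (20 : ℕ) * t ^ (10 : ℕ) * s ^ (2 : ℕ) +
        ((523 : ℂ) / 60) * x ^ (20 : ℕ) * t ^ (11 : ℕ) * s ^ (3 : ℕ) + ((-157 : ℂ) / 10) * x ^ (20 : ℕ) * t ^ (12 : ℕ) +
        ((-157 : ℂ) / 10) * x ^ (20 : ℕ) * t ^ (13 : ℕ) * s + ((-71 : ℂ) / 5) * x ^ (20 : ℕ) * t ^ (14 : ℕ) * s ^ (2 : ℕ) +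
        ((-71 : ℂ) / 5) * x ^ (20 : ℕ) * t ^ (15 : ℕ) * s ^ (3 : ℕ) + ((419 : ℂ) / 60) * x ^ (20 : ℕ) * t ^ (16 : ℕ) +
        ((419 : ℂ) / 60) * x ^ (20 : ℕ) * t ^ (17 : ℕ) * s + ((359 : ℂ) / 60) * x ^ (20 : ℕ) * t ^ (18 : ℕ) * s ^ (2 : ℕ) +
        ((359 : ℂ) / 60) * x ^ (20 : ℕ) * t ^ (19 : ℕ) * s ^ (3 : ℕ) + ((1 : ℂ) / 2) * x ^ (21 : ℕ) * t ^ (10 : ℕ) +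
        ((1 : ℂ) / 2) * x ^ (21 : ℕ) * t ^ (11 : ℕ) * s + ((1 : ℂ) / 2) * x ^ (21 : ℕ) * t ^ (12 : ℕ) * s ^ (2 : ℕ) +
        ((1 : ℂ) / 2) * x ^ (21 : ℕ) * t ^ (13 : ℕ) * s ^ (3 : ℕ) + ((-1 : ℂ) / 2) * x ^ (21 : ℕ) * t ^ (14 : ℕ) +
        ((-1 : ℂ) / 2) * x ^ (21 : ℕ) * t ^ (15 : ℕ) * s + ((-1 : ℂ) / 2) * x ^ (21 : ℕ) * t ^ (16 : ℕ) * s ^ (2 : ℕ) +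
        ((-1 : ℂ) / 2) * x ^ (21 : ℕ) * t ^ (17 : ℕ) * s ^ (3 : ℕ)) * U) * hs

/-- **Algebraic core.** For `x ≠ 0`, `t ≠ 0` in `ℂ`, the twenty-two exact domino relations of the instances force `c = 0`. [folklore] -/
private theorem core {x t : ℂ} (hx : x ≠ 0) (ht : t ≠ 0) {c0 c1 c2 c3 c4 c5 c6 : ℂ}
    (e_DP0_0_1 : c0 * (x ^ (2 : ℕ) * t) + c1 * (x) + c2 * (x ^ (2 : ℕ) * t⁻¹) + c3 * (x ^ (2 : ℕ)) + c4 * (x ^ (3 : ℕ) * t) +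
        c5 * (x ^ (3 : ℕ) * t ^ (2 : ℕ)) +
      c6 * (x ^ (3 : ℕ)) = 0)
    (e_DP0_1_m1 : c0 * (x ^ (2 : ℕ) * t) + c1 * (x ^ (3 : ℕ)) + c2 * (x ^ (3 : ℕ) * t) + c3 * (x ^ (3 : ℕ) * t ^ (2 : ℕ)) + c4 * (x ^ (2 : ℕ) * t⁻¹) +
      c5 * (x ^ (2 : ℕ)) + c6 * (x) = 0)
    (e_DP0_m1_0 : c0 * (x ^ (2 : ℕ)) + c1 * (x ^ (2 : ℕ) * t) + c2 * (x) + c3 * (x ^ (2 : ℕ) * t⁻¹) + c4 * (x ^ (3 : ℕ)) + c5 * (x ^ (3 : ℕ) * t) +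
      c6 * (x ^ (3 : ℕ) * t⁻¹) = 0)
    (e_DP0_2_0 : c0 * (x ^ (2 : ℕ)) + c1 * (x ^ (3 : ℕ) * t⁻¹) + c2 * (x ^ (3 : ℕ)) + c3 * (x ^ (3 : ℕ) * t) + c4 * (x) + c5 * (x ^ (2 : ℕ) * t⁻¹) +
      c6 * (x ^ (2 : ℕ) * t) = 0)
    (e_DP0_0_m1 : c0 * (x ^ (2 : ℕ) * t⁻¹) + c1 * (x ^ (2 : ℕ)) + c2 * (x ^ (2 : ℕ) * t) + c3 * (x) + c4 * (x ^ (3 : ℕ) * t⁻¹) + c5 * (x ^ (3 : ℕ)) +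
      c6 * (x ^ (3 : ℕ) * t⁻¹ ^ (2 : ℕ)) = 0)
    (e_DP0_1_1 : c0 * (x ^ (2 : ℕ) * t⁻¹) + c1 * (x ^ (3 : ℕ) * t⁻¹ ^ (2 : ℕ)) + c2 * (x ^ (3 : ℕ) * t⁻¹) + c3 * (x ^ (3 : ℕ)) +
        c4 * (x ^ (2 : ℕ) * t) + c5 * (x) +
      c6 * (x ^ (2 : ℕ)) = 0)
    (e_DPa_1_m1 : c0 * (x ^ (2 : ℕ) * t + x ^ (5 : ℕ) * t ^ (3 : ℕ)) + c1 * (x ^ (3 : ℕ) + x ^ (4 : ℕ) * t ^ (2 : ℕ)) + c2 * (x ^ (3 : ℕ) * t +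
        x ^ (5 : ℕ) * t) +
      c3 * (x ^ (3 : ℕ) * t ^ (2 : ℕ) + x ^ (5 : ℕ) * t ^ (2 : ℕ)) + c4 * (x ^ (2 : ℕ) * t⁻¹) + c5 * (x ^ (2 : ℕ) + x ^ (5 : ℕ) * t⁻¹ ^ (2 : ℕ)) +
          c6 * (x) = 0)
    (e_DPb_0_1 : c0 * (x ^ (2 : ℕ) * t + x ^ (5 : ℕ) * t ^ (3 : ℕ)) + c1 * (x) + c2 * (x ^ (2 : ℕ) * t⁻¹) + c3 * (x ^ (2 : ℕ) +
        x ^ (5 : ℕ) * t⁻¹ ^ (2 : ℕ)) +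
      c4 * (x ^ (3 : ℕ) * t + x ^ (5 : ℕ) * t) + c5 * (x ^ (3 : ℕ) * t ^ (2 : ℕ) + x ^ (5 : ℕ) * t ^ (2 : ℕ)) + c6 * (x ^ (3 : ℕ) +
      x ^ (4 : ℕ) * t ^ (2 : ℕ)) = 0)
    (e_DPa_m1_0 : c0 * (x ^ (2 : ℕ) + x ^ (5 : ℕ) * t⁻¹ ^ (2 : ℕ)) + c1 * (x ^ (2 : ℕ) * t + x ^ (5 : ℕ) * t ^ (3 : ℕ)) + c2 * (x) +
        c3 * (x ^ (2 : ℕ) * t⁻¹) +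
      c4 * (x ^ (3 : ℕ) + x ^ (5 : ℕ)) + c5 * (x ^ (3 : ℕ) * t + x ^ (4 : ℕ) * t⁻¹) + c6 * (x ^ (3 : ℕ) * t⁻¹ + x ^ (5 : ℕ) * t⁻¹) = 0)
    (e_DPb_2_0 : c0 * (x ^ (2 : ℕ) + x ^ (5 : ℕ) * t⁻¹ ^ (2 : ℕ)) + c1 * (x ^ (3 : ℕ) * t⁻¹ + x ^ (5 : ℕ) * t⁻¹) + c2 * (x ^ (3 : ℕ) + x ^ (5 : ℕ)) +
      c3 * (x ^ (3 : ℕ) * t + x ^ (4 : ℕ) * t⁻¹) + c4 * (x) + c5 * (x ^ (2 : ℕ) * t⁻¹) + c6 * (x ^ (2 : ℕ) * t + x ^ (5 : ℕ) * t ^ (3 : ℕ)) = 0)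
    (e_DPa_2_0 : c0 * (x ^ (2 : ℕ) + x ^ (5 : ℕ) * t ^ (2 : ℕ)) + c1 * (x ^ (3 : ℕ) * t⁻¹ + x ^ (4 : ℕ) * t) + c2 * (x ^ (3 : ℕ) + x ^ (5 : ℕ)) +
        c3 * (x ^ (3 : ℕ) * t +
      x ^ (5 : ℕ) * t) + c4 * (x) + c5 * (x ^ (2 : ℕ) * t⁻¹ + x ^ (5 : ℕ) * t⁻¹ ^ (3 : ℕ)) + c6 * (x ^ (2 : ℕ) * t) = 0)
    (e_DPb_m1_0 : c0 * (x ^ (2 : ℕ) + x ^ (5 : ℕ) * t ^ (2 : ℕ)) + c1 * (x ^ (2 : ℕ) * t) + c2 * (x) + c3 * (x ^ (2 : ℕ) * t⁻¹ +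
        x ^ (5 : ℕ) * t⁻¹ ^ (3 : ℕ)) +
      c4 * (x ^ (3 : ℕ) + x ^ (5 : ℕ)) + c5 * (x ^ (3 : ℕ) * t + x ^ (5 : ℕ) * t) + c6 * (x ^ (3 : ℕ) * t⁻¹ + x ^ (4 : ℕ) * t) = 0)
    (e_DPab_m1_0 : c0 * (x ^ (2 : ℕ) + x ^ (5 : ℕ) * t⁻¹ ^ (2 : ℕ) + x ^ (5 : ℕ) * t ^ (2 : ℕ)) + c1 * (x ^ (2 : ℕ) * t + x ^ (5 : ℕ) * t ^ (3 : ℕ) +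
      x ^ (7 : ℕ) * t ^ (3 : ℕ)) + c2 * (x) + c3 * (x ^ (2 : ℕ) * t⁻¹ + x ^ (5 : ℕ) * t⁻¹ ^ (3 : ℕ) + x ^ (7 : ℕ) * t⁻¹ ^ (3 : ℕ)) +
          c4 * (x ^ (3 : ℕ) +
      (2 : ℂ) * x ^ (5 : ℕ)) + c5 * (x ^ (3 : ℕ) * t + x ^ (4 : ℕ) * t⁻¹ + x ^ (5 : ℕ) * t) + c6 * (x ^ (3 : ℕ) * t⁻¹ + x ^ (4 : ℕ) * t +
          x ^ (5 : ℕ) * t⁻¹) = 0)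
    (e_DPab_2_0 : c0 * (x ^ (2 : ℕ) + x ^ (5 : ℕ) * t⁻¹ ^ (2 : ℕ) + x ^ (5 : ℕ) * t ^ (2 : ℕ)) + c1 * (x ^ (3 : ℕ) * t⁻¹ + x ^ (4 : ℕ) * t +
        x ^ (5 : ℕ) * t⁻¹) +
      c2 * (x ^ (3 : ℕ) + (2 : ℂ) * x ^ (5 : ℕ)) + c3 * (x ^ (3 : ℕ) * t + x ^ (4 : ℕ) * t⁻¹ + x ^ (5 : ℕ) * t) + c4 * (x) + c5 * (x ^ (2 : ℕ) * t⁻¹ +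
      x ^ (5 : ℕ) * t⁻¹ ^ (3 : ℕ) + x ^ (7 : ℕ) * t⁻¹ ^ (3 : ℕ)) + c6 * (x ^ (2 : ℕ) * t + x ^ (5 : ℕ) * t ^ (3 : ℕ) + x ^ (7 : ℕ) * t ^ (3 : ℕ)) = 0)
    (e_DPnw_2_0 : c0 * (x ^ (2 : ℕ)) + c1 * (x ^ (3 : ℕ) * t⁻¹ + x ^ (6 : ℕ) * t⁻¹ ^ (3 : ℕ)) + c2 * (x ^ (3 : ℕ) + x ^ (6 : ℕ) * t ^ (2 : ℕ)) +
        c3 * (x ^ (3 : ℕ) * t) +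
      c4 * (x) + c5 * (x ^ (2 : ℕ) * t⁻¹) + c6 * (x ^ (2 : ℕ) * t) = 0)
    (e_DPse_m1_0 : c0 * (x ^ (2 : ℕ)) + c1 * (x ^ (2 : ℕ) * t) + c2 * (x) + c3 * (x ^ (2 : ℕ) * t⁻¹) + c4 * (x ^ (3 : ℕ) +
        x ^ (6 : ℕ) * t ^ (2 : ℕ)) +
      c5 * (x ^ (3 : ℕ) * t) + c6 * (x ^ (3 : ℕ) * t⁻¹ + x ^ (6 : ℕ) * t⁻¹ ^ (3 : ℕ)) = 0)
    (e_DPnw_1_m1 : c0 * (x ^ (2 : ℕ) * t) + c1 * (x ^ (3 : ℕ) + x ^ (6 : ℕ) * t⁻¹ ^ (2 : ℕ)) + c2 * (x ^ (3 : ℕ) * t + x ^ (6 : ℕ) * t ^ (3 : ℕ)) +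
      c3 * (x ^ (3 : ℕ) * t ^ (2 : ℕ)) + c4 * (x ^ (2 : ℕ) * t⁻¹) + c5 * (x ^ (2 : ℕ)) + c6 * (x) = 0)
    (e_DPse_0_1 : c0 * (x ^ (2 : ℕ) * t) + c1 * (x) + c2 * (x ^ (2 : ℕ) * t⁻¹) + c3 * (x ^ (2 : ℕ)) + c4 * (x ^ (3 : ℕ) * t +
        x ^ (6 : ℕ) * t ^ (3 : ℕ)) +
      c5 * (x ^ (3 : ℕ) * t ^ (2 : ℕ)) + c6 * (x ^ (3 : ℕ) + x ^ (6 : ℕ) * t⁻¹ ^ (2 : ℕ)) = 0)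
    (e_DPne_m1_0 : c0 * (x ^ (2 : ℕ)) + c1 * (x ^ (2 : ℕ) * t) + c2 * (x) + c3 * (x ^ (2 : ℕ) * t⁻¹) + c4 * (x ^ (3 : ℕ) +
        x ^ (6 : ℕ) * t⁻¹ ^ (2 : ℕ)) +
      c5 * (x ^ (3 : ℕ) * t + x ^ (6 : ℕ) * t ^ (3 : ℕ)) + c6 * (x ^ (3 : ℕ) * t⁻¹) = 0)
    (e_DPsw_2_0 : c0 * (x ^ (2 : ℕ)) + c1 * (x ^ (3 : ℕ) * t⁻¹) + c2 * (x ^ (3 : ℕ) + x ^ (6 : ℕ) * t⁻¹ ^ (2 : ℕ)) + c3 * (x ^ (3 : ℕ) * t +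
        x ^ (6 : ℕ) * t ^ (3 : ℕ)) +
      c4 * (x) + c5 * (x ^ (2 : ℕ) * t⁻¹) + c6 * (x ^ (2 : ℕ) * t) = 0)
    (e_DPne_0_1 : c0 * (x ^ (2 : ℕ) * t) + c1 * (x) + c2 * (x ^ (2 : ℕ) * t⁻¹) + c3 * (x ^ (2 : ℕ)) + c4 * (x ^ (3 : ℕ) * t + x ^ (6 : ℕ) * t⁻¹) +
      c5 * (x ^ (3 : ℕ) * t ^ (2 : ℕ) + x ^ (6 : ℕ) * t ^ (4 : ℕ)) + c6 * (x ^ (3 : ℕ)) = 0)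
    (e_DPsw_1_m1 : c0 * (x ^ (2 : ℕ) * t) + c1 * (x ^ (3 : ℕ)) + c2 * (x ^ (3 : ℕ) * t + x ^ (6 : ℕ) * t⁻¹) + c3 * (x ^ (3 : ℕ) * t ^ (2 : ℕ) +
      x ^ (6 : ℕ) * t ^ (4 : ℕ)) + c4 * (x ^ (2 : ℕ) * t⁻¹) + c5 * (x ^ (2 : ℕ)) + c6 * (x) = 0)
    : c0 = 0 ∧ c1 = 0 ∧ c2 = 0 ∧ c3 = 0 ∧ c4 = 0 ∧ c5 = 0 ∧ c6 = 0 := by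
  have hs : t * t⁻¹ = 1 := mul_inv_cancel₀ ht
  generalize t⁻¹ = s at hs e_DP0_0_1 e_DP0_1_m1 e_DP0_m1_0 e_DP0_2_0 e_DP0_0_m1 e_DP0_1_1 e_DPa_1_m1 e_DPb_0_1 e_DPa_m1_0 e_DPb_2_0 e_DPa_2_0 e_DPb_m1_0 e_DPab_m1_0 e_DPab_2_0 e_DPnw_2_0 e_DPse_m1_0 e_DPnw_1_m1 e_DPse_0_1 e_DPne_m1_0 e_DPsw_2_0 e_DPne_0_1 e_DPsw_1_m1
  have s_DP0_0_1 : (x ^ (2 : ℕ) * t) * (c0 + c0) + (x + x ^ (3 : ℕ)) * (c1 + c6) + (x ^ (2 : ℕ) * s + x ^ (3 : ℕ) * t) * (c2 + c4) + (x ^ (2 : ℕ) +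
      x ^ (3 : ℕ) * t ^ (2 : ℕ)) * (c3 + c5) = 0 := by
    linear_combination e_DP0_0_1 + e_DP0_1_m1
  have a_DP0_0_1 : (x + -(x ^ (3 : ℕ))) * (c1 - c6) + (x ^ (2 : ℕ) * s + -(x ^ (3 : ℕ) * t)) * (c2 - c4) + (x ^ (2 : ℕ) +
      -(x ^ (3 : ℕ) * t ^ (2 : ℕ))) * (c3 - c5) = 0 := by
    linear_combination e_DP0_0_1 - e_DP0_1_m1
  have s_DP0_m1_0 : (x ^ (2 : ℕ)) * (c0 + c0) + (x ^ (2 : ℕ) * t + x ^ (3 : ℕ) * s) * (c1 + c6) + (x + x ^ (3 : ℕ)) * (c2 + c4) + (x ^ (2 : ℕ) * s +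
      x ^ (3 : ℕ) * t) * (c3 + c5) = 0 := by
    linear_combination e_DP0_m1_0 + e_DP0_2_0
  have a_DP0_m1_0 : (x ^ (2 : ℕ) * t + -(x ^ (3 : ℕ) * s)) * (c1 - c6) + (x + -(x ^ (3 : ℕ))) * (c2 - c4) + (x ^ (2 : ℕ) * s +
      -(x ^ (3 : ℕ) * t)) * (c3 - c5) = 0 := by
    linear_combination e_DP0_m1_0 - e_DP0_2_0
  have s_DP0_0_m1 : (x ^ (2 : ℕ) * s) * (c0 + c0) + (x ^ (2 : ℕ) + x ^ (3 : ℕ) * s ^ (2 : ℕ)) * (c1 + c6) + (x ^ (2 : ℕ) * t + x ^ (3 : ℕ) * s) * (c2 +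
      c4) + (x +
      x ^ (3 : ℕ)) * (c3 + c5) = 0 := by
    linear_combination e_DP0_0_m1 + e_DP0_1_1
  have a_DP0_0_m1 : (x ^ (2 : ℕ) + -(x ^ (3 : ℕ) * s ^ (2 : ℕ))) * (c1 - c6) + (x ^ (2 : ℕ) * t + -(x ^ (3 : ℕ) * s)) * (c2 - c4) + (x +
      -(x ^ (3 : ℕ))) * (c3 - c5) = 0 := by
    linear_combination e_DP0_0_m1 - e_DP0_1_1
  have s_DPa_1_m1 : (x ^ (2 : ℕ) * t + x ^ (5 : ℕ) * t ^ (3 : ℕ)) * (c0 + c0) + (x + x ^ (3 : ℕ) + x ^ (4 : ℕ) * t ^ (2 : ℕ)) * (c1 + c6) +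
      (x ^ (2 : ℕ) * s +
      x ^ (3 : ℕ) * t + x ^ (5 : ℕ) * t) * (c2 + c4) + (x ^ (2 : ℕ) + x ^ (3 : ℕ) * t ^ (2 : ℕ) + x ^ (5 : ℕ) * s ^ (2 : ℕ) +
      x ^ (5 : ℕ) * t ^ (2 : ℕ)) * (c3 + c5) = 0 := by
    linear_combination e_DPa_1_m1 + e_DPb_0_1
  have a_DPa_1_m1 : (-(x) + x ^ (3 : ℕ) + x ^ (4 : ℕ) * t ^ (2 : ℕ)) * (c1 - c6) + (-(x ^ (2 : ℕ) * s) + x ^ (3 : ℕ) * t +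
      x ^ (5 : ℕ) * t) * (c2 - c4) + (-(x ^ (2 : ℕ)) +
      x ^ (3 : ℕ) * t ^ (2 : ℕ) + -(x ^ (5 : ℕ) * s ^ (2 : ℕ)) + x ^ (5 : ℕ) * t ^ (2 : ℕ)) * (c3 - c5) = 0 := by
    linear_combination e_DPa_1_m1 - e_DPb_0_1
  have s_DPa_m1_0 : (x ^ (2 : ℕ) + x ^ (5 : ℕ) * s ^ (2 : ℕ)) * (c0 + c0) + (x ^ (2 : ℕ) * t + x ^ (3 : ℕ) * s + x ^ (5 : ℕ) * s +
      x ^ (5 : ℕ) * t ^ (3 : ℕ)) * (c1 + c6) +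
      (x + x ^ (3 : ℕ) + x ^ (5 : ℕ)) * (c2 + c4) + (x ^ (2 : ℕ) * s + x ^ (3 : ℕ) * t + x ^ (4 : ℕ) * s) * (c3 + c5) = 0 := by
    linear_combination e_DPa_m1_0 + e_DPb_2_0
  have a_DPa_m1_0 : (x ^ (2 : ℕ) * t + -(x ^ (3 : ℕ) * s) + -(x ^ (5 : ℕ) * s) + x ^ (5 : ℕ) * t ^ (3 : ℕ)) * (c1 - c6) + (x + -(x ^ (3 : ℕ)) +
      -(x ^ (5 : ℕ))) * (c2 - c4) + (x ^ (2 : ℕ) * s + -(x ^ (3 : ℕ) * t) + -(x ^ (4 : ℕ) * s)) * (c3 - c5) = 0 := by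
    linear_combination e_DPa_m1_0 - e_DPb_2_0
  have s_DPa_2_0 : (x ^ (2 : ℕ) + x ^ (5 : ℕ) * t ^ (2 : ℕ)) * (c0 + c0) + (x ^ (2 : ℕ) * t + x ^ (3 : ℕ) * s + x ^ (4 : ℕ) * t) * (c1 + c6) + (x +
      x ^ (3 : ℕ) +
      x ^ (5 : ℕ)) * (c2 + c4) + (x ^ (2 : ℕ) * s + x ^ (3 : ℕ) * t + x ^ (5 : ℕ) * s ^ (3 : ℕ) + x ^ (5 : ℕ) * t) * (c3 + c5) = 0 := by
    linear_combination e_DPa_2_0 + e_DPb_m1_0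
  have a_DPa_2_0 : (-(x ^ (2 : ℕ) * t) + x ^ (3 : ℕ) * s + x ^ (4 : ℕ) * t) * (c1 - c6) + (-(x) + x ^ (3 : ℕ) + x ^ (5 : ℕ)) * (c2 - c4) +
      (-(x ^ (2 : ℕ) * s) +
      x ^ (3 : ℕ) * t + -(x ^ (5 : ℕ) * s ^ (3 : ℕ)) + x ^ (5 : ℕ) * t) * (c3 - c5) = 0 := by
    linear_combination e_DPa_2_0 - e_DPb_m1_0
  have s_DPab_m1_0 : (x ^ (2 : ℕ) + x ^ (5 : ℕ) * s ^ (2 : ℕ) + x ^ (5 : ℕ) * t ^ (2 : ℕ)) * (c0 + c0) + (x ^ (2 : ℕ) * t + x ^ (3 : ℕ) * s +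
      x ^ (4 : ℕ) * t +
      x ^ (5 : ℕ) * s + x ^ (5 : ℕ) * t ^ (3 : ℕ) + x ^ (7 : ℕ) * t ^ (3 : ℕ)) * (c1 + c6) + (x + x ^ (3 : ℕ) + (2 : ℂ) * x ^ (5 : ℕ)) * (c2 + c4) +
      (x ^ (2 : ℕ) * s + x ^ (3 : ℕ) * t + x ^ (4 : ℕ) * s + x ^ (5 : ℕ) * s ^ (3 : ℕ) + x ^ (5 : ℕ) * t + x ^ (7 : ℕ) * s ^ (3 : ℕ)) * (c3 +
          c5) = 0 := by
    linear_combination e_DPab_m1_0 + e_DPab_2_0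
  have a_DPab_m1_0 : (x ^ (2 : ℕ) * t + -(x ^ (3 : ℕ) * s) + -(x ^ (4 : ℕ) * t) + -(x ^ (5 : ℕ) * s) + x ^ (5 : ℕ) * t ^ (3 : ℕ) +
      x ^ (7 : ℕ) * t ^ (3 : ℕ)) * (c1 - c6) +
      (x + -(x ^ (3 : ℕ)) + (-2 : ℂ) * x ^ (5 : ℕ)) * (c2 - c4) + (x ^ (2 : ℕ) * s + -(x ^ (3 : ℕ) * t) + -(x ^ (4 : ℕ) * s) +
          x ^ (5 : ℕ) * s ^ (3 : ℕ) +
      -(x ^ (5 : ℕ) * t) + x ^ (7 : ℕ) * s ^ (3 : ℕ)) * (c3 - c5) = 0 := by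
    linear_combination e_DPab_m1_0 - e_DPab_2_0
  have s_DPnw_2_0 : (x ^ (2 : ℕ)) * (c0 + c0) + (x ^ (2 : ℕ) * t + x ^ (3 : ℕ) * s + x ^ (6 : ℕ) * s ^ (3 : ℕ)) * (c1 + c6) + (x + x ^ (3 : ℕ) +
      x ^ (6 : ℕ) * t ^ (2 : ℕ)) * (c2 + c4) + (x ^ (2 : ℕ) * s + x ^ (3 : ℕ) * t) * (c3 + c5) = 0 := by
    linear_combination e_DPnw_2_0 + e_DPse_m1_0
  have a_DPnw_2_0 : (-(x ^ (2 : ℕ) * t) + x ^ (3 : ℕ) * s + x ^ (6 : ℕ) * s ^ (3 : ℕ)) * (c1 - c6) + (-(x) + x ^ (3 : ℕ) +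
      x ^ (6 : ℕ) * t ^ (2 : ℕ)) * (c2 - c4) +
      (-(x ^ (2 : ℕ) * s) + x ^ (3 : ℕ) * t) * (c3 - c5) = 0 := by
    linear_combination e_DPnw_2_0 - e_DPse_m1_0
  have s_DPnw_1_m1 : (x ^ (2 : ℕ) * t) * (c0 + c0) + (x + x ^ (3 : ℕ) + x ^ (6 : ℕ) * s ^ (2 : ℕ)) * (c1 + c6) + (x ^ (2 : ℕ) * s + x ^ (3 : ℕ) * t +
      x ^ (6 : ℕ) * t ^ (3 : ℕ)) * (c2 + c4) + (x ^ (2 : ℕ) + x ^ (3 : ℕ) * t ^ (2 : ℕ)) * (c3 + c5) = 0 := by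
    linear_combination e_DPnw_1_m1 + e_DPse_0_1
  have a_DPnw_1_m1 : (-(x) + x ^ (3 : ℕ) + x ^ (6 : ℕ) * s ^ (2 : ℕ)) * (c1 - c6) + (-(x ^ (2 : ℕ) * s) + x ^ (3 : ℕ) * t +
      x ^ (6 : ℕ) * t ^ (3 : ℕ)) * (c2 - c4) +
      (-(x ^ (2 : ℕ)) + x ^ (3 : ℕ) * t ^ (2 : ℕ)) * (c3 - c5) = 0 := by
    linear_combination e_DPnw_1_m1 - e_DPse_0_1
  have s_DPne_m1_0 : (x ^ (2 : ℕ)) * (c0 + c0) + (x ^ (2 : ℕ) * t + x ^ (3 : ℕ) * s) * (c1 + c6) + (x + x ^ (3 : ℕ) + x ^ (6 : ℕ) * s ^ (2 : ℕ)) * (c2 +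
      c4) +
      (x ^ (2 : ℕ) * s + x ^ (3 : ℕ) * t + x ^ (6 : ℕ) * t ^ (3 : ℕ)) * (c3 + c5) = 0 := by
    linear_combination e_DPne_m1_0 + e_DPsw_2_0
  have a_DPne_m1_0 : (x ^ (2 : ℕ) * t + -(x ^ (3 : ℕ) * s)) * (c1 - c6) + (x + -(x ^ (3 : ℕ)) + -(x ^ (6 : ℕ) * s ^ (2 : ℕ))) * (c2 - c4) +
      (x ^ (2 : ℕ) * s +
      -(x ^ (3 : ℕ) * t) + -(x ^ (6 : ℕ) * t ^ (3 : ℕ))) * (c3 - c5) = 0 := by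
    linear_combination e_DPne_m1_0 - e_DPsw_2_0
  have s_DPne_0_1 : (x ^ (2 : ℕ) * t) * (c0 + c0) + (x + x ^ (3 : ℕ)) * (c1 + c6) + (x ^ (2 : ℕ) * s + x ^ (3 : ℕ) * t + x ^ (6 : ℕ) * s) * (c2 + c4) +
      (x ^ (2 : ℕ) +
      x ^ (3 : ℕ) * t ^ (2 : ℕ) + x ^ (6 : ℕ) * t ^ (4 : ℕ)) * (c3 + c5) = 0 := by
    linear_combination e_DPne_0_1 + e_DPsw_1_m1
  have a_DPne_0_1 : (x + -(x ^ (3 : ℕ))) * (c1 - c6) + (x ^ (2 : ℕ) * s + -(x ^ (3 : ℕ) * t) + -(x ^ (6 : ℕ) * s)) * (c2 - c4) + (x ^ (2 : ℕ) +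
      -(x ^ (3 : ℕ) * t ^ (2 : ℕ)) + -(x ^ (6 : ℕ) * t ^ (4 : ℕ))) * (c3 - c5) = 0 := by
    linear_combination e_DPne_0_1 - e_DPsw_1_m1
  obtain ⟨msym1_0, msym1_1, msym1_2, msym1_3⟩ := minor_sym1 hs s_DP0_0_1 s_DP0_m1_0 s_DPnw_2_0 s_DPne_m1_0
  obtain ⟨msym2_0, msym2_1, msym2_2, msym2_3⟩ := minor_sym2 hs s_DP0_0_1 s_DPa_1_m1 s_DPnw_1_m1 s_DPne_0_1
  obtain ⟨msym3_0, msym3_1, msym3_2, msym3_3⟩ := minor_sym3 hs s_DP0_m1_0 s_DPab_m1_0 s_DPnw_2_0 s_DPne_m1_0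
  have hmono_sym : (x ^ (19 : ℕ) * t : ℂ) ≠ 0 := mul_ne_zero (pow_ne_zero _ hx) (ht)
  have usym0 : (c0 + c0) = 0 := (mul_eq_zero.1 (cert_sym hs msym1_0 msym2_0 msym3_0)).resolve_left hmono_sym
  have usym1 : (c1 + c6) = 0 := (mul_eq_zero.1 (cert_sym hs msym1_1 msym2_1 msym3_1)).resolve_left hmono_sym
  have usym2 : (c2 + c4) = 0 := (mul_eq_zero.1 (cert_sym hs msym1_2 msym2_2 msym3_2)).resolve_left hmono_sym
  have usym3 : (c3 + c5) = 0 := (mul_eq_zero.1 (cert_sym hs msym1_3 msym2_3 msym3_3)).resolve_left hmono_sym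
  obtain ⟨masym1_0, masym1_1, masym1_2⟩ := minor_asym1 hs a_DP0_0_1 a_DPa_1_m1 a_DPne_0_1
  obtain ⟨masym2_0, masym2_1, masym2_2⟩ := minor_asym2 hs a_DP0_0_1 a_DP0_0_m1 a_DPa_1_m1
  obtain ⟨masym3_0, masym3_1, masym3_2⟩ := minor_asym3 hs a_DP0_m1_0 a_DPa_m1_0 a_DPab_m1_0
  obtain ⟨masym4_0, masym4_1, masym4_2⟩ := minor_asym4 hs a_DPa_m1_0 a_DPa_2_0 a_DPab_m1_0
  obtain ⟨masym5_0, masym5_1, masym5_2⟩ := minor_asym5 hs a_DP0_0_1 a_DP0_m1_0 a_DPne_m1_0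
  have hmono_asym : (x ^ (12 : ℕ) : ℂ) ≠ 0 := pow_ne_zero _ hx
  have uasym0 : (c1 - c6) = 0 := (mul_eq_zero.1 (cert_asym hs masym1_0 masym2_0 masym3_0 masym4_0 masym5_0)).resolve_left hmono_asym
  have uasym1 : (c2 - c4) = 0 := (mul_eq_zero.1 (cert_asym hs masym1_1 masym2_1 masym3_1 masym4_1 masym5_1)).resolve_left hmono_asym
  have uasym2 : (c3 - c5) = 0 := (mul_eq_zero.1 (cert_asym hs masym1_2 masym2_2 masym3_2 masym4_2 masym5_2)).resolve_left hmono_asym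
  refine ⟨?_, ?_, ?_, ?_, ?_, ?_, ?_⟩
  · linear_combination usym0 / 2
  · linear_combination (usym1 + uasym0) / 2
  · linear_combination (usym2 + uasym1) / 2
  · linear_combination (usym3 + uasym2) / 2
  · linear_combination (usym2 - uasym1) / 2
  · linear_combination (usym3 - uasym2) / 2
  · linear_combination (usym1 - uasym0) / 2

end NoDominoRelation

/-! ### The theorem -/

/-- `t = e^{-iσπ/2}` is non-zero. [folklore] -/
private theorem NoDominoRelation.tOf_ne_zero (σ : ℝ) : NoVertexRelation.tOf σ ≠ 0 := by
  intro h
  have := NoVertexRelation.norm_tOf σ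
  rw [h, norm_zero] at this
  exact zero_ne_one this

/-- **The uniform square-lattice SAW observable admits NO exact two-vertex (domino) stencil relation
with constant coefficients**, at any fugacity `x ≠ 0` and any spin `σ`: an exact domino relation
forces `c = 0`. Twenty-two explicit finite domains suffice — the domino with its six outer neighbours
as pendant leaves, with zero, one or two of the adjacent unit squares closed, rooted at boundary
vertices, in `R180`-pairs (`NoDominoRelation.inst_DP0_0_1` …, kernel-checked walk enumerations),
followed by the elimination `NoDominoRelation.core`. This is the smallest multi-vertex extension of
the refuted one-vertex relation (`not_hasExactVertexRelationZ2`, Duminil-Copin–Smirnov's Lemma 1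
shape), i.e. the pre-registered class S-Z2-2a (horizontal domino, seven slots) made range-free.
[cite: DuminilCopinSmirnov2012, Lemma 1 (shape of the relation, one vertex; two-vertex square-lattice counterpart refuted here)]
[cite: GlazmanManolescu2019, p. 1 (no well-behaved observable expected on the square lattice)] -/
theorem exactDominoRelationZ2_eq_zero {x σ : ℝ} {c : Fin 7 → ℂ} (hx : x ≠ 0)
    (h : ExactDominoRelationZ2 x σ c) : c = 0 := by
  obtain ⟨h0, h1, h2, h3, h4, h5, h6⟩ := NoDominoRelation.core (x := (x : ℂ)) (t := NoVertexRelation.tOf σ)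
    (by exact_mod_cast hx) (NoDominoRelation.tOf_ne_zero σ)
    (NoDominoRelation.inst_DP0_0_1 h) (NoDominoRelation.inst_DP0_1_m1 h)
    (NoDominoRelation.inst_DP0_m1_0 h) (NoDominoRelation.inst_DP0_2_0 h)
    (NoDominoRelation.inst_DP0_0_m1 h) (NoDominoRelation.inst_DP0_1_1 h)
    (NoDominoRelation.inst_DPa_1_m1 h) (NoDominoRelation.inst_DPb_0_1 h)
    (NoDominoRelation.inst_DPa_m1_0 h) (NoDominoRelation.inst_DPb_2_0 h)
    (NoDominoRelation.inst_DPa_2_0 h) (NoDominoRelation.inst_DPb_m1_0 h)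
    (NoDominoRelation.inst_DPab_m1_0 h) (NoDominoRelation.inst_DPab_2_0 h)
    (NoDominoRelation.inst_DPnw_2_0 h) (NoDominoRelation.inst_DPse_m1_0 h)
    (NoDominoRelation.inst_DPnw_1_m1 h) (NoDominoRelation.inst_DPse_0_1 h)
    (NoDominoRelation.inst_DPne_m1_0 h) (NoDominoRelation.inst_DPsw_2_0 h)
    (NoDominoRelation.inst_DPne_0_1 h) (NoDominoRelation.inst_DPsw_1_m1 h)
  funext i; fin_cases i <;> simp [h0, h1, h2, h3, h4, h5, h6]

/-- The hypothesis `x ≠ 0` is necessary: at `x = 0` the observable vanishes identically (every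
term carries `x^{n+1}`), so every `c` satisfies the relation.
[cite: DuminilCopinSmirnov2012, §2, Definition 1 (weight `x^{ℓ(γ)}` of the observable)] -/
theorem exactDominoRelationZ2_zero_fugacity (σ : ℝ) (c : Fin 7 → ℂ) :
    ExactDominoRelationZ2 0 σ c := by
  intro Ω δ a v _ _ _ _
  have hF : ∀ e, midEdgeParafermionicObservable Ω δ a 0 σ e = 0 := by
    intro e
    induction e using Sym2.ind with
    | h z w => simp [midEdgeParafermionicObservable_mk, halfEdgeTerm]
  simp [dominoFunctionalZ2, hF]

/-- The technique class is non-vacuously typed: with zero coefficients every relation holds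
(which is why the barrier statement concludes `c = 0`).
[cite: DuminilCopinSmirnov2012, Lemma 1 (shape of the relation)] -/
theorem exactDominoRelationZ2_zero (x σ : ℝ) : ExactDominoRelationZ2 x σ 0 := by
  intro Ω δ a v _ _ _ _
  simp [dominoFunctionalZ2]

/-! ### The barrier -/

/-- **Barrier `NoExactDominoRelationZ2`** (companion of `NienhuisWeightsExcludeVertexSAW`, whose audit
appendices refute the one-vertex relation, of `NoExactPlaquetteRelationZ2` (the face) and of
`NoExactBoundaryRelationZ2` / `NoExactStripRelationZ2Width` (boundary and strip identities); it fills
the scope caveat (b) "larger or multi-vertex stencils" of the first for the smallest multi-vertex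
stencil): the uniform square-lattice SAW mid-edge parafermionic observable admits NO exact relation
`Σ_{k<7} c_k F(slot_k) = 0` over the seven mid-edges adjacent to a horizontal domino `{v, v + e₀}` with
slot-indexed, domain-, root- and position-independent coefficients `c ≠ 0`, at any fugacity `x ≠ 0`
and any spin `σ`. This is a THEOREM of this file (`NoExactDominoRelationZ2_holds`, from twenty-two
explicit finite domains), not a cited claim; by the lattice symmetry `x ↔ y` the same holds for
vertical dominoes.

BARRIER (structured block, D-0021):
- technique_class: discrete-holomorphicity parafermionic-observable exact-local-relation multi-vertex-stencil — explicitly the predicate `ExactDominoRelationZ2 x σ c` (for every discrete domain `Ω_δ ⊆ δℤ²`, boundary root `a` and horizontal domino whose seven adjacent mid-edges are edges of `Ω_δ`, `dominoFunctionalZ2 Ω δ a v x σ c = Σ_k c_k F({base_k, base_k + dir_k}) = 0` for the observable `Literature.Probability.RandomPlanarGeometry.SAW.midEdgeParafermionicObservable`; slots: the shared edge, the three other edges at `v`, the three other edges at `v + e₀`)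
- blocks: repairing the failure of the one-vertex Duminil-Copin–Smirnov relation on `ℤ²` (`not_hasExactVertexRelationZ2`) by passing to a TWO-vertex stencil with more free coefficients (seven instead of four) — the first step of the "larger stencil" evasion — as the local input of a DCS-type computation of `μ(ℤ²)` or of the scaling limit of the observable (route `SAWParafermion`, guard `NoExactVertexRelation`; the scaling-limit programme of DCS §4 transposed to `ℤ²`) [cite: DuminilCopinSmirnov2012, Lemma 1 and §4] [cite: GlazmanManolescu2019, p. 1]
- because: any such relation must hold on every finite domain with a boundary root and every admissible domino; evaluating the library's observable exactly on twenty-two small domains (the domino with its six outer neighbours as leaves, plus zero, one or two closed adjacent unit squares; kernel-checked enumerations `NoDominoRelation.terms_…`) yields linear forms in `c` whose only common zero, for every complex `x ≠ 0` and `t = e^{-iσπ/2} ≠ 0`, is `c = 0` (`NoDominoRelation.core`): the rotation by `π` about the domino's centre splits `c` into the symmetric part `(2c₀, c₁ + c₆, c₂ + c₄, c₃ + c₅)` and the antisymmetric part `(c₁ - c₆, c₂ - c₄, c₃ - c₅)`, and in each part a handful of maximal minors of the row matrix, expanded by cofactors, generate a monomial `x^a t^b` with explicit multipliers (exact Nullstellensatz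 certificates over `ℚ`); mechanism: the bare tree (domino + six leaves, rooted at each leaf) already has rank `6` of `7` — it forces the two-vertex analogue of the discrete Cauchy–Riemann stencil — and the rank-`7` completion needs walks returning around a closed unit square; the sparsest minors share the spurious common zeros `t²⁰ = 1`, `x ∈ {±1, ±(3 ± √5)/2}`-type points (symmetric part) and `(x, t) ∈ {(1, 1), (-1, i), (1, -1)}` (antisymmetric part), removed by minors involving two closed squares; on `ℤ²` the one-vertex relation fails by the two inequivalent loop-return classes of a degree-4 vertex (`NienhuisWeightsExcludeVertexSAW`, because-field), and the second vertex does not restore it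
- evasions_known: still larger stencils (the `2 × 2` block with twelve slots, the plus with sixteen — classes S-Z2-2b/2c of the lane's search protocol, EMPTY on finite tables but not theorems), relations with position-dependent coefficients or explicit remainder terms, observables of MODIFIED walks (Yang–Baxter weights: `Literature.Probability.RandomPlanarGeometry.SAW.YangBaxter.GlazmanManolescu2019_thm1`) [cite: GlazmanManolescu2019, Theorems 1–3], asymptotic / scaling-limit statements [cite: DuminilCopinSmirnov2012, §4], inexact numerical identities [cite: BeatonGuttmannJensen2012, pp. 2, 5] — none is of the excluded shape
- scope_caveats: EXCLUDED is exactly the predicate `ExactDominoRelationZ2 x σ c` with `x ≠ 0` real, `σ` real, `c : Fin 7 → ℂ` constant (the SAME seven coefficients on every finite discrete domain, for every boundary root and every horizontal domino whose seven adjacent mid-edges are domain edges — the outer endpoints of the six outer slots need not have further neighbours, and the root may be one of them; all twenty-two instances are trees or trees with one or two closed unit squares, rooted at a leaf or at a degree-2 boundary vertex); vertical dominoes follow by the diagonal reflection of `ℤ²` (not restated); `x = 0` is genuinely exceptional (`exactDominoRelationZ2_zero_fugacity`); NOT excluded: see evasions_known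
- status: established — `NoExactDominoRelationZ2_holds` (this file; positive form `exactDominoRelationZ2_eq_zero`); the cited sources record that no appropriate observable is known for the uniform square-lattice walk [cite: GlazmanManolescu2019, p. 1] [cite: BeatonGuttmannJensen2012, p. 2]
[cite: DuminilCopinSmirnov2012, Lemma 1 (shape of the relation, one vertex)] -/
def NoExactDominoRelationZ2 : Prop :=
  ∀ (x σ : ℝ) (c : Fin 7 → ℂ), x ≠ 0 → ExactDominoRelationZ2 x σ c → c = 0

/-- **The barrier statement holds.**
[cite: DuminilCopinSmirnov2012, Lemma 1 (shape of the relation; two-vertex square-lattice counterpart refuted here)] -/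
theorem NoExactDominoRelationZ2_holds : NoExactDominoRelationZ2 :=
  fun _ _ _ hx h => exactDominoRelationZ2_eq_zero hx h

end Literature.Barriers.CriticalPhenomena

/-! ## Appendix V: a one-vertex relation is a domino relation — the vertex no-go at every fugacity `x ≠ 0`

Zero-extension of the coefficients embeds the one-vertex class `ExactVertexRelationZ2` (the `ℤ²`
shape of Duminil-Copin–Smirnov's Lemma 1: four coefficients on the four mid-edges of a vertex) into
`ExactDominoRelationZ2`: the four edges of `v` are the domino slots `0–3`, and a domino whose seven
adjacent mid-edges are domain edges has in particular the four neighbours of `v` joined to `v`. Hence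
`exactDominoRelationZ2_eq_zero` yields the one-vertex no-go for EVERY real fugacity `x ≠ 0` and every
spin, whereas `exactVertexRelationZ2_eq_zero` (Appendix A of `NienhuisWeightsExcludeVertexSAW`) and
`NoExactVertexRelationZ2SC_holds` are stated for `0 < x < 1`. -/

namespace Literature.Barriers.CriticalPhenomena

open Literature.Probability.RandomPlanarGeometry.SAW Literature.Probability.LatticeModels
  Literature.Probability.Percolation

/-- **Zero-extension: a one-vertex relation is a domino relation.** If `c : Fin 4 → ℂ` is an exact
vertex relation (`ExactVertexRelationZ2 x σ c`), then `(c₀, c₁, c₂, c₃, 0, 0, 0)` is an exact domino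
relation: on every admissible domino the domino functional reduces to the vertex relation at `v`.
[cite: DuminilCopinSmirnov2012, Lemma 1 (shape of the relation, one vertex)] -/
theorem exactDominoRelationZ2_of_vertex {x σ : ℝ} {c : Fin 4 → ℂ} (h : ExactVertexRelationZ2 x σ c) :
    ExactDominoRelationZ2 x σ ![c 0, c 1, c 2, c 3, 0, 0, 0] := by
  intro Ω δ a v hδ ha hw hadj
  have hv := h Ω δ a v hδ ha hw (fun i => by
    fin_cases i
    · simpa [dominoBase, dominoDir] using hadj 0
    · simpa [dominoBase, dominoDir] using hadj 1
    · simpa [dominoBase, dominoDir] using hadj 2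
    · simpa [dominoBase, dominoDir] using hadj 3)
  unfold dominoFunctionalZ2
  rw [Fin.sum_univ_seven]
  rw [Fin.sum_univ_four] at hv
  simp only [dominoBase, dominoDir, Matrix.cons_val_zero, Matrix.cons_val_one, Matrix.head_cons,
    Matrix.cons_val_two, Matrix.tail_cons, Matrix.cons_val_three, Matrix.cons_val_four] at hv ⊢
  simp at hv ⊢
  linear_combination hv

/-- **The Duminil-Copin–Smirnov-shape vertex relation on `ℤ²` is empty at EVERY real fugacity `x ≠ 0`
and every spin** (the tree's `exactVertexRelationZ2_eq_zero` and `NoExactVertexRelationZ2SC_holds`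
assume `0 < x < 1`): an exact vertex relation extends by zeros to a domino relation
(`exactDominoRelationZ2_of_vertex`), which forces all coefficients to vanish
(`exactDominoRelationZ2_eq_zero`).
[cite: DuminilCopinSmirnov2012, Lemma 1 (shape of the relation; square-lattice counterpart refuted for all real `x ≠ 0`)] -/
theorem exactVertexRelationZ2_eq_zero_of_ne_zero {x σ : ℝ} {c : Fin 4 → ℂ} (hx : x ≠ 0)
    (h : ExactVertexRelationZ2 x σ c) : c = 0 := by
  have h7 := exactDominoRelationZ2_eq_zero hx (exactDominoRelationZ2_of_vertex h)
  funext i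
  fin_cases i
  · simpa using congrFun h7 0
  · simpa using congrFun h7 1
  · simpa using congrFun h7 2
  · simpa using congrFun h7 3

end Literature.Barriers.CriticalPhenomena
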